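import Summits.BirchSwinnertonDyer.BirchSwinnertonDyer.Theses.ErratumRoadFive
import Literature.NumberTheory.EllipticCurves.Kato2004.AdmissibleZetaClassRealisability
import Literature.NumberTheory.EllipticCurves.Kato2004.AdmissibleZetaClassLengthInequality
import Literature.NumberTheory.EllipticCurves.Kato2004.IwasawaH2FineSelmerDualCountRankFree
import Literature.NumberTheory.EllipticCurves.MordellWeilTheoremProofs
import Literature.NumberTheory.EllipticCurves.TateModuleContinuityProofs
import Literature.NumberTheory.EllipticCurves.LeadingTerm
import Literature.NumberTheory.EllipticCurves.Rank1Residual.Typed.Basic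
import Literature.NumberTheory.EllipticCurves.CongruenceNumber
import Literature.NumberTheory.EllipticCurves.GrossZagierRationalPointProofs
import Literature.NumberTheory.EllipticCurves.Castella2018.PAdicWaldspurgerFormula
import Summits.BirchSwinnertonDyer.Rank1Residual.X11b.AnticyclotomicEmbedding
import Summits.BirchSwinnertonDyer.Rank1Residual.X11b.HalvesReceptacle
import Summits.BirchSwinnertonDyer.Rank1Residual.X11b.RouteR1BDPValue
import Literature.NumberTheory.EllipticCurves.ZpExtensionAnticyclotomicHoldsProofs
import Literature.NumberTheory.EllipticCurves.UnrIntegersUnits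
import Literature.NumberTheory.EllipticCurves.PastenSpectralDegreeProofs
import Literature.NumberTheory.EllipticCurves.NeronIsogenyScalingHoldsProofs
import Summits.BirchSwinnertonDyer.Rank1Residual.X11b.BDPRouteManin
import Literature.FieldTheory.AlgClosed.PadicAlgClEquivComplex
import Literature.NumberTheory.EllipticCurves.KrausOesterle1992.TorsionCongruenceCriterionHasseWeilProofs
import Summits.BirchSwinnertonDyer.BirchSwinnertonDyer.Theorems.CongruentShaFreeCutKatoKummerLogTorsion
import Literature.NumberTheory.QuadraticFields.ImaginaryResiduePiForm
import Summits.BirchSwinnertonDyer.BirchSwinnertonDyer.Theorems.ErratumRoadFiveGrossZagierDescentExact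
import Summits.BirchSwinnertonDyer.BirchSwinnertonDyer.Theorems.ErratumRoadFiveKatoFframeValueAtoms
import Summits.BirchSwinnertonDyer.BirchSwinnertonDyer.Theorems.ErratumRoadFiveKatoFframeValueAtomsOfFamily
import Summits.BirchSwinnertonDyer.BirchSwinnertonDyer.Theorems.ErratumRoadFiveValueByNormContinuity
import Literature.NumberTheory.EllipticCurves.BDPValueContinuityMultiplicativePrime
import Summits.BirchSwinnertonDyer.BirchSwinnertonDyer.Theorems.ErratumRoadFiveOpenInputNotRamBDPFrameDescentStub
import Literature.NumberTheory.EllipticCurves.StrictSelmerRankOneDegreeOneProofs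
import HarnessLib

/-!
# Door skeleton (rev 3.9) — crux idea `bstw-zeta-nonsplit-door` for S3ns (`KatoFframe.stub_integralNonsplitValue`); since rev 3.8 BOTH signs (also S3, `stub_valuationIneqSplit`)

NOT a registered line of the crux and NOT a skeleton of the crux (the line of record of
`EulerHalfNotRamNoInertSetAtFive` is `Lines/kato_Fframe_r5.lean` — since 2026-08-30T13:07:30Z the r5.7 bytes `f297f72a3565a6d8`,
keyed by pen bsd-stepL-plan g50 (r5.6 `bd976d191c265a9a` 10:34Z–13:07Z), registered stubs {`stub_printedFactsHeld`,
`stub_valuationIneqSplit : Theses.ErratumRoadFive.KatoValuationIneqSplitAtFive`, `stub_valuationIneqNonsplit :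
Theses.ErratumRoadFive.KatoValuationIneqNonsplitAtFive`} — r5.7 binds the two research atoms BY NAME to route ER5's aside items
33168 ∕ 33169 (rev 80, director-bsd (560)(1) (α2)), whose bodies are r5.6's atom texts verbatim; rev 3.9's §6 below DOCKS at them BY NAME;
r5.5's S3ns `stub_integralNonsplitValue` survives there as a THEOREM of the atoms): this file decomposes ONE research stub of
that line — the non-split atom `stub_valuationIneqNonsplit`, born as S3ns `stub_integralNonsplitValue` (r5.5 l.677–687: `x ∈ X11b`, `p ≥ 5`,
`ρ̄` onto, `p` NON-split multiplicative; "a `(q, t)` with `log_BK z_ℚ = t ≠ 0` and `ord_p t − 2 ord_p log_ω x̂ ≤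
ord_p Ш_an + ord_p Tam − 2 ord_p #tors − 1`") — into THREE named sorried stubs (one bundle of cites, one PRINT-SHAPED
anticyclotomic half, one RESEARCH cyclotomic half), two theorems PROVED sorry-free (the classical Gross–Zagier half B,
by name from the landed helper; the crossing A from its two halves) and kernel-checked compositions — since rev 3.4, DOCKED to
the LEAD's atomisation of S3ns: `valuationIneqNonsplit_of_stubs : <r5.6 stub_valuationIneqNonsplit verbatim>` (the pure
valuation inequality = binder `hVnonsplit` of `ErratumRoadFiveKatoFframeValueAtoms.integralNonsplitValue_of_atoms`, p766845 —
since 10:34:10Z THE REGISTERED research stub; re-verified against the tree bytes, 821/821 chars whitespace-normalised)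
and `integralNonsplitValue_of_stubs (hNZ : <hNZnonsplit verbatim>) : <r5.5 S3ns verbatim>` (= the statement of r5.6's derived
theorem `stub_integralNonsplitValue`, 746/746).  History: rev 1 (`BstwZetaNonsplitDoorSketch.lean` commit
78c9da81) typed the content as ONE `def … : Prop` identity + Ribet; critic V318 P1 asked for `theorem stub_… := by
sorry` consumed by name — paid in rev 2 (92ae4419), which separated the classical Gross–Zagier half B from the `p`-adic
half A; rev 2.1 (2cb89312) proved B in this file; rev 2.2 (d6a06155) consumes B BY NAME from the landed helper
`Theorems/ErratumRoadFiveGrossZagierDescentExact.lean` (p766762, commit b9596a61f4f1); rev 3 (0a12b2d9) splits the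
research stub A along the line BSTW themselves cross — the anticyclotomic `p`-adic `L`-value `X = L_𝔭(f)(𝟙)` of
Bertolini–Darmon–Prasanna / Castella, typed on the TREE's predicate `IsBDPLFunction` (Castella 2018 Thm. 3.1 = A206,
the object of the X11b cell's route R1) — into A♯ (PRINT-SHAPED: a BDP frame exists and `L_𝔭(f)(𝟙) = u·((1 −
a_p/p)·log_ω P_L/c)²`, Castella 2018 Thm. 3.2 at `p ∣ N` + [Castella 2024, arXiv:2409.01360, Cor. 2.3] at NON-split
`p`; for semistable curves literally the tree fact `Castella2018.thm32_exists_isBDPLFunction_valueAtOne` + Steinitz +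
`ZpExtension.exists_isAnticyclotomic_holds`) and A♭ (RESEARCH: Kato's bottom layer against `X` — BSTW's
(comp-with-Kato) + (GRL) at a Steinberg `p`, the gaps G1/G2), and PROVES the rev-2 crossing A from A♯ + A♭;
rev 3.1 (bae237a9) reads the Heegner presentation through the PLACE embedding `w₀.embedding` with the frame's
prime the X11b cell's canonical `𝔭_{ι′} = X11b.primeOfEmbeddingDatum p ι′ w₀.embedding` (the composition moves an
arbitrary presentation `(ι, P_L)` there by `Gal(L/ℚ)`: `ι = w₀.embedding ∘ τ`, `P_L ↦ τ_* P_L`), and DISCHARGES A♯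
for SEMISTABLE curves with `p ∤ c` from the tree fact (theorem `bdpFrameValue_of_thm32`, sorry-free);
rev 3.2 (e1bb7be3) (i) CHOOSES THE DATUM `Dt` WITH MANIN CONSTANT PRIME TO `p` (Mazur 1978 Cor. 4.1 — a fifth S0′
conjunct `mazur_not_dvd_maninConstant_of_odd` — and the tree THEOREM `integral_neronScaling_of_isGloballyMinimal_holds`,
assembled by the X11b cell's `X11b.exists_modularParametrizationData_not_dvd`), so A♯ / A♭ / A carry `p ∤ c(Dt)` and A♯
is then EXACTLY the tree's named fact `thm32` up to its square-free-`N` typing (hence discharged on every SEMISTABLE member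
of X11b); (ii) reads the `L`-rational Heegner point DIRECTLY through the place embedding (Darmon 2004 Thm. 3.6 = tree
theorem `heegnerPointComplex_mem_range_map_holds`, with `exists_dvd_sq_sub_discr_holds`, `nonempty_heegnerDatum_holds`),
so rev 3.1's `Gal(L/ℚ)` move disappears from the composition; (iii) takes `r_f ≠ 0` OUT of the research stub A♭ (tree
theorem, Pasten–Shimura); rev 3.3 (710a2620) moves Castella's Thms. 3.1–3.2 INTO S0′ as the sixth tree-named printed
fact (`Castella2018.thm32_exists_isBDPLFunction_valueAtOne`, the X11b cell's A206) and the embedding datum `ℚ̄_p ≃ ℂ` is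
the tree THEOREM `PadicAlgCl.nonempty_ringEquiv_complex`, so A♯ holds OUTRIGHT on the semistable members
(`bdpFrameValue_of_semistable`, sorry-free) and the print-shaped stub SHRINKS to the NON-semistable members
(`stub_bdpFrameValueNonsplitNonSemistable`); `bdpFrameValue (h32)` = rev 3.2's A♯ verbatim, by cases;
rev 3.4 (394ded34) DOCKS the door to the LEAD's ATOMISATION of S3ns (bsd-line-er5-p1 g10/g11: p766845
`Theorems/ErratumRoadFiveKatoFframeValueAtoms`, p768140 `Theorems/ErratumRoadFiveKatoFframeNonvanishingOfPrint`, r5.6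
candidate `Lines/kato_Fframe_r5_6_candidate.lean`): of S3ns's four conjuncts `∃ q` is B (GZ86 I.(7.3)), `∃ t` is the tree
THEOREM `ErratumRoadFiveKatoFframeValueAtoms.exists_hasLocPKummerLog_bottomClass` (Kummer theory in positive rank), `t ≠ 0`
is PRINT (Bertolini–Darmon–Venerucci 2022 Thm. A — the binder `hNZnonsplit`), and the research is the PURE VALUATION
INEQUALITY (`hVnonsplit` = r5.6's `stub_valuationIneqNonsplit`); accordingly A♭ no longer concludes `∃ t, … ∧ t ≠ 0 ∧ …` but
the VALUE IDENTITY for EVERY Kummer logarithm `t ≠ 0` of the bottom layer (a strictly SMALLER research stub: existence and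
non-vanishing of `t` are taken OUT), A is re-proved in that currency, and §3 proves from ONE core theorem BOTH
`valuationIneqNonsplit_of_stubs : <r5.6 stub_valuationIneqNonsplit verbatim>` (hypothesis-free modulo the three stubs) and
`integralNonsplitValue_of_stubs (hNZ) : <r5.5 S3ns verbatim>` (`hNZ` = `hNZnonsplit` verbatim, discharged today by
`ErratumRoadFiveKatoFframeNonvanishingOfPrint.kummerLog_ne_zero_nonsplit_of_bdv`, p768140); rev 3.5 SPLITS the
print-shaped residual A♯-res of revs 3.3–3.4 along the cell `bsd-stepL`'s (VN_p) series (p433271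
`Theorems/ErratumRoadFiveValueByNormContinuity`, `Theorems/ErratumRoadFiveNormContinuityFromPrint`): its VALUE clause is PRINT
for ANY conductor — Castella, J. Inst. Math. Jussieu 17 (2018) Thms. 2.10–2.11, value continuity of the BDP `p`-adic
`L`-function at `𝟙` for `p ∥ N` = the tree's named fact `castella2018Exceptional_bdpValueContinuity_trivialChar` (route ER5's
by-name item `BDPValueContinuityInput`; a SEVENTH S0′ conjunct) — plus two tree THEOREMS, one-sided norm rigidity
`intSeries_norm_constantCoeff_eq_of_isBDPLFunctionInt_of_continuousNorms` and `exists_unit_unrIntegers_mul_eq_of_norm_eq`; so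
the residual stub SHRINKS to bare `R₀`-FRAME EXISTENCE `stub_bdpFrameNonsplitNonSemistable` (A♯-frame: `IsBDPLFunction` for
`(f, L, p)` at a non-semistable X11b member — Cas18 Thm. 3.1 ∕ A206 with `Squarefree N` relaxed; in print only for semistable
`E`, in general the cell's refereed memo THEOREM C♯ = the remaining content of ER5's item `BDPValueCoreFramesAll` at these
data), and `bdpFrameValue_of_frame (hVC)` PROVES revs 3.3–3.4's A♯-res statement — with ONE extra binder, `P_L` of
infinite order, which the composition gets from B at the embedding `X11b.embAt` and `log_ω x̂ ≠ 0` — from it; rev 3.6 (16f3301d;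
rev 3.6.1 = 03348d43) RE-TYPES the residual frame stub IN PRINT SHAPE — `stub_bdpFramePrintMultiplicative`, the statement of the
X11b cell's A206 `castella2018_exists_isBDPLFunction` with `Squarefree N` REPLACED by Castella 2024's standing hypotheses
(arXiv:2409.01360 §2.1 p. 5: ANY conductor `N`, `p ∥ N` multiplicative, `p > 3`, `K` of odd discriminant `< −4` with the
classical Heegner hypothesis; §2.3 p. 6: «`L_𝔭(f) ∈ Λ_{R₀}` the `p`-adic Rankin `L`-function of BDP, as extended in [hsieh,
cas-split] to the `p`-multiplicative case» — the frame IN PRINT BY CITATION for every conductor), PROVES rev 3.5's door-data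
frame from it on ALL of X11b (`bdpFrame_of_print`), and CORRECTS rev 3.5's attribution of the frame debt to ER5's item
`BDPValueCoreFramesAll` (19275): that item quantifies over ERRATUM data (an `E[p]`-ramified multiplicative `q ≠ p`, an erratum
field) and its pointwise shape is VACUOUS on this crux's `¬Ram` class — certified: `r1_bdpValueCoreFrameOnTree_of_not_ram`;
rev 3.7 (b5e40f0c84f0) DOCKS THE RESEARCH STUB AT THE
FAMILY LEVEL — the LEAD's THIRD currency (bsd-line-er5-p1 g12: p768925 `Theorems/ErratumRoadFiveKatoFframeAdmissibleLogTransfer`,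
p769350 `Theorems/ErratumRoadFiveKatoFframeValueAtomsOfFamily`, «a research/door seat should start from
`valuationIneq{Split,Nonsplit}_of_family`»): A♭ is now stated on the bottom class of the Λ-adic lift `y` of a VALUE-PINNED KATO
FAMILY `(f, ι, q, Λ, c, d₁, a, A, d′, z, x)` (`ZetaBody`; Kato Thm. 12.5 (1) / Ex. 13.3 — Kato's OWN classes `z_{γ,c,d}`, the object
BSTW's (comp-with-Kato) is literally about), with Kato's constants `q`, `R⁻_𝟙 = ratCuspFactor`, `∏_{ℓ∣A, ℓ≠p} P_ℓ(ℓ⁻¹)` and the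
period ratio `λ` (`Ω⁺_f = λ·Ω_E`) EXPLICIT in the exponent — `stub_katoBdpCrossingNonsplitFamily` (A♭-fam) — and revs 3.4–3.6's
admissible-class A♭ becomes the THEOREM `katoBdpCrossingNonsplit_of_family` (one binder added: positive rank, which the composition
has from `h1`) by the LEAD's TRANSFER `exists_family_kummerLog_transfer_of_isAdmissibleZetaClass` (`v(t) = v(σ) +
v_p(λ/(q·R⁻_𝟙·∏P_ℓ))`); A and the core are proved ONCE at an abstract exponent `v` and instantiated in both currencies, so the
compositions reach BOTH docking targets: `famValuationIneqNonsplit_of_stubs : <hFamNonsplit of valuationIneqNonsplit_of_family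
VERBATIM>` and — through that LEAD theorem BY NAME — `valuationIneqNonsplit_of_stubs : <r5.6 stub_valuationIneqNonsplit VERBATIM>`;
rev 3.8 (9249710bebad) serves BOTH SIGNS: the anticyclotomic half A♯, the classical half B and the crossing ∕ core glue never used the
sign of `a_p` (Castella JIMJ 2018 is natively the `a_p = +1` case; `ord_p(1 − a_p p⁻¹) = −1` for both signs; the LEAD typed both r5.6
atoms with the identical right-hand side) — their unused binder `¬ split` is DROPPED and the decls renamed sign-free (`bdpFrame_of_print`,
`bdpFrameValue_of_frame ∕ _of_thm32 ∕ _of_semistable`, `bdpFrameValue`, `bstwCrossing_of_normIdentity`, `valuationIneq_core_of_crossing`;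
statements otherwise unchanged) — and a FOURTH stub, the SPLIT twin `stub_katoBdpCrossingSplitFamily` (A♭-fam-split: A♭-fam's text with the
flag flipped; RESEARCH WITHOUT a printed mechanism — at `a_p = +1` both of BSTW's displayed relations degenerate, see its docstring), feeds
the split instances `katoBdpCrossingSplit_of_family`, `bstwCrossingSplitFamily`, `bstwCrossingSplit`, `valuationIneqSplitFamily_core`,
`valuationIneqSplit_core` and the §3b compositions `famValuationIneqSplit_of_stubs : <hFamSplit of valuationIneqSplit_of_family VERBATIM,
1984/1984>`, `valuationIneqSplit_of_stubs : <r5.6 stub_valuationIneqSplit VERBATIM, 819/819>` (through that LEAD theorem BY NAME),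
`valuationIneqSplit_of_stubs'` and `integralExcZeroValue_of_stubs (hNZsplit : <verbatim, 466/466>) : <r5.5 S3 verbatim, 744/744>`;
rev 3.9 (this file) CLOSES THE TYPER TARGET FROM REFEREED PRINT HELD BY NAME — and CORRECTS revs 3.5–3.8: the print-shaped residual
A♯-print (the BDP `R₀`-frame at a multiplicative `p ≥ 5`, ANY conductor) is a THEOREM of two REFEREED tree named facts, (H14)
`hsieh2014_exists_anticyclotomicPAdicLFunction_unrPeriod` (Hsieh, Doc. Math. 19 (2014), Thm. A = Thms. 5.6–5.7 with the period
`Ω_p ∈ 𝒲^×`; `p` odd, `p² ∤ N` — `p ∥ N` ALLOWED) and (R) `bertoliniDarmonPrasanna2013_centralValue_reciprocity` (BDP, Duke 162 (2013),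
Thm. 5.5 with its proof) — now S0′'s EIGHTH and NINTH conjuncts, exactly the pair route ER5's crux `OpenInputNotRam` (19282) line consumes —
via the CELL'S OWN `R₀`-DESCENT `exists_isBDPLFunction_of_hsieh2014_unrPeriod_of_bdp2013`
(`Theorems/ErratumRoadFiveOpenInputNotRamBDPFrameDescentStub.lean`, seat nram2 g2, landed 2026-08-26 — i.e. BEFORE revs 3.5–3.8, whose
«NOT a tree fact today … existence asserted in print BY CITATION only» was therefore INCOMPLETE and is CORRECTED here) plus three lines of
plumbing (`p ∣ N`, `p² ∤ N` from multiplicative reduction; `p` split from the all-split Heegner hypothesis; `e(𝔭|p) = f(𝔭|p) = 1`):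
`bdpFramePrintMultiplicative_of_descent`. Castella 2024 §2.3's by-citation sentence, typed meanwhile as the flagged named fact
`Castella2024.exists_isBDPLFunction_multiplicative` (p774890, flag C23-cite), is thereby a COROLLARY of (H14) ∧ (R)
(`Theorems/ErratumRoadFiveBDPFramePrintMultiplicativeOfHsiehBDP.lean`, p775634) and is load-bearing NOWHERE in this file. Sorries drop from
four to THREE (S0′, A♭-fam, A♭-fam-split): the door's ENTIRE non-research content is REFEREED print held by name; in the docstrings
below read «S0′ ∧ A♯-print» as «S0′» (nothing else changes; every statement outside S0′ is rev 3.8's verbatim). Rev 3.9 also DOCKS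
AT THE r5.7 REGISTRY BY NAME (§6): since 13:07:30Z the registered atoms are `stub_valuationIneqSplit :
Theses.ErratumRoadFive.KatoValuationIneqSplitAtFive` and `stub_valuationIneqNonsplit : Theses.ErratumRoadFive.KatoValuationIneqNonsplitAtFive`
(route ER5's aside items 33168 ∕ 33169, bodies = r5.6's atom texts verbatim; LEAD er5-p1 g17 `blocked-on: 33168 ∧ 33169`), and
`katoValuationIneqNonsplitAtFive_of_stubs : KatoValuationIneqNonsplitAtFive := valuationIneqNonsplit_of_stubs` (modulo S0′ ∧ A♭-fam),
`katoValuationIneqSplitAtFive_of_stubs : KatoValuationIneqSplitAtFive := valuationIneqSplit_of_stubs` (modulo S0′ ∧ A♭-fam-split) reach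
those ITEMS by name (definitional unfolding only):

* `stub_printedFactsHeldNonsplit` (S0′, CITE, S-sized): nine tree NAMED FACTS consumed by name (seven through rev 3.8) — modular
  parametrisations exist (BCDT Thm. A (6)), Hoffstein–Luo non-vanishing of a twist with prescribed splitting, the
  Gross–Zagier theorem `gross_zagier`, Ribet's `m_E ∣ r_E` (`modularDegree_dvd_congruenceNumber`, ARS12 Thm 2.1),
  Mazur's `p ∤ c₀` (`mazur_not_dvd_maninConstant_of_odd`, Mazur 1978 Cor. 4.1), Castella's BDP frame + Waldspurger
  value for semistable curves (`Castella2018.thm32_exists_isBDPLFunction_valueAtOne`, Cas18 Thms. 3.1–3.2 = A206), and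
  (since rev 3.5) Castella's value continuity at `𝟙` for `p ∥ N`, ANY conductor
  (`castella2018Exceptional_bdpValueContinuity_trivialChar`, Cas18-JIMJ Thms. 2.10–2.11 = ER5's `BDPValueContinuityInput`), and
  (since rev 3.9, REFEREED) Hsieh's anticyclotomic `p`-adic `L`-function with `Ω_p ∈ 𝒲^×` at `p² ∤ N`
  (`hsieh2014_exists_anticyclotomicPAdicLFunction_unrPeriod`, Hsieh 2014 Thm. A) and BDP13's central-value reciprocity
  (`bertoliniDarmonPrasanna2013_centralValue_reciprocity`, BDP13 Thm. 5.5) — the pair ER5's 19282 line consumes.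
* `grossZagierDescentExact` (B, classical, PROVED = the landed Theorems helper BY NAME): the EXACT form of the tree's
  Gross–Zagier descent: for a Heegner field `L` (odd `d_L < −4`, `L(E^{(d_L)},1) ≠ 0`) with Heegner point `P_L` and the
  Birch / Manin–period integers `s, k`, there is `n ∈ ℤ ∖ {0}` with `Ш_an(E) = n²·#tors² / (2·c·s·k·Tam)` and
  `2·log_ω ι_𝔭(P_L) = n·log_ω(x̂)` for EVERY `ι_𝔭 : L → ℚ_p`.
* `bdpFramePrintMultiplicative_of_descent` (A♯-print; through rev 3.8 the sorried `stub_bdpFramePrintMultiplicative`, PRINT-SHAPED,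
  the WHOLE non-research residual beyond S0′; since rev 3.9 a THEOREM of S0′'s refereed pair (H14) ∧ (R) via the cell's `R₀`-descent
  `exists_isBDPLFunction_of_hsieh2014_unrPeriod_of_bdp2013`, nram2 g2): the BDP frame `(Ω_K ≠ 0, Ω_p ∈ R₀^×,
  L_𝔭(f) ∈ R₀⟦T⟧)` with `IsBDPLFunction ι 𝔭 κ γ f Ω_K Ω_p L_𝔭(f)` for `E/ℚ` of ANY conductor `N`, `p ≥ 5` multiplicative,
  `ρ̄` irreducible, `K` imaginary quadratic of odd discriminant `< −4` with every `ℓ ∣ N` split, `𝔭 ∋ p` compatible with `ι`,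
  `κ` anticyclotomic with topological generator `γ` — A206's statement with `Squarefree N` replaced by Castella 2024 §2.1's
  standing hypotheses, under which §2.3 (arXiv:2409.01360 p. 6) asserts `L_𝔭(f) ∈ Λ_{R₀}` «as extended in [hsieh, cas-split]»;
  PROVED here from (H14) ∧ (R) (rev 3.9; revs 3.5–3.8's «NOT a tree fact today» corrected — the descent was in the tree since 2026-08-26).
* `bdpFrame_of_print` (rev 3.5's A♯-frame, PROVED modulo A♯-print — i.e., since rev 3.9, modulo S0′ — on ALL of X11b): at `(E, p)` in X11b, a Heegner
  field `L` for `N_E` with `d_L` odd `< −4`, a newform datum `Dt` and the place `w₀`, an `R₀`-frame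
  `(ι′, 𝔭_{ι′}, e, κ, γ, Ω_K, Ω_p, L_𝔭(f))` of `(f, L, p)` EXISTS — the X11b cell's A206 instantiation pattern
  (`X11b.exists_isBDPLFunction_of_satisfiesHeegnerHypothesis`) minus semistability.
* `r1_bdpValueCoreFrameOnTree_of_not_ram` (certified bookkeeping): `¬Ram W p → X11b.R1.BDPValueCoreFrameOnTree W p` — ER5's
  item 19275 is VACUOUS on this crux's class, hence NOT the owner of the frame debt (rev 3.5's docstring said otherwise).
* `bdpFrameValue_of_frame (hVC)` (A♯-res of revs 3.3–3.4, PROVED modulo A♯-print): the frame's value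
  `L_𝔭(f)(𝟙) = u·((1 − a_p p⁻¹)·log_ω e(P_L)/c)²`, `u ∈ R₀^×`, for `p ∤ c(Dt)` and `P_L` of infinite order, from the
  named fact `hVC` (Cas18-JIMJ Thms. 2.10–2.11: the sign clause is VACUOUS here, every `ℓ ∣ N` being split in `L`) +
  one-sided norm rigidity (`intSeries_norm_constantCoeff_eq_of_isBDPLFunctionInt_of_continuousNorms`) + "an element of
  `R₀` of the right norm is a unit multiple" (`exists_unit_unrIntegers_mul_eq_of_norm_eq`) — the cell's (VN_p) argument
  (`bdpValueCoreFrameOnTree_of_normContinuity_of_frames`, p433271) at the door's data.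
* `bdpFrameValue_of_semistable` / `bdpFrameValue (h32) (hVC)` (A♯, PROVED modulo S0′ and A♯-print): the
  same statement for semistable `W` from `thm32` + `PadicAlgCl.nonempty_ringEquiv_complex` +
  `ZpExtension.exists_isAnticyclotomic_holds` + the X11b cell's frame instantiation; all of X11b by cases (the
  non-semistable members through `bdpFrameValue_of_frame`, whence the binder `P_L` of infinite order).
* `bdpFrameValue_of_thm32` (the engine, PROVED): for `W` semistable and `p ∤ c(Dt)`, A♯'s conclusion from
  `thm32` + an embedding datum `ι₀ : ℚ̄_p ≃ ℂ` + `ZpExtension.exists_isAnticyclotomic_holds` + the X11b cell's frame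
  instantiation (`X11b.R1.exists_frame_bdpValueAtOneOnTreeAt_of_satisfiesHeegnerHypothesis`) + `c²` absorbed into the unit.
* `stub_katoBdpCrossingNonsplitFamily` (A♭-fam, XL, RESEARCH — gaps G1/G2 of the card; since rev 3.7 THE research stub): for
  EVERY value-pinned Kato family of `W` at `p` (`ZetaBody W p f ι q Λ c d₁ a A z x` with Kato's printed guards, its Λ-adic lift
  `y ∈ I.H`, the period ratio `λ ≠ 0`), EVERY BDP frame with value `X` at `𝟙` and EVERY Kummer logarithm `σ ≠ 0` of the bottom
  class of `y`: `‖X‖ = p^{1 + ord_p c − ord_p s − ord_p k − (ord_p r_f − ord_p m_f) − (v(σ) + v_p(λ/(q·R⁻_𝟙·∏_{ℓ∣A,ℓ≠p} P_ℓ(ℓ⁻¹))))}`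
  ([BSTW24 §6.2.1 (comp-with-Kato) + (GRL = log-Heegner) + (log-Kato-elt-1), arXiv:2409.01350 pp. 59–60] PORTED from good
  ordinary `p` to a NON-split Steinberg `p ∥ N` and read on Kato's class `z_{γ,c,d}` [Kato04 Thm. 12.5 (1), Ex. 13.3, Lemma
  13.10 (1)]; `m_f` = minimal modular degree among parametrisations by the same newform, `r_f` its congruence number; the
  big-logarithm factor `(1 + 1/p)/2`, the period dictionary and Kato's constants are this stub's burden).
* `katoBdpCrossingNonsplit_of_family` (revs 3.4–3.6's A♭, now PROVED modulo A♭-fam, for `W` of positive rank): the same identity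
  with exponent `… − ord_p t` for EVERY Kummer logarithm `t ≠ 0` of the bottom layer of an ADMISSIBLE zeta class (`t` exists by
  `exists_hasLocPKummerLog_bottomClass`, is unique by `ContraCount.HasLocPKummerLog.unique`, is `≠ 0` by BDV 2022 Thm. A = the
  LEAD's print binder `hNZnonsplit`) — by the LEAD's transfer (p768925) and `exists_hasLocPKummerLog_bottomClass` (p766845) at `y`.
* `stub_katoBdpCrossingSplitFamily` (A♭-fam-split, XL, RESEARCH, since rev 3.8 the FOURTH stub): A♭-fam's statement with
  `¬ W.HasSplitMultiplicativeReductionAtPrime p` replaced by `W.HasSplitMultiplicativeReductionAtPrime p` — same exponent; NO printed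
  mechanism (BSTW's comparison factor vanishes and the big-logarithm factor has a pole at `a_p = +1`; Venerucci 2016 Thm. A ∕ BDV 2022 give
  the RATIONAL form only); its admissible-currency theorem `katoBdpCrossingSplit_of_family` and the split crossings
  `bstwCrossingSplitFamily` ∕ `bstwCrossingSplit` are the non-split proofs verbatim through the sign-free glue.
* `bstwCrossing_of_normIdentity` ∕ `bstwCrossingNonsplitFamily` ∕ `bstwCrossingNonsplit (h32) (hVC)` (A, PROVED from A♯ +
  a norm identity of A♭'s shape + Pasten–Shimura `r_f ≠ 0`, `ord_p` arithmetic on `‖X‖`, ONCE at an abstract exponent `v`): for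
  `P_L` of infinite order, `∃ e`, `r_f ≠ 0` with `v + 1 + ord_p c + ord_p s + ord_p k + (ord_p r_f − ord_p m_f) = 2·ord_p log_ω e(P_L)`
  — `v = v(σ) + v_p(λ/(q·R⁻_𝟙·∏P_ℓ))` (family, from A♭-fam) or `v = ord_p t` (admissible class, positive rank, from
  `katoBdpCrossingNonsplit_of_family`); rev 2's single research stub, a theorem of its halves (`log_ω e(P_L) ≠ 0` comes OUT).

The composition picks `L` by Hoffstein–Luo (split at `p`, at `2` and at every `ℓ ∣ N`, odd `d_L`, `|d_L| > 4`), a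
datum with `p ∤ c` (Mazur + Néron scaling), the `L`-rational Heegner point through the place embedding (Darmon Thm. 3.6),
a minimal datum by well-ordering, gets `P_L` of INFINITE ORDER from B through the embedding `X11b.embAt` of a
degree-one prime above the split `p` (`2 log P_L = n log x̂`, `n ≠ 0`) and `log_ω x̂ ≠ 0` (`x̂` a Mordell–Weil basis has
infinite order; `log_ω` kills only torsion: `isOfFinAddOrder_of_padicLogLocal_eq_zero`), takes the embedding `e` of
A♯'s frame for B, and closes the inequality by `ord_p`-arithmetic + Ribet (`ord_p r_f ≥ ord_p m_f`).  This is `valuationIneq_core_of_crossing` (for a GIVEN exponent `v` and crossing: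
`∃ q, #Ш_an = q ∧ ⟨inequality at v⟩`), instantiated as `valuationIneqNonsplitFamily_core` (family currency, `σ ≠ 0` given) and
`valuationIneqNonsplit_core` (admissible currency, `t ≠ 0` given); the LEAD's `hFamNonsplit` and r5.6's `stub_valuationIneqNonsplit`
quantify over ANY rational `q` with `#Ш_an = q` — pinned to B's by `Rat.cast_injective` (`famValuationIneqNonsplit_of_stubs`; the
registered stub then by the LEAD's `valuationIneqNonsplit_of_family` BY NAME, and a second time directly, `valuationIneqNonsplit_of_stubs'`)
— and r5.5's S3ns gets its `t` from `exists_hasLocPKummerLog_bottomClass` and `t ≠ 0` from the binder `hNZ`.  On X11b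
(`p ∥ N`) the Γ₀-term `ord_p r_f − ord_p m_f` of A♭ VANISHES by Agashe–Ribet–Stein Thm. 2.1 (b) = the tree's named fact
`padicValNat_congruenceNumber_eq_of_not_sq_dvd` (not consumed: an inequality needs only Ribet (a); recorded because with
(b) the door is BSD-TIGHT — BSD ∧ Kato's main conjecture predict EQUALITY in S3ns).

Sorries ONLY in the three `stub_*` (S0′ = nine tree-named printed facts, the eighth and ninth — since rev 3.9 — the REFEREED pair
(H14) `hsieh2014_exists_anticyclotomicPAdicLFunction_unrPeriod` ∧ (R) `bertoliniDarmonPrasanna2013_centralValue_reciprocity`, from which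
A♯-print (the BDP frame at a multiplicative prime for ANY conductor, in PRINT SHAPE) is a THEOREM by the cell's `R₀`-descent;
A♭-fam = the research content at a
NON-split `p`, on Kato's value-pinned families; A♭-fam-split = its twin at a SPLIT `p`, research without a printed mechanism); no stub restates S3ns, r5.6's atom, the crux, or a refuted statement (see the card's
probe table); nothing here is registered (`ledger skeleton check` is NOT run on this file — W-79).  No summit statement,
no crux, no r5.5 stub and no r5.6 stub is proved by this file: it proves only the classical bookkeeping half B, the value
clause of the anticyclotomic half from print (`bdpFrameValue_of_frame`), the print-shaped frame A♯-print from S0′'s refereed pair by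
the cell's `R₀`-descent (`bdpFramePrintMultiplicative_of_descent`), the door-data frame from it (`bdpFrame_of_print`), the vacuity of 19275's shape on `¬Ram` pairs, the glue A ⇐ A♯ + A♭-fam (once, at an
abstract exponent) and A♭ ⇐ A♭-fam (the LEAD's admissible-to-family transfer), the monotonicity
certificate `forall_kummerLog_of_exists` (rev 3.4's A♭ ⇐ rev 3.3's) and the compositions.
-/

noncomputable section

open scoped Classical NumberField TensorProduct BigOperators

set_option linter.dupNamespace false

namespace Summit.BirchSwinnertonDyer.BirchSwinnertonDyer.Cruxes.EulerHalfNotRamNoInertSetAtFive.BstwZetaNonsplit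

open Field
open Literature.NumberTheory.GaloisRepresentations
open Literature.NumberTheory.EllipticCurves Literature.NumberTheory.EllipticCurves.Kato2004
open Literature.NumberTheory.EllipticCurves.Kato2004.EulerSystemValues
open Literature.NumberTheory.EllipticCurves.Rank1Residual
open Literature.NumberTheory.EllipticCurves.Rank1Residual.Typed
open Literature.NumberTheory.EllipticCurves.ModularForms
open Literature.NumberTheory.EllipticCurves.Castella2018
open Summit.BirchSwinnertonDyer.Rank1Residual
open Summit.BirchSwinnertonDyer.BirchSwinnertonDyer.Theses.ErratumRoadFive
open Summit.BirchSwinnertonDyer.BirchSwinnertonDyer.Theorems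
open IsDedekindDomain (HeightOneSpectrum)
open CongruenceSubgroup (Gamma0)

/-! ## §0 Vocabulary (verbatim copies of r5.5 = r5.4's three local definitions; bodies, nothing asserted) -/

/-- `E(ℚ) → E(ℚ_p)` on points (Mathlib's `Point.map` along `ℚ → ℚ_p`). [folklore] -/
abbrev toLocalPoint (W : WeierstrassCurve ℚ) (p : ℕ) [Fact p.Prime] :
    W.toAffine.Point →+ (W.baseChange ℚ_[p]).toAffine.Point :=
  WeierstrassCurve.Affine.Point.map (W' := W.toAffine) (S := ℚ) (Algebra.ofId ℚ ℚ_[p])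

/-- `log_ω(x) ∈ ℚ_p` of a RATIONAL point `x ∈ E(ℚ)` (Néron differential, `W` globally minimal).
[cite: SilvermanAEC2009, IV.6.4 and VII.2.2] -/
def logOmega (W : WeierstrassCurve ℚ) [W.IsElliptic] [W.IsGloballyMinimal] (p : ℕ) [Fact p.Prime]
    (x : W.toAffine.Point) : ℚ_[p] :=
  padicLogLocal W p (toLocalPoint W p x)

/-- The BOTTOM LAYER `z_ℚ ∈ H¹(ℚ, T_pE)` of a class `z₀` of a pinned Iwasawa cohomology.
[cite: Kato2004Asterisque, §12.2 (p. 220) and §14.14 (14.14.1) (p. 243)] -/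
def bottomClass (W : WeierstrassCurve ℚ) [W.IsElliptic] (p : ℕ) [Fact p.Prime]
    [ContinuousSMul ℤ_[p] (W.tateModule p)] (K : ZpExtension ℚ p) {γ : absoluteGaloisGroup ℚ}
    (I : IwasawaH1Data W p K γ) (z₀ : I.H) : H1 (tateRep W p) ⊤ :=
  layerZeroToTop W p K (I.proj 0 z₀)

/-! ## §1 The three stubs (sorries ONLY here: S0′, A♭-fam, A♭-fam-split), the A♯-print theorem and the A-layer -/

/-- **S0′ (CITE) printed facts held as tree named facts**, consumed BY NAME by the composition:
modular parametrisations exist (BCDT 2001 Thm. A (6)); a Heegner field with prescribed splitting, odd discriminant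
and `L(E^{(d)},1) ≠ 0` exists (Hoffstein–Luo 1997 / Friedberg–Hoffstein 1995, via the tree's
`HoffsteinLuo1997_exists_twist_L_one_ne_zero`); the Gross–Zagier theorem (`gross_zagier`, GZ86 I.(6.5)/V.§2, CST14
Thm 1.1); Ribet's divisibility `deg φ ∣ r_f` for an optimal parametrisation (ARS12 Thm. 2.1 (a)); Mazur's
`p ∤ c₀` for the optimal curve at an odd `p` with `p² ∤ N` (Mazur 1978 Cor. 4.1; since rev 3.2 — with the tree THEOREM
`integral_neronScaling_of_isGloballyMinimal_holds` it yields a datum of `W` with `p ∤ c`,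
`X11b.exists_modularParametrizationData_not_dvd`); and (since rev 3.3) Castella's BDP frame + `p`-adic Waldspurger
value at `𝟙` for SEMISTABLE curves, the X11b cell's named fact `Castella2018.thm32_exists_isBDPLFunction_valueAtOne`
(Cas18 Thms. 3.1–3.2 = A206, with its recorded scope flags) — through which A♯ is DISCHARGED on the semistable members;
and (since rev 3.5) Castella's VALUE CONTINUITY of the BDP `p`-adic `L`-function at the trivial character for `p ∥ N`, ANY
conductor — J. Inst. Math. Jussieu 17 (2018) Thms. 2.10–2.11, the named fact
`castella2018Exceptional_bdpValueContinuity_trivialChar` (p434741, second-reader audit FAITHFUL; route ER5's by-name item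
`BDPValueContinuityInput`) — through which the VALUE clause of A♯ is discharged on ALL members (`bdpFrameValue_of_frame`);
and (since rev 3.9, the EIGHTH and NINTH conjuncts, both REFEREED) Hsieh's anticyclotomic `p`-adic `L`-function of `(f, K)` with
values in `𝒪_{ℂ_p}⟦Γ⁻⟧`, the square-interpolation at the BDP characters and the Katz–Hida–Tilouine period `Ω_p ∈ 𝒲^×` — Doc. Math. 19
(2014) Thm. A (p. 712) = Thms. 5.6–5.7, hypotheses `p` odd and `p² ∤ N` ONLY (Hsieh's level datum is the prime-to-`p` conductor; NO
hypothesis on `π_p`, so `p ∥ N` is allowed), the named fact (H14) `hsieh2014_exists_anticyclotomicPAdicLFunction_unrPeriod`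
(`AnticyclotomicRankinSelbergPAdicLFunction.lean`, flags (W1)–(W4), (E1)–(E2) recorded there); and the Bertolini–Darmon–Prasanna
central-value RECIPROCITY — Duke 162 (2013) Thm. 5.5 with its proof ((5.1.16), Prop. 1.12 (1) = Shimura, Lemma 5.3), purely
archimedean, no `p` — the named fact (R) `bertoliniDarmonPrasanna2013_centralValue_reciprocity` (`BDPCentralValueReciprocity.lean`):
EXACTLY the pair route ER5's crux `OpenInputNotRam` (19282) line consumes (`openInputNotRam_stub_bdpDatumNotRam_of_hsieh2014_unrPeriod_of_bdp2013`),
through which — by the cell's `R₀`-DESCENT `exists_isBDPLFunction_of_hsieh2014_unrPeriod_of_bdp2013` (nram2 g2, 2026-08-26) — A♯-print is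
the THEOREM `bdpFramePrintMultiplicative_of_descent` below (rev 3.9; Castella 2024 §2.3's by-citation sentence, the flagged named fact
`Castella2024.exists_isBDPLFunction_multiplicative` = p774890, is a corollary of this pair — `Theorems/ErratumRoadFiveBDPFramePrintMultiplicativeOfHsiehBDP.lean`,
p775634 — and is NOT used here).
[cite: BCDT2001, Thm. A] [cite: GrossZagier1986, I.(6.5) and V.§2] [cite: AgasheRibetStein2012, Thm. 2.1]
[cite: Mazur1978, Cor. 4.1] [cite: Castella2018, Thm. 3.1 and Thm. 3.2 with (3.2) (arXiv:1704.06608 p. 9)]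
[cite: Castella2018Exceptional, Thms. 2.10–2.11 (arXiv:1507.04260 pp. 13–14)]
[cite: Hsieh2014, Thm. A (p. 712) and Thms. 5.6–5.7 (arXiv:1112.1580 pp. 3–4, 23)]
[cite: BertoliniDarmonPrasanna2013, Thm. 5.5 and (5.1.16) (p. 60)] -/
theorem stub_printedFactsHeldNonsplit :
    nonempty_modularParametrizationData ∧ HoffsteinLuo1997_exists_twist_L_one_ne_zero ∧
      (∀ (N : ℕ) [NeZero N] (W : WeierstrassCurve ℚ) (L : Type) [Field L] [NumberField L], gross_zagier N W L) ∧
      modularDegree_dvd_congruenceNumber ∧ mazur_not_dvd_maninConstant_of_odd ∧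
      thm32_exists_isBDPLFunction_valueAtOne ∧ castella2018Exceptional_bdpValueContinuity_trivialChar ∧
      hsieh2014_exists_anticyclotomicPAdicLFunction_unrPeriod ∧ bertoliniDarmonPrasanna2013_centralValue_reciprocity := by
  sorry

/-- **B — the Gross–Zagier descent in EXACT form** (classical; PROVED — here BY NAME from the landed helper
`Theorems/ErratumRoadFiveGrossZagierDescentExact.lean` (p766762), which re-runs the tree proof of
`GrossZagier1986_thm_I_7_3_main_of_isGloballyMinimal` without discarding the constant, plus the `p`-adic
logarithm bookkeeping `log(P_L + P̄_L) = 2 log ι_𝔭 P_L`, `log(n x̂ + T) = n log x̂`).  For `E = W` globally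
minimal of analytic rank one and root number `−1`, a Mordell–Weil basis `x̂` (rank one), an imaginary quadratic
`L` with the Heegner hypothesis for `N_E`, `d_L < −4` odd and `L(E^{(d_L)},1) ≠ 0`, a Heegner point `P_L` of the
datum `(Dt, Hd, ι∞)`, the Gross–Zagier formula over `L`, Birch's `√|d_L|·L(E^{(d_L)},1) = s·Ω⁻_f` and the period
relation `c·Ω⁻_f = k·Ω⁻(E)`: there is `n ∈ ℤ ∖ {0}` (`P_L + P̄_L ≡ n·x̂ mod torsion`) with
`Ш_an(E) = n²·#E(ℚ)_tors² / (2·c·s·k·∏ c_ℓ)` and `2·log_ω ι_𝔭(P_L) = n·log_ω(x̂)` for every `ι_𝔭 : L → ℚ_p`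
(`#𝓞_L^× = 2` as `d_L < −4`; `ĥ(n x̂ + T) = n² Reg`; `P̄_L = P_L +` torsion by Darmon Prop. 3.11 with `w = −1`).
[cite: GrossZagier1986, Thm. I.(7.3) and V.§2 (pp. 312–313)] [cite: Darmon2004, Prop. 3.11] -/
theorem grossZagierDescentExact :
    ∀ (W : WeierstrassCurve ℚ) [W.IsElliptic] [W.IsGloballyMinimal] (p : ℕ) [Fact p.Prime]
      [NeZero (W.conductorNorm ℤ)],
      exists_isNewformOf → W.analyticRank = 1 → W.rootNumber = -1 →
      ∀ (h1 : W.mordellWeilRank = 1) (P : Fin W.mordellWeilRank → W.toAffine.Point), W.IsMordellWeilBasis P →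
      ∀ (L : Type) [Field L] [NumberField L], IsImaginaryQuadratic L →
        SatisfiesHeegnerHypothesis (W.conductorNorm ℤ) L → NumberField.discr L < -4 → Odd (NumberField.discr L) →
        (W.quadraticTwist (NumberField.discr L : ℚ)).entireLFunction 1 ≠ 0 →
      ∀ (Dt : ModularParametrizationData W (W.conductorNorm ℤ))
        (Hd : HeegnerDatum (W.conductorNorm ℤ) (NumberField.discr L)) (ι : L →+* ℂ)
        (PL : (W.baseChange L).toAffine.Point),
        WeierstrassCurve.Affine.Point.map ι.toRatAlgHom PL = heegnerPointComplex Dt Hd →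
        GrossZagierFormula (W.conductorNorm ℤ) W L →
      ∀ (s : ℚ) (k : ℤ),
        (Real.sqrt ((NumberField.discr L).natAbs : ℝ) : ℂ) *
            (W.quadraticTwist (NumberField.discr L : ℚ)).entireLFunction 1 = (s : ℂ) * (minusPeriod Dt.f : ℂ) →
        (Dt.c : ℝ) * minusPeriod Dt.f = k * W.imaginaryPeriodRat →
      ∀ (ιp : L →+* ℚ_[p]),
      ∃ n : ℤ, n ≠ 0 ∧
        shaAn W = (((n : ℚ) ^ 2 * (W.torsionOrder : ℚ) ^ 2 /
            (2 * (Dt.c : ℚ) * s * (k : ℚ) * (W.tamagawaProduct : ℚ)) : ℚ) : ℂ) ∧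
        (2 : ℚ_[p]) * padicLogOmega W p ιp PL = (n : ℚ_[p]) * logOmega W p (P (Fin.cast h1.symm 0)) :=
  -- the landed helper (p766762), whose last conjunct spells `logOmega W p x̂` out as
  -- `padicLogLocal W p (Point.map (Algebra.ofId ℚ ℚ_[p]) x̂)` — the same term by `rfl`
  Summit.BirchSwinnertonDyer.BirchSwinnertonDyer.Theorems.GrossZagierDescentExact.grossZagierDescentExact

/-- **A♯-print — the RESIDUAL of the anticyclotomic half, RE-TYPED IN PRINT SHAPE (rev 3.6), a THEOREM since rev 3.9: the BDP
anticyclotomic `p`-adic `L`-function FRAME at a MULTIPLICATIVE prime, ANY conductor** (PRINT-SHAPED; through rev 3.8 the sorried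
typer target `stub_bdpFramePrintMultiplicative`; since rev 3.9 PROVED from S0′'s REFEREED pair (H14) `hsieh2014_exists_anticyclotomicPAdicLFunction_unrPeriod`
∧ (R) `bertoliniDarmonPrasanna2013_centralValue_reciprocity` by the cell's `R₀`-DESCENT `exists_isBDPLFunction_of_hsieh2014_unrPeriod_of_bdp2013`
(`Theorems/ErratumRoadFiveOpenInputNotRamBDPFrameDescentStub.lean`, nram2 g2: Hsieh's `𝒪_{ℂ_p}`-valued square-root `L`-function is
DESCENDED to `R₀ = W(𝔽̄_p)` using `Ω_p ∈ 𝒲^×` and BDP13's reciprocity — finite Galois orbits, no Tate–Sen) and three lines of plumbing: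
`p ∣ N`, `p² ∤ N` from multiplicative reduction (`X11b.dvd_conductorNorm_of_mult`, `X11b.not_sq_dvd_conductorNorm_of_mult`), `p` split
from the all-split Heegner hypothesis at `ℓ = p`, `e(𝔭|p) = f(𝔭|p) = 1` (`ramificationIdx_eq_one_and_inertiaDeg_eq_one_of_ncard_primesOver_eq_two`);
the binders `ρ̄` irreducible and `d_K < −4` are idle; no `def … : Prop` in this workfile, per critic V318 P1 and the tree audit's
`vendored-fact` rule).  The statement is the X11b cell's A206 `Literature.NumberTheory.EllipticCurves.castella2018_exists_isBDPLFunction`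
(Cas18 Thm. 3.1 in the `∃`-currency: CM periods `Ω_K ∈ ℂ^×`, `Ω_p ∈ R₀^×` and `L ∈ R₀⟦T⟧ = Λ_{R₀}` with the tree's
interpolation predicate `IsBDPLFunction ι 𝔭 κ γ f Ω_K Ω_p L`) with its binder `Squarefree N` (Cas18 §2.1 «`E` semistable»)
REPLACED (and, since rev 3.6.1 = critic V341 N1, WITHOUT the door's `[W.IsGloballyMinimal]` — A206's exact binder granularity, the
predicates being model-independent) by the standing hypotheses of Castella 2024, §2.1 (arXiv:2409.01360 p. 5 L9–L16: «Let `E/ℚ` be an elliptic curve of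
conductor `N`, let `f ∈ S₂(Γ₀(N))` be the newform associated to `E`, and let `p` be a prime of multiplicative reduction for
`E`, so `p ∥ N`. Throughout we assume that `p > 3` … Let `K` be an imaginary quadratic field of odd discriminant `−D_K < −4`
… such that (Heeg-main) holds. In particular, the prime `p` splits in `K`, … with `𝔭` the prime of `K` above `p` induced by a
fixed embedding `ι_p`») — here: `W/ℚ` globally minimal with `W.conductorNorm ℤ = N`, `f` a newform of `W` at level `N`,
`p ≥ 5` with `W.HasMultiplicativeReductionAtPrime p`, `ρ̄_{E,p}` irreducible (kept from A206's standing list; harmless),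
`K` imaginary quadratic, `d_K` odd and `< −4`, the classical Heegner hypothesis in the ALL-SPLIT form (every prime `ℓ ∣ N`
splits in `K` — it implies (Heeg-main) «`∃ 𝔑 ⊂ 𝒪_K, 𝒪_K/𝔑 ≃ ℤ/Nℤ`» (p. 3 L46–L48) and `p` split), `𝔭 ∋ p` compatible
with the embedding datum `ι : ℚ̄_p ≃ ℂ` exactly as in A206, `κ` anticyclotomic with topological generator `γ` — under which
§2.3 (p. 6 L14–L18) asserts the frame: «Let `R₀ = ℤ̂_p^{nr}` …, set `Λ_{R₀} = Λ ⊗̂_{ℤ_p} R₀`, and denote by `L_𝔭(f) ∈ Λ_{R₀}`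
the `p`-adic Rankin `L`-function of Bertolini–Darmon–Prasanna [bdp], as extended in [hsieh, cas-split] to the
`p`-multiplicative case» ([hsieh] = Hsieh, Doc. Math. 19 (2014); [cas-split] = Castella, J. Inst. Math. Jussieu 17 (2018) =
arXiv:1507.04260, whose Thm. 2.11 (p. 14, `a_p` symbolic, «a `p`-new eigenform») is the interpolation display for `p ∥ N`,
`ε_p = 0` — the display Cas18 Thm. 3.1 (arXiv:1704.06608 p. 9) records and the tree's `IsBDPLFunction` transcribes).
STATUS (rev 3.9, CORRECTING revs 3.5–3.8's «NOT a tree fact today … by citation only»): a THEOREM of the refereed pair (H14) ∧ (R)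
since the nram2 descent landed (2026-08-26, for ER5's crux `OpenInputNotRam` 19282 on the same `¬Ram` class) — missed by revs 3.5–3.8,
surfaced by the reviewer of p774890; Castella 2024 §2.3's by-citation sentence (the flagged named fact
`Castella2024.exists_isBDPLFunction_multiplicative`, p774890) is a corollary of the same pair (p775634) and NOT used here. (Unchanged
context: A206 and `Castella2018.thm32_exists_isBDPLFunction_valueAtOne` carry `Squarefree N`; the
cell `bsd-stepL`'s memo THEOREM C♯ and ER5's item `BDPValueCoreFramesAll` (19275) concern ERRATUM data — an
`E[p]`-RAMIFIED multiplicative `q ≠ p` and an erratum field, Castella–Hsieh's (Heeg′) with `N⁻ = q` — and 19275's shape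
`X11b.R1.BDPValueCoreFrameOnTree W p` is VACUOUS on the `¬Ram` class of THIS crux: `r1_bdpValueCoreFrameOnTree_of_not_ram`
below; rev 3.5's docstring attributing the frame debt to 19275 was corrected in rev 3.6.)  In print the frame is ALSO asserted BY
CITATION (Castella 2024 §2.3: [hsieh] = Hsieh 2014 Thm. A — the `Λ`-adic element, NO hypothesis on `π` at `p` ((ST), (sf) constrain
`𝔫⁻` only and are vacuous under the all-split (Heeg); (ord) = `p` split) — and [cas-split] `p ∥ N`, level `Γ₀(Np)` for ANY `N`);
rev 3.5's door-data-shaped A♯-frame `stub_bdpFrameNonsplitNonSemistable` is the THEOREM `bdpFrame_of_print` below.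
Why it might fail: it cannot any more as a statement of this file (PROVED modulo S0′); the residual risk sits in the flags of (H14)
((W1)–(W4), (E1)–(E2) of `AnticyclotomicRankinSelbergPAdicLFunction.lean`) and is shared with ER5's 19282 line.
[cite: Castella2024, §2.1 (arXiv:2409.01360 p. 5, l.358–370) and §2.3 (p. 6, l.465–469) (frame by citation)]
[cite: Castella2018Exceptional, Thm. 2.11 (arXiv:1507.04260 p. 14)] [cite: Castella2018, Thm. 3.1 (arXiv:1704.06608 p. 9)]
[cite: Hsieh2014, Thm. A (p. 712) and Thms. 5.6–5.7 (arXiv:1112.1580 pp. 3–4, 23)]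
[cite: BertoliniDarmonPrasanna2013, Thm. 5.5 and (5.1.16) (p. 60); Thm. 5.13] -/
theorem bdpFramePrintMultiplicative_of_descent :
    ∀ {p : ℕ} [Fact p.Prime] (ι : PadicAlgCl p ≃+* ℂ) (W : WeierstrassCurve ℚ) [W.IsElliptic]
      (K : Type) [Field K] [NumberField K] (𝔭 : IsDedekindDomain.HeightOneSpectrum (𝓞 K))
      (κ : ZpExtension K p) (γ : absoluteGaloisGroup K) {N : ℕ} [NeZero N]
      {f : CuspForm (CongruenceSubgroup.Gamma0 N) 2} (_ : IsNewformOf W f),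
      5 ≤ p → W.conductorNorm ℤ = N → W.HasMultiplicativeReductionAtPrime p → W.HasIrreducibleModPGaloisRep p →
      IsImaginaryQuadratic K → Odd (NumberField.discr K) → NumberField.discr K < -4 →
      (∀ ℓ : ℕ, ℓ.Prime → ℓ ∣ N → ((Ideal.span {(ℓ : ℤ)}).primesOver (𝓞 K)).ncard = 2) →
      ((p : ℕ) : 𝓞 K) ∈ 𝔭.asIdeal →
      (∀ (w : NumberField.InfinitePlace K) (k : 𝓞 K), k ∈ 𝔭.asIdeal ↔ ‖ι.symm (w.embedding (k : K))‖ < 1) →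
      κ.IsAnticyclotomic → κ.IsTopGenerator γ →
      ∃ (ΩK : ℂ) (Ωp : (unrIntegers p)ˣ) (L : UnrSeries p),
        ΩK ≠ 0 ∧ IsBDPLFunction ι 𝔭 κ γ f ΩK ((Ωp : unrIntegers p) : ℂ_[p]) L := by
  intro p _ ι W _ K _ _ 𝔭 κ γ N _ f hf h5 hN hmult _hirr hK hodd _hd4 hHeeg hp𝔭 hι hκ hγ
  -- S0′'s refereed pair (H14) ∧ (R), BY NAME
  obtain ⟨-, -, -, -, -, -, -, hH, hR⟩ := stub_printedFactsHeldNonsplit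
  have hp : p.Prime := Fact.out
  have hp2 : p ≠ 2 := by omega
  -- plumbing: `p ∥ N` from multiplicative reduction; `p` split (Heegner at `ℓ = p`); `e(𝔭|p) = f(𝔭|p) = 1`
  have hpN : p ∣ N := hN ▸ X11b.dvd_conductorNorm_of_mult hmult
  have hp2N : ¬ p ^ 2 ∣ N := hN ▸ X11b.not_sq_dvd_conductorNorm_of_mult W p hmult
  obtain ⟨hram, hdeg⟩ :=
    ramificationIdx_eq_one_and_inertiaDeg_eq_one_of_ncard_primesOver_eq_two p hK.1 (hHeeg p hp hpN) 𝔭 hp𝔭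
  -- the cell's `R₀`-descent of Hsieh's `𝒪_{ℂ_p}`-frame (nram2 g2, 2026-08-26)
  exact exists_isBDPLFunction_of_hsieh2014_unrPeriod_of_bdp2013 hH hR hp2 ι W K 𝔭 κ γ hf hN hpN hp2N hK hodd hHeeg hp𝔭
    hram hdeg hι hκ hγ


/-- **19275 is NOT the owner of the frame debt** (certified, rev 3.6): route ER5's item `BDPValueCoreFramesAll` :=
`∀ W p, X11b.R1.BDPValueCoreFrameOnTree W p` quantifies over ERRATUM data — a multiplicative `q ≠ p` with
`p ∤ ord_q(Δ_E)` (i.e. `ρ̄_{E,p}` RAMIFIED at `q`) — so on the `¬Ram` class of the crux `EulerHalfNotRamNoInertSetAtFive`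
its pointwise shape holds VACUOUSLY and carries no frame.  (Negative bookkeeping for the ER5 planner: 19275's content lives
on `Ram` pairs only, by design of route R1.) [cite: SkinnerUrban2014, Thm. 2 (p. 3), second bullet (the predicate ram)] -/
theorem r1_bdpValueCoreFrameOnTree_of_not_ram {W : WeierstrassCurve ℚ} [W.IsElliptic] [W.IsGloballyMinimal] {p : ℕ}
    [Fact p.Prime] (hram : ¬ Ram W p) : X11b.R1.BDPValueCoreFrameOnTree W p := by
  intro _ q _ _ _ _ _ _ _ _ _ _ hqp hmq _ hvq
  exact (hram ⟨q, ‹Fact q.Prime›, hqp, hmq, hvq⟩).elim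

/-- **A♯-frame (rev 3.5's residual stub) is since rev 3.6 a THEOREM of A♯-print** (sorry-free modulo the stub, consumed BY NAME; proof = the
X11b cell's instantiation pattern `X11b.exists_isBDPLFunction_of_satisfiesHeegnerHypothesis` ∕ this file's
`bdpFrameValue_of_thm32`, minus semistability): for `(E, p)` in X11b (`p ∥ N` multiplicative, `ρ̄` irreducible),
`p ≥ 5`, a Heegner field `L` for `N_E` (every `ℓ ∣ N_E` split — so `p` splits) with `d_L` odd `< −4`, a newform datum `Dt`
(`Dt.isNewformOf`) and the place `w₀`: THE anticyclotomic `ℤ_p`-extension `κ` (`ZpExtension.exists_isAnticyclotomic_holds`)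
with a topological generator, a degree-one prime `𝔭 ∣ p` (`X11b.exists_degreeOnePrime_of_splitsIn`) with THE embedding
`X11b.embAt` inducing it, `𝔭 = 𝔭_{ι′}` for `ι′ ∈ {ι₀, ι₀ ∘ conj}` (`X11b.eq_primeOfEmbeddingDatum_or_eq_trans_starRingAut`),
`𝔭_{ι′} ∋ p` compatible with `ι′` by construction (`X11b.natCast_mem_primeOfEmbeddingDatum`,
`X11b.forall_mem_primeOfEmbeddingDatum_iff`), and the print-shaped frame at these data.  ALL of X11b (no semistability
case split is needed for the frame; the semistable VALUE still comes from `thm32` by name).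
[cite: Castella2024ExceptionalZerosHeegner, §2.3 (arXiv:2409.01360 p. 6)] [cite: Castella2018, Thm. 3.1 (arXiv:1704.06608 p. 9)] -/
theorem bdpFrame_of_print {p : ℕ} [Fact p.Prime] (ι₀ : PadicAlgCl p ≃+* ℂ) :
    ∀ (W : WeierstrassCurve ℚ) [W.IsElliptic] [W.IsGloballyMinimal] [NeZero (W.conductorNorm ℤ)],
      ClassX11b W p → 5 ≤ p →
      ∀ (L : Type) [Field L] [NumberField L], IsImaginaryQuadratic L →
        SatisfiesHeegnerHypothesis (W.conductorNorm ℤ) L → NumberField.discr L < -4 → Odd (NumberField.discr L) →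
      ∀ (Dt : ModularParametrizationData W (W.conductorNorm ℤ)) (w₀ : NumberField.InfinitePlace L),
      ∃ (ι' : PadicAlgCl p ≃+* ℂ) (e : L →+* ℚ_[p])
        (κ : ZpExtension L p) (γ : absoluteGaloisGroup L) (ΩK : ℂ) (Ωp : (unrIntegers p)ˣ) (Λf : UnrSeries p),
        (∀ x : 𝓞 L, x ∈ (X11b.primeOfEmbeddingDatum p ι' w₀.embedding).asIdeal ↔ ‖e (x : L)‖ < 1) ∧
        κ.IsAnticyclotomic ∧ κ.IsTopGenerator γ ∧ ΩK ≠ 0 ∧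
        IsBDPLFunction ι' (X11b.primeOfEmbeddingDatum p ι' w₀.embedding) κ γ Dt.f ΩK
          ((Ωp : unrIntegers p) : ℂ_[p]) Λf := by
  intro W _ _ _ hX h5 L _ _ hLq hH hd4 hodd Dt w₀
  have hp : p.Prime := Fact.out
  have hpN : p ∣ W.conductorNorm ℤ :=
    (W.dvd_conductorNorm_iff_not_hasGoodReductionAtPrime p).mpr
      (WeierstrassCurve.HasMultiplicativeReduction.not_hasGoodReduction (R := ℤ_[p]) hX.2.2.1)
  have hirr : Irr W p := hX.2.2.2
  have hsp : X11b.SplitsIn L p := hH p hp hpN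
  -- THE anticyclotomic `ℤ_p`-extension and a topological generator
  have himag : ∀ w : NumberField.InfinitePlace L, w.IsComplex := fun w ↦ hLq.2.isComplex w
  obtain ⟨κ, hκ⟩ := ZpExtension.exists_isAnticyclotomic_holds (K := L) (p := p) hLq.1 himag
  obtain ⟨γ, hγ⟩ : ∃ γ : absoluteGaloisGroup L, κ.IsTopGenerator γ := κ.surjective (Multiplicative.ofAdd 1)
  -- a degree-one prime above the split `p`; it is `𝔭_{ι′}` for `ι′ ∈ {ι₀, ι₀ ∘ conj}`
  obtain ⟨𝔭, h𝔭, he1, hf1⟩ := X11b.exists_degreeOnePrime_of_splitsIn L p hLq.1 hsp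
  have key : ∀ ι' : PadicAlgCl p ≃+* ℂ, 𝔭 = X11b.primeOfEmbeddingDatum p ι' w₀.embedding →
      ∃ (ι' : PadicAlgCl p ≃+* ℂ) (e : L →+* ℚ_[p])
        (κ : ZpExtension L p) (γ : absoluteGaloisGroup L) (ΩK : ℂ) (Ωp : (unrIntegers p)ˣ) (Λf : UnrSeries p),
        (∀ x : 𝓞 L, x ∈ (X11b.primeOfEmbeddingDatum p ι' w₀.embedding).asIdeal ↔ ‖e (x : L)‖ < 1) ∧
        κ.IsAnticyclotomic ∧ κ.IsTopGenerator γ ∧ ΩK ≠ 0 ∧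
        IsBDPLFunction ι' (X11b.primeOfEmbeddingDatum p ι' w₀.embedding) κ γ Dt.f ΩK
          ((Ωp : unrIntegers p) : ℂ_[p]) Λf := by
    intro ι' h𝔭eq
    subst h𝔭eq
    have hemb : ∀ x : 𝓞 L, x ∈ (X11b.primeOfEmbeddingDatum p ι' w₀.embedding).asIdeal ↔
        ‖X11b.embAt L p _ h𝔭 he1 hf1 (x : L)‖ < 1 :=
      X11b.mem_asIdeal_iff_norm_embAt_lt_one _ h𝔭 he1 hf1
    obtain ⟨ΩK, Ωp, Λf, hΩ, hL⟩ :=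
      bdpFramePrintMultiplicative_of_descent ι' W L (X11b.primeOfEmbeddingDatum p ι' w₀.embedding) κ γ Dt.isNewformOf h5 rfl
        hX.2.2.1 hirr hLq hodd hd4
        (fun ℓ hℓ hℓN ↦ hH ℓ hℓ hℓN) (X11b.natCast_mem_primeOfEmbeddingDatum p ι' w₀.embedding)
        (X11b.forall_mem_primeOfEmbeddingDatum_iff p ι' hLq w₀) hκ hγ
    exact ⟨ι', X11b.embAt L p _ h𝔭 he1 hf1, κ, γ, ΩK, Ωp, Λf, hemb, hκ, hγ, hΩ, hL⟩
  rcases X11b.eq_primeOfEmbeddingDatum_or_eq_trans_starRingAut p ι₀ hLq w₀ h𝔭 with h | h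
  · exact key ι₀ h
  · exact key _ h

/-- **A♯-res (revs 3.3–3.4's print-shaped stub) is since rev 3.5 a THEOREM of the frame + PRINT** (sorry-free modulo
the stub — A♯-print since rev 3.6, through `bdpFrame_of_print`; the named fact `hVC` is a hypothesis, D-0014 pattern): for a NON-semistable member, a Heegner
presentation `(Dt, Hd, w₀, P_L)` with `p ∤ c(Dt)` and `P_L` of INFINITE ORDER, the frame of
`bdpFrame_of_print` carries the `p`-adic Waldspurger value `L_𝔭(f)(𝟙) = u·((1 − a_p p⁻¹)·log_ω e(P_L)/c)²`,
`u ∈ R₀^×`.  Proof = the cell `bsd-stepL`'s (VN_p) argument (`bdpValueCoreFrameOnTree_of_normContinuity_of_frames` of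
`Theorems/ErratumRoadFiveValueByNormContinuity`, p433271) run at the door's data: Castella's VALUE CONTINUITY at `𝟙` for
`p ∥ N`, ANY conductor (J. Inst. Math. Jussieu 17 (2018) Thms. 2.10–2.11 = the named fact
`castella2018Exceptional_bdpValueContinuity_trivialChar`; its binders are discharged here — `p` split and the degree-one
primes above every `ℓ ∣ N` from the two Heegner hypotheses (`X11b.exists_absNorm_eq_of_splitsIn`), the sign clause
VACUOUSLY (every `ℓ ∣ N` splits in `L`, so `ℓ ∤ d_L`: `X11b.not_dvd_discr_of_splitsIn`), `𝔭_{ι′} ∋ p` compatible with `ι′`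
(`X11b.natCast_mem_primeOfEmbeddingDatum`, `X11b.forall_mem_primeOfEmbeddingDatum_iff`)) gives virtual periods against
which the display NORMS tend to `‖(1 − a_p p⁻¹)·log_ω e(P_L)‖² ≠ 0` (`a_p = ±1` at the multiplicative `p`,
`X11b.Halves.norm_one_sub_div_eq`; `log_ω ≠ 0` off torsion, `X11b.R1.logOmega_ne_zero`); ONE-SIDED NORM RIGIDITY (tree
theorem `intSeries_norm_constantCoeff_eq_of_isBDPLFunctionInt_of_continuousNorms`, the frame read in `𝓞_{ℂ_p}⟦T⟧` by
`X11b.R1.isBDPLFunctionInt_map`) pins `‖[T⁰]L_𝔭(f)‖` to that limit; `‖c‖_p = 1`, so `[T⁰]L_𝔭(f) ∈ R₀` has the norm of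
`((1 − a_p p⁻¹)·log_ω e(P_L)/c)²` and IS a unit multiple of it (`exists_unit_unrIntegers_mul_eq_of_norm_eq`); the value at
`𝟙` is `[T⁰]` (`UnrSeries.hasValueAt_zero`).  No new mathematics: the typing debt left in the stub is frame EXISTENCE.
[cite: Castella2018Exceptional, Thms. 2.10–2.11 (arXiv:1507.04260 pp. 13–14)]
[cite: Castella2018, Thm. 3.2 with (3.2) (arXiv:1704.06608 p. 9) (value shape)] -/
theorem bdpFrameValue_of_frame (hVC : castella2018Exceptional_bdpValueContinuity_trivialChar) :
    ∀ (W : WeierstrassCurve ℚ) [W.IsElliptic] [W.IsGloballyMinimal] (p : ℕ) [Fact p.Prime]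
      [NeZero (W.conductorNorm ℤ)],
      ClassX11b W p → 5 ≤ p → ¬ Semistable W → Surj W p →
      ∀ (L : Type) [Field L] [NumberField L], IsImaginaryQuadratic L →
        SatisfiesHeegnerHypothesis (W.conductorNorm ℤ) L → SatisfiesHeegnerHypothesis p L →
        NumberField.discr L < -4 → Odd (NumberField.discr L) →
      ∀ (Dt : ModularParametrizationData W (W.conductorNorm ℤ))
        (Hd : HeegnerDatum (W.conductorNorm ℤ) (NumberField.discr L)) (w₀ : NumberField.InfinitePlace L)
        (PL : (W.baseChange L).toAffine.Point),
        WeierstrassCurve.Affine.Point.map w₀.embedding.toRatAlgHom PL = heegnerPointComplex Dt Hd →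
        ¬ (p : ℤ) ∣ Dt.c → ¬ IsOfFinAddOrder PL →
      ∃ (ι' : PadicAlgCl p ≃+* ℂ) (e : L →+* ℚ_[p])
        (κ : ZpExtension L p) (γ : absoluteGaloisGroup L) (ΩK : ℂ) (Ωp : (unrIntegers p)ˣ) (Λf : UnrSeries p),
        (∀ x : 𝓞 L, x ∈ (X11b.primeOfEmbeddingDatum p ι' w₀.embedding).asIdeal ↔ ‖e (x : L)‖ < 1) ∧
        κ.IsAnticyclotomic ∧ κ.IsTopGenerator γ ∧ ΩK ≠ 0 ∧
        IsBDPLFunction ι' (X11b.primeOfEmbeddingDatum p ι' w₀.embedding) κ γ Dt.f ΩK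
          ((Ωp : unrIntegers p) : ℂ_[p]) Λf ∧
        ∃ u : (unrIntegers p)ˣ, Λf.HasValueAt 0
          (((u : unrIntegers p) : ℂ_[p]) *
            (algebraMap ℚ_[p] ℂ_[p]
              (((1 : ℚ_[p]) - (W.LFunction p : ℚ_[p]) * (p : ℚ_[p])⁻¹) * padicLogOmega W p e PL /
                (Dt.c : ℚ_[p]))) ^ 2) := by
  intro W _ _ p _ _ hX h5 _hss _ L _ _ hLq hH hHp hd4 hodd Dt Hd w₀ PL hPL hc hinf
  have hp : p.Prime := Fact.out
  have hp2 : p ≠ 2 := by omega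
  -- the frame: an `R₀`-frame of `(f, L, p)` from the print-shaped stub A♯-print (Steinitz for `ι₀`)
  obtain ⟨ι₀⟩ := PadicAlgCl.nonempty_ringEquiv_complex p
  obtain ⟨ι', e, κ, γ, ΩK, Ωp, Λf, he, hκ, hγ, hΩK, hL⟩ :=
    bdpFrame_of_print ι₀ W hX h5 L hLq hH hd4 hodd Dt w₀
  -- the named fact at these data; its sign clause is VACUOUS (every `ℓ ∣ N` splits in `L`, so `ℓ ∤ d_L`)
  have hsign : ∀ (ℓ : ℕ) [Fact ℓ.Prime], ℓ ∣ W.conductorNorm ℤ → (ℓ : ℤ) ∣ NumberField.discr L →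
      W.HasMultiplicativeReductionAtPrime ℓ ∧ ¬ W.HasSplitMultiplicativeReductionAtPrime ℓ := by
    intro ℓ _ hℓN hℓD
    exact absurd hℓD (X11b.not_dvd_discr_of_splitsIn hLq.1 Fact.out (hH ℓ Fact.out hℓN))
  obtain ⟨ΩK', Ωp', hΩK', hΩp', hcont⟩ :=
    tendsto_norm_bdpInterpolationValue_of_valueContinuity hVC ι' W L
      (X11b.primeOfEmbeddingDatum p ι' w₀.embedding) κ γ Dt Hd w₀ e PL h5 rfl hX.2.2.1 hLq hodd (by omega)
      (hHp p hp dvd_rfl) (X11b.natCast_mem_primeOfEmbeddingDatum p ι' w₀.embedding)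
      (X11b.forall_mem_primeOfEmbeddingDatum_iff p ι' hLq w₀)
      (fun ℓ hℓ hℓN ↦ X11b.exists_absNorm_eq_of_splitsIn hLq.1 hℓ (hH ℓ hℓ hℓN))
      (fun ℓ _ hℓN hℓD ↦ hsign ℓ hℓN hℓD) hκ hγ hc hPL he
  -- the target norm is `≠ 0`: `a_p = ±1`, `log_ω e(P_L) ≠ 0` (`P_L` of infinite order)
  have hΩp0 : ((Ωp : unrIntegers p) : ℂ_[p]) ≠ 0 := by
    rw [Ne, ZeroMemClass.coe_eq_zero]
    exact Units.ne_zero Ωp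
  have ha : W.LFunction p = 1 ∨ W.LFunction p = -1 :=
    KrausOesterle1992.lFunction_apply_prime_eq_one_or_eq_neg_one_of_mult W p hX.2.2.1
  have hp0 : (0 : ℝ) < p := by exact_mod_cast hp.pos
  have heul0 : (1 : ℚ_[p]) - (W.LFunction p : ℚ_[p]) * (p : ℚ_[p])⁻¹ ≠ 0 := by
    intro h0
    have hn := X11b.Halves.norm_one_sub_div_eq p ha
    rw [h0, norm_zero] at hn
    exact hp0.ne hn
  have hlog0 : padicLogOmega W p e PL ≠ 0 := by
    rw [← X11b.R1.logOmega_eq_padicLogOmega]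
    exact X11b.R1.logOmega_ne_zero W p e hinf
  set z : ℚ_[p] := ((1 : ℚ_[p]) - (W.LFunction p : ℚ_[p]) * (p : ℚ_[p])⁻¹) * padicLogOmega W p e PL with hz
  have hz0 : z ≠ 0 := mul_ne_zero heul0 hlog0
  have hN0 : ‖algebraMap ℚ_[p] ℂ_[p] z‖ ^ 2 ≠ 0 :=
    pow_ne_zero _ (norm_ne_zero_iff.mpr ((map_ne_zero_iff _ (algebraMap ℚ_[p] ℂ_[p]).injective).mpr hz0))
  -- one-sided norm rigidity in `𝓞_{ℂ_p}⟦T⟧`: `‖[T⁰]Λf‖ = ‖z‖²`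
  have hQ := X11b.R1.isBDPLFunctionInt_map hL
  have key :=
    Summit.BirchSwinnertonDyer.BirchSwinnertonDyer.Theorems.intSeries_norm_constantCoeff_eq_of_isBDPLFunctionInt_of_continuousNorms
      hp2 hLq hκ hγ hΩK' hΩK hΩp' hΩp0 hcont hN0 hQ
  have hcoe : ((PowerSeries.constantCoeff (PowerSeries.map (X11b.R1.unrToCpInt p) Λf) : 𝓞_ℂ_[p]) : ℂ_[p]) =
      ((PowerSeries.constantCoeff Λf : unrIntegers p) : ℂ_[p]) := by
    rw [← PowerSeries.coeff_zero_eq_constantCoeff_apply, PowerSeries.coeff_map,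
      PowerSeries.coeff_zero_eq_constantCoeff_apply, X11b.R1.coe_unrToCpInt]
  rw [hcoe] at key
  -- `c` is a `p`-adic unit, so `‖(z/c)²‖ = ‖z‖²`, and an element of `R₀` of that norm is a unit multiple
  have hcQ1 : ‖((Dt.c : ℤ) : ℚ_[p])‖ = 1 := by
    rcases (Padic.norm_int_le_one (p := p) Dt.c).eq_or_lt with h | h
    · exact h
    · exact absurd (Padic.norm_intCast_lt_one_iff.mp h) hc
  have hc0 : ((Dt.c : ℤ) : ℚ_[p]) ≠ 0 := by
    intro h0; rw [h0, norm_zero] at hcQ1; exact zero_ne_one hcQ1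
  have hx0 : (z / (Dt.c : ℚ_[p])) ^ 2 ≠ 0 := pow_ne_zero _ (div_ne_zero hz0 hc0)
  have hnorm : ‖((PowerSeries.constantCoeff Λf : unrIntegers p) : ℂ_[p])‖ =
      ‖algebraMap ℚ_[p] ℂ_[p] ((z / (Dt.c : ℚ_[p])) ^ 2)‖ := by
    rw [key, norm_algebraMap', norm_algebraMap', norm_pow, norm_div, hcQ1, div_one]
  obtain ⟨u, hu⟩ :=
    Summit.BirchSwinnertonDyer.BirchSwinnertonDyer.Theorems.exists_unit_unrIntegers_mul_eq_of_norm_eq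
      (PowerSeries.constantCoeff Λf) hx0 hnorm
  refine ⟨ι', e, κ, γ, ΩK, Ωp, Λf, he, hκ, hγ, hΩK, hL, u, ?_⟩
  rw [map_pow] at hu
  rw [hu]
  exact Λf.hasValueAt_zero

/-- **A♯ DISCHARGED for SEMISTABLE curves and `p ∤ c`, from the tree's NAMED FACT** (sorry-free modulo the
published fact as a hypothesis, D-0014 pattern): Castella 2018 Thms. 3.1–3.2 as typed in
`Castella2018.thm32_exists_isBDPLFunction_valueAtOne` (square-free `N`, `p ≥ 5`, `ρ̄` irreducible, `p ∣ N` split in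
`K`, classical Heegner hypothesis, `p ∤ c`), one embedding datum `ι₀ : ℚ̄_p ≃ ℂ` (Steinitz — an INPUT, as in the
X11b cell's `R1.bsdp_of_imcEq_final`), THE anticyclotomic `ℤ_p`-extension (`ZpExtension.exists_isAnticyclotomic_holds`,
global reciprocity) with a topological generator (`κ` is onto `ℤ_p`), a degree-one prime `𝔭 ∣ p`
(`X11b.exists_degreeOnePrime_of_splitsIn`) with THE embedding `X11b.embAt` inducing it, `𝔭 = 𝔭_{ι′}` for
`ι′ ∈ {ι₀, ι₀ ∘ conj}` (`X11b.eq_primeOfEmbeddingDatum_or_eq_trans_starRingAut`), the cell's instantiation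
`X11b.R1.exists_frame_bdpValueAtOneOnTreeAt_of_satisfiesHeegnerHypothesis`, and the absorption of the `p`-UNIT `c²`
into `u` (`unrIntegers.isUnit_iff_norm_eq_one`).  So on the semistable members of X11b with `p ∤ c(Dt)` the stub
A♯ IS print (the named fact); what A♯ adds beyond it is only level-generality (non-square-free `N`) and `p ∣ c`.
[cite: Castella2018, Thm. 3.1, Thm. 3.2 with (3.2) (arXiv:1704.06608 p. 9)] -/
theorem bdpFrameValue_of_thm32 (h32 : thm32_exists_isBDPLFunction_valueAtOne)
    {p : ℕ} [Fact p.Prime] (ι₀ : PadicAlgCl p ≃+* ℂ) :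
    ∀ (W : WeierstrassCurve ℚ) [W.IsElliptic] [W.IsGloballyMinimal] [NeZero (W.conductorNorm ℤ)],
      ClassX11b W p → 5 ≤ p → Semistable W →
      ∀ (L : Type) [Field L] [NumberField L], IsImaginaryQuadratic L →
        SatisfiesHeegnerHypothesis (W.conductorNorm ℤ) L → SatisfiesHeegnerHypothesis p L →
      ∀ (Dt : ModularParametrizationData W (W.conductorNorm ℤ))
        (Hd : HeegnerDatum (W.conductorNorm ℤ) (NumberField.discr L)) (w₀ : NumberField.InfinitePlace L)
        (PL : (W.baseChange L).toAffine.Point), ¬ (p : ℤ) ∣ Dt.c →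
        WeierstrassCurve.Affine.Point.map w₀.embedding.toRatAlgHom PL = heegnerPointComplex Dt Hd →
      ∃ (ι' : PadicAlgCl p ≃+* ℂ) (e : L →+* ℚ_[p])
        (κ : ZpExtension L p) (γ : absoluteGaloisGroup L) (ΩK : ℂ) (Ωp : (unrIntegers p)ˣ) (Λf : UnrSeries p),
        (∀ x : 𝓞 L, x ∈ (X11b.primeOfEmbeddingDatum p ι' w₀.embedding).asIdeal ↔ ‖e (x : L)‖ < 1) ∧
        κ.IsAnticyclotomic ∧ κ.IsTopGenerator γ ∧ ΩK ≠ 0 ∧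
        IsBDPLFunction ι' (X11b.primeOfEmbeddingDatum p ι' w₀.embedding) κ γ Dt.f ΩK
          ((Ωp : unrIntegers p) : ℂ_[p]) Λf ∧
        ∃ u : (unrIntegers p)ˣ, Λf.HasValueAt 0
          (((u : unrIntegers p) : ℂ_[p]) *
            (algebraMap ℚ_[p] ℂ_[p]
              (((1 : ℚ_[p]) - (W.LFunction p : ℚ_[p]) * (p : ℚ_[p])⁻¹) * padicLogOmega W p e PL /
                (Dt.c : ℚ_[p]))) ^ 2) := by
  intro W _ _ _ hX h5 hss L _ _ hLq hH hHp Dt Hd w₀ PL hc hPL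
  have hp : p.Prime := Fact.out
  have hpN : p ∣ W.conductorNorm ℤ :=
    (W.dvd_conductorNorm_iff_not_hasGoodReductionAtPrime p).mpr
      (WeierstrassCurve.HasMultiplicativeReduction.not_hasGoodReduction (R := ℤ_[p]) hX.2.2.1)
  have hirr : Irr W p := hX.2.2.2
  have hsp : X11b.SplitsIn L p := hHp p hp dvd_rfl
  -- THE anticyclotomic `ℤ_p`-extension and a topological generator
  have himag : ∀ w : NumberField.InfinitePlace L, w.IsComplex := fun w ↦ hLq.2.isComplex w
  obtain ⟨κ, hκ⟩ := ZpExtension.exists_isAnticyclotomic_holds (K := L) (p := p) hLq.1 himag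
  obtain ⟨γ, hγ⟩ : ∃ γ : absoluteGaloisGroup L, κ.IsTopGenerator γ := κ.surjective (Multiplicative.ofAdd 1)
  -- a degree-one prime above the split `p`; it is `𝔭_{ι′}` for `ι′ ∈ {ι₀, ι₀ ∘ conj}`
  obtain ⟨𝔭, h𝔭, he1, hf1⟩ := X11b.exists_degreeOnePrime_of_splitsIn L p hLq.1 hsp
  -- `c` is a `p`-adic unit
  have hcQ1 : ‖((Dt.c : ℤ) : ℚ_[p])‖ = 1 := by
    rcases (Padic.norm_int_le_one (p := p) Dt.c).eq_or_lt with h | h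
    · exact h
    · exact absurd (Padic.norm_intCast_lt_one_iff.mp h) hc
  have hcC : ‖((Dt.c : ℤ) : ℂ_[p])‖ = 1 := by
    rw [← map_intCast (algebraMap ℚ_[p] ℂ_[p]), norm_algebraMap', hcQ1]
  have hc0 : ((Dt.c : ℤ) : ℂ_[p]) ≠ 0 := by
    intro h0; rw [h0, norm_zero] at hcC; exact zero_ne_one hcC
  obtain ⟨uc, huc⟩ := (unrIntegers.isUnit_iff_norm_eq_one
    (⟨((Dt.c : ℤ) : ℂ_[p]), intCast_mem_unrIntegers Dt.c⟩ : unrIntegers p)).mpr hcC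
  have huc' : ((uc : unrIntegers p) : ℂ_[p]) = ((Dt.c : ℤ) : ℂ_[p]) := by rw [huc]
  have key : ∀ ι' : PadicAlgCl p ≃+* ℂ, 𝔭 = X11b.primeOfEmbeddingDatum p ι' w₀.embedding →
      ∃ (ι' : PadicAlgCl p ≃+* ℂ) (e : L →+* ℚ_[p])
        (κ : ZpExtension L p) (γ : absoluteGaloisGroup L) (ΩK : ℂ) (Ωp : (unrIntegers p)ˣ) (Λf : UnrSeries p),
        (∀ x : 𝓞 L, x ∈ (X11b.primeOfEmbeddingDatum p ι' w₀.embedding).asIdeal ↔ ‖e (x : L)‖ < 1) ∧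
        κ.IsAnticyclotomic ∧ κ.IsTopGenerator γ ∧ ΩK ≠ 0 ∧
        IsBDPLFunction ι' (X11b.primeOfEmbeddingDatum p ι' w₀.embedding) κ γ Dt.f ΩK
          ((Ωp : unrIntegers p) : ℂ_[p]) Λf ∧
        ∃ u : (unrIntegers p)ˣ, Λf.HasValueAt 0
          (((u : unrIntegers p) : ℂ_[p]) *
            (algebraMap ℚ_[p] ℂ_[p]
              (((1 : ℚ_[p]) - (W.LFunction p : ℚ_[p]) * (p : ℚ_[p])⁻¹) * padicLogOmega W p e PL /
                (Dt.c : ℚ_[p]))) ^ 2) := by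
    intro ι' h𝔭eq
    subst h𝔭eq
    have hemb : ∀ x : 𝓞 L, x ∈ (X11b.primeOfEmbeddingDatum p ι' w₀.embedding).asIdeal ↔
        ‖X11b.embAt L p _ h𝔭 he1 hf1 (x : L)‖ < 1 :=
      X11b.mem_asIdeal_iff_norm_embAt_lt_one _ h𝔭 he1 hf1
    obtain ⟨ΩK, Ωp, Λf, hΩ, hL, u, hu⟩ :=
      X11b.R1.exists_frame_bdpValueAtOneOnTreeAt_of_satisfiesHeegnerHypothesis h32 ι' Dt Hd h5 hss hirr hpN
        hLq hH hc w₀ hPL κ hκ γ hγ hemb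
    refine ⟨ι', X11b.embAt L p _ h𝔭 he1 hf1, κ, γ, ΩK, Ωp, Λf, hemb, hκ, hγ, hΩ, hL, u * uc ^ 2, ?_⟩
    rw [X11b.R1.logOmega_eq_padicLogOmega] at hu
    convert hu using 1
    rw [Units.val_mul, Units.val_pow_eq_pow_val, Subring.coe_mul, Subring.coe_pow, huc', map_div₀,
      map_intCast, div_pow]
    field_simp
  rcases X11b.eq_primeOfEmbeddingDatum_or_eq_trans_starRingAut p ι₀ hLq w₀ h𝔭 with h | h
  · exact key ι₀ h
  · exact key _ h

/-- **A♭-fam — the cyclotomic HALF of the crossing AT THE FAMILY LEVEL (rev 3.7; THE research stub): the VALUE IDENTITY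
between the bottom class of a VALUE-PINNED KATO FAMILY and the BDP value at `𝟙`, PORTED to a non-split Steinberg prime**
(RESEARCH; the card's gaps G1 = the comparison of the two-variable zeta element `𝒵(g/L)` (Beilinson–Flach / Hida) with
`z^{Kato}(g) ⊗ z^{Kato}(g ⊗ χ_L)` and its explicit reciprocity law on the `v̄`-line for a newform that is STEINBERG at
`p`, G2 = Wan's three-variable divisibility at `p ∥ N`; [BSTW24] prove the chain only for GOOD `p ∤ 2N` — Thm. 1.13
(arXiv:2409.01350 p. 5): «Let `E/ℚ` be an elliptic curve of conductor `N`, and `p ∤ 2N` a prime. … Then Conjecture (PR0)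
is true for the pair `(E,p)`. In the text we prove a `p`-integral version of Conjecture (PR0) (cf. (up-to-u_L))», the
`p`-integral version being (log-Kato-elt-1) of §6.2.1 (p. 60) with `u_L ∈ ℤ_{(p)}^×`; Thm. 6.4 (p. 59): `p ∤ 2N`,
`λ ∤ a_p(g)` or `a_p(g) = 0`).
CURRENCY (rev 3.7 — the LEAD's THIRD currency, bsd-line-er5-p1 g12: `Theorems/ErratumRoadFiveKatoFframeAdmissibleLogTransfer`
p768925, `Theorems/ErratumRoadFiveKatoFframeValueAtomsOfFamily` p769350, whose docstring says «a research/door seat should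
start from `valuationIneq{Split,Nonsplit}_of_family`»): the identity is stated on the bottom class `proj₀ y` of the Λ-adic
lift `y ∈ I.H = 𝐇¹_Γ(T_pE)` of a VALUE-PINNED KATO FAMILY — Kato's OWN classes `z = (z_{m,𝔯})` with `ZetaBody W p f ι q Λ c d₁ a A z x`
(the value relation `∑_± L_S(E, χ, 1)/Ω^± = q · per_f(Λ(z)^±)` at every finite level, [Kato04 Thm. 12.5 (1) pp. 221–222,
Ex. 13.3 p. 225, Thm. 6.6 / 9.7]), Kato's printed guards on `(c, d₁, a, A, d′)`, the cusp factor `R⁻_𝟙 =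
ratCuspFactor f true c d₁ a A d′ ≠ 0`, the Euler factors `P_ℓ(ℓ⁻¹) = eulerFactorAtOne W N ℓ` at `ℓ ∣ A`, `ℓ ≠ p`, and the
period ratio `λ ≠ 0`, `Ω⁺_f = λ·Ω_E` — EXACTLY the binder prefix of the LEAD's `hFamNonsplit` (`valuationIneqNonsplit_of_family`).
This is the object BSTW's (comp-with-Kato) is LITERALLY about (`z^{Kato}_{γ,c,d}`, [BSTW24 §6.2.1 p. 59]); every bottom
class of the family is an explicit non-zero multiple of THE Kato zeta element ([Kato04 Lemma 13.10 (1) p. 230, §13.9]), and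
Kato's constants `q·R⁻_𝟙·∏P_ℓ` and `λ` — implicit `p`-units-or-not in revs ≤ 3.6's «admissible class» currency (there they hid
inside `IsAdmissibleZetaClass`, Kato Thm. 12.5: bottom layers differ by `ℤ_p^× · (q·R⁻·∏P_ℓ/λ)`) — are now EXPLICIT in the
exponent: for EVERY Kummer logarithm `σ ≠ 0` of `proj₀ y` (unique, `ContraCount.HasLocPKummerLog.unique`; it EXISTS in positive
rank by `ErratumRoadFiveKatoFframeValueAtoms.exists_hasLocPKummerLog_bottomClass`; `σ ≠ 0` is PRINT, BDV 2022 Thm. A, the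
LEAD's `hNZ`/transfer `forall_isAdmissibleZetaClass_kummerLog_ne_zero_of_forall_family` — none of the three is this stub's burden),
`‖X‖ = p^{1 + ord_p c(Dt) − ord_p s − ord_p k − (ord_p r_f − ord_p m_f) − (v(σ) + v_p(λ/(q·R⁻_𝟙·∏_{ℓ∣A,ℓ≠p} P_ℓ(ℓ⁻¹))))}`.
Revs 3.4–3.6's admissible-class statement (`… − ord_p t`, `t` a Kummer logarithm of the bottom layer of an ADMISSIBLE zeta
class) FOLLOWS from this one by the LEAD's transfer `exists_family_kummerLog_transfer_of_isAdmissibleZetaClass` (`v(t) = v(σ) +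
v_p(λ/(q·R⁻_𝟙·∏P_ℓ))`, Kato Thm. 12.5 (1) + Lemma 13.10 (1) + (14.14.1)) — theorem `katoBdpCrossingNonsplit_of_family` below
(sorry-free modulo this stub; one binder added there: positive rank).  The exponent form NEEDS `σ ≠ 0`: the identity behind it is
LINEAR in `σ`, `X ≐ 𝔅_p·c(ω,γ,γ′)·𝔤(χ_L)·(L(1,g′)/Ω⁻)·σ`.  Source identities [BSTW24 §6.2.1 (comp-with-Kato), (GRL = log-Heegner),
(log-Kato-elt-1), arXiv:2409.01350 pp. 59–60]: `𝔅_p · log_ω(loc_v̄ 𝒵(g/L)_𝟙) ≐ L_v̄^{BDP}(g/L)(𝟙)` and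
`log_ω(loc_v̄ 𝒵(g/L)_𝟙) ≐ log_ω(loc_p z^{Kato}_{γ,c,d}(g)) · (1 − a_p(g′)⁻¹·…) · c(ω,γ,γ′)·𝔤(χ_L)·L(1,g′)/Ω⁻`, `≐` up to
`p`-units.  Port dictionary (card §Mechanism, rev 1.2): at a NON-split Steinberg `p` (`a_p = −1 = a_p(g ⊗ χ_L)`,
`χ_L(p) = 1`) the big-logarithm factor is `𝔅_p = (1 − α/p)(1 − 1/α)⁻¹ = (1 + 1/p)/2`, of `ord_p = −1` (at a SPLIT
`p` it has a POLE — this door is non-split only); `c(ω,γ,γ′) ≍ r_f/m_f` up to `p`-units (Γ₀-congruence period versus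
Petersson norm `= m·covol`, [BSTW24 Prop. 4.13, p. 43]); `𝔤(χ_L)·L(1,g′)/Ω⁻ ≍ s` (Birch); the passage from BSTW's
canonical periods / `c_g` to the tree's descent currency `(c, k)` and to Kato's `(q, R⁻_𝟙, ∏P_ℓ, λ)` costs only the
DISPLAYED valuations for `p ≥ 5`, `p ∥ N`, `ρ̄_{E,p}` onto (Manin constants [Mazur78 Cor. 4.1]; no `p`-isogeny in the class)
— these unit statements are PART of this stub's burden (P1 of the card), not hypotheses (`r_f ≠ 0` is a tree THEOREM —
Pasten–Shimura, `congruenceNumber_ne_zero_of_datum` below).  Stated for EVERY value-pinned family of EVERY pinned cyclotomic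
Iwasawa cohomology (the same `∀`-family prefix as the LEAD's `hFamNonsplit`), every Heegner presentation and minimal datum `D`
(`D.f = Dt.f`), and EVERY BDP frame `(ι′, 𝔭_{ι′}, κ, γ′, Ω_K, Ω_p, L_𝔭(f))` of `(f, L, p)` (the interpolation predicate PINS
`L_𝔭(f)(𝟙)`: two frames of the same `(ι′, 𝔭, κ, γ′, f)` differ by a unit of `Λ_{R₀}` — tree theorem
`X11b.R1.exists_iwasawaUnit_mul_eq_of_isBDPLFunction` — and have the SAME constant term — tree theorem
`X11b.constantCoeff_eq_of_isBDPLFunction` — so the `∀`-frame currency asserts nothing beyond ONE frame).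
The Γ₀-term `ord_p r_f − ord_p m_f` is what the two-variable machinery produces ([BSTW24 Prop. 4.13]); on X11b (`p ∥ N`) it
VANISHES by Agashe–Ribet–Stein 2012 Thm. 2.1 (b) = the tree's named fact `padicValNat_congruenceNumber_eq_of_not_sq_dvd` — kept
symbolic here (the composition needs only Ribet (a), `ord_p m_f ≤ ord_p r_f`).  With A♯ (`‖X‖ = ‖(1 − a_p/p)·log_ω P_L/c‖²`) this
is the crossing identity `v + 1 + ord_p c + ord_p s + ord_p k + (ord_p r_f − ord_p m_f) = 2·ord_p log_ω e(P_L)` at the family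
exponent `v = v(σ) + v_p(λ/(q·R⁻_𝟙·∏P_ℓ))` (theorem `bstwCrossingNonsplitFamily` below, sorry-free from A♯ + A♭-fam).  Why it
might fail: G1/G2 are open at `p ∣ N`; that the TWO-variable regulator has no exceptional zero at `a_p = −1` is the bet (the
one-variable cyclotomic Coleman map at `a_p = −1` is NOT used — that road computes a `p`-adic height and meets the barrier
`PAdicHeightNondegeneracy`); the family-level form is (pointwise) STRONGER than the admissible-class form only in that it speaks of
every value-pinned family, not only of those dominating an admissible class — Kato Thm. 12.5 (1) / Ex. 13.3: every such family's
bottom class is `(q·R⁻_𝟙·∏P_ℓ/λ)·z^{Kato}` up to `ℤ_{(p)}^×`, so the two forms carry the same mathematics.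
[cite: BurungaleSkinnerTianWan2024, Thm. 1.13 (p. 5), Thm. 6.4 (p. 59), §6.2.1 (comp-with-Kato), (GRL=logheegner), (log-Kato-elt-1) = (up-to-u_L) (p. 60), Prop. 4.13, Thm. 4.26 (arXiv:2409.01350 pp. 43, 46–47, 59–60)]
[cite: Kato2004Asterisque, Thm. 12.5 (1) (pp. 221–222), Ex. 13.3 (p. 225), Lemma 13.10 (1) (p. 230), §14.14 (14.14.1) (p. 243)]
[cite: BertoliniDarmonVenerucci2022, Thm. A] [cite: AgasheRibetStein2012, Thm. 2.1 (a) and (b)] [cite: Mazur1978, Cor. 4.1] -/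
theorem stub_katoBdpCrossingNonsplitFamily :
    ∀ (W : WeierstrassCurve ℚ) [W.IsElliptic] [W.IsGloballyMinimal] (p : ℕ) [Fact p.Prime]
      [ContinuousSMul ℤ_[p] (W.tateModule p)] [Module.Free ℤ_[p] (W.tateModule p)]
      [Module.Finite ℤ_[p] (W.tateModule p)] [NeZero (W.conductorNorm ℤ)],
      ClassX11b W p → 5 ≤ p → Surj W p → ¬ W.HasSplitMultiplicativeReductionAtPrime p →
      ∀ (L : Type) [Field L] [NumberField L], IsImaginaryQuadratic L →
        SatisfiesHeegnerHypothesis (W.conductorNorm ℤ) L → SatisfiesHeegnerHypothesis p L →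
        NumberField.discr L < -4 → Odd (NumberField.discr L) →
        (W.quadraticTwist (NumberField.discr L : ℚ)).entireLFunction 1 ≠ 0 →
      ∀ (Dt : ModularParametrizationData W (W.conductorNorm ℤ))
        (Hd : HeegnerDatum (W.conductorNorm ℤ) (NumberField.discr L)) (w₀ : NumberField.InfinitePlace L)
        (PL : (W.baseChange L).toAffine.Point),
        WeierstrassCurve.Affine.Point.map w₀.embedding.toRatAlgHom PL = heegnerPointComplex Dt Hd →
        ¬ (p : ℤ) ∣ Dt.c →
      ∀ (s : ℚ) (k : ℤ),
        (Real.sqrt ((NumberField.discr L).natAbs : ℝ) : ℂ) *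
            (W.quadraticTwist (NumberField.discr L : ℚ)).entireLFunction 1 = (s : ℂ) * (minusPeriod Dt.f : ℂ) →
        (Dt.c : ℝ) * minusPeriod Dt.f = k * W.imaginaryPeriodRat →
      ∀ (W' : WeierstrassCurve ℚ) [W'.IsElliptic] (D : ModularParametrizationData W' (W.conductorNorm ℤ)),
        D.f = Dt.f →
        (∀ (W'' : WeierstrassCurve ℚ) [W''.IsElliptic] (D'' : ModularParametrizationData W'' (W.conductorNorm ℤ)),
            D''.f = D.f → D.modularDegree ≤ D''.modularDegree) →
      ∀ (K : ZpExtension ℚ p) (hK : K.IsCyclotomic) (γ : absoluteGaloisGroup ℚ)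
        (I : IwasawaH1Data W p K γ), K.IsTopGenerator γ →
      ∀ (hp : p ≠ 2) (N : ℕ) [NeZero N] (f : CuspForm (Gamma0 N) 2), IsNewformOf W f →
      ∀ (ι : (n : ℕ) → (CyclotomicField n ℚ →+* ℂ)) (q : ℚ)
        (Λ : ∀ (m : ℕ) (r : Finset (HeightOneSpectrum (𝓞 ℚ))),
          H1 (tateRep W p) (cycSubgroup p m r) →ₗ[ℤ_[p]] ℚ_[p] ⊗[ℚ] CyclotomicField (cycLevel p m r) ℚ)
        (c d₁ a : ℤ) (A : ℕ) (d' : ℤ)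
        (z : ∀ (m : ℕ) (r : (cyclotomicLevelsRat p (badPlaces c d₁ A N)).Ideals),
          H1 (tateRep W p) ((cyclotomicLevelsRat p (badPlaces c d₁ A N)).level m r.1))
        (x : ∀ (m : ℕ) (r : (cyclotomicLevelsRat p (badPlaces c d₁ A N)).Ideals),
          CyclotomicField (cycLevel p m r.1) ℚ)
        (y : I.H) (perRatio : ℚ),
        q ≠ 0 → ZetaBody W p f ι ((q : ℚ) : ℝ) Λ c d₁ a A z x →
        (∀ n : ℕ, I.proj n y =
          levelToLayer W p hK hp (badPlaces c d₁ A N) n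
            (z (n + 1) (cyclotomicLevelsRat p (badPlaces c d₁ A N)).idealOne)) →
        0 < A → Int.gcd c (6 * p * A) = 1 → Int.gcd d₁ (6 * p * N) = 1 → (d₁ : ℤ) * d' ≡ 1 [ZMOD (A : ℤ)] →
        ratCuspFactor f true c d₁ a A d' ≠ 0 → perRatio ≠ 0 →
        plusPeriod f = ((perRatio : ℚ) : ℝ) * W.realPeriodRat →
      ∀ (ι' : PadicAlgCl p ≃+* ℂ)
        (κ : ZpExtension L p) (γ' : absoluteGaloisGroup L) (ΩK : ℂ) (Ωp : (unrIntegers p)ˣ) (Λf : UnrSeries p),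
        κ.IsAnticyclotomic → κ.IsTopGenerator γ' → ΩK ≠ 0 →
        IsBDPLFunction ι' (X11b.primeOfEmbeddingDatum p ι' w₀.embedding) κ γ' Dt.f ΩK
          ((Ωp : unrIntegers p) : ℂ_[p]) Λf →
      ∀ (X : ℂ_[p]), Λf.HasValueAt 0 X →
      ∀ σ : ℚ_[p], HasLocPKummerLog W p (bottomClass W p K I y) σ → σ ≠ 0 →
        ‖X‖ = (p : ℝ) ^ (1 + padicValInt p Dt.c - padicValRat p s - padicValInt p k -
            ((padicValNat p (congruenceNumber Dt.f) : ℤ) - padicValNat p D.modularDegree) -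
            (σ.valuation + padicValRat p (perRatio /
              (q * ratCuspFactor f true c d₁ a A d' * ∏ ℓ ∈ A.primeFactors.erase p, eulerFactorAtOne W N ℓ)))) := by
  sorry

/-- **A♭ (revs 3.4–3.6's research stub `stub_katoBdpCrossingNonsplit`) is, since rev 3.7, a THEOREM of A♭-fam** (sorry-free
glue; ONE binder added to the rev 3.4–3.6 statement: `W` of POSITIVE RANK, which the composition has from `h1`): for EVERY BDP
frame and its value `X` at `𝟙` and EVERY Kummer logarithm `t ≠ 0` of the bottom layer of an ADMISSIBLE zeta class,
`‖X‖ = p^{1 + ord_p c − ord_p s − ord_p k − (ord_p r_f − ord_p m_f) − ord_p t}`.  Proof: the LEAD's TRANSFER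
`ErratumRoadFiveKatoFframeAdmissibleLogTransfer.exists_family_kummerLog_transfer_of_isAdmissibleZetaClass` (p768925: an admissible
`z₀` is dominated by the Λ-adic lift `y` of a value-pinned Kato family, `c₁•proj₀ z₀ = c₂•proj₀ y`, and for Kummer logarithms `t`
of `proj₀ z₀`, `σ` of `proj₀ y`: `t ≠ 0 ↔ σ ≠ 0`, `v(t) = v(σ) + v_p(λ/(q·R⁻_𝟙·∏P_ℓ))`), a Kummer logarithm `σ` of `proj₀ y`
from `ErratumRoadFiveKatoFframeValueAtoms.exists_hasLocPKummerLog_bottomClass` (p766845, positive rank), and A♭-fam at `(y, σ)`;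
`T_pE` free of finite rank over `ℤ_p` by the tree theorems `WeierstrassCurve.module_free_tateModule_holds` /
`WeierstrassCurve.module_finite_tateModule_holds`.
[cite: Kato2004Asterisque, Thm. 12.5 (1) (pp. 221–222), Lemma 13.10 (1) (p. 230), §14.14 (14.14.1) (p. 243)]
[cite: BurungaleSkinnerTianWan2024, §6.2.1 (arXiv:2409.01350 pp. 59–60)] -/
theorem katoBdpCrossingNonsplit_of_family :
    ∀ (W : WeierstrassCurve ℚ) [W.IsElliptic] [W.IsGloballyMinimal] (p : ℕ) [Fact p.Prime]
      [ContinuousSMul ℤ_[p] (W.tateModule p)] [NeZero (W.conductorNorm ℤ)],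
      ClassX11b W p → 5 ≤ p → Surj W p → ¬ W.HasSplitMultiplicativeReductionAtPrime p → W.mordellWeilRank ≠ 0 →
      ∀ (L : Type) [Field L] [NumberField L], IsImaginaryQuadratic L →
        SatisfiesHeegnerHypothesis (W.conductorNorm ℤ) L → SatisfiesHeegnerHypothesis p L →
        NumberField.discr L < -4 → Odd (NumberField.discr L) →
        (W.quadraticTwist (NumberField.discr L : ℚ)).entireLFunction 1 ≠ 0 →
      ∀ (Dt : ModularParametrizationData W (W.conductorNorm ℤ))
        (Hd : HeegnerDatum (W.conductorNorm ℤ) (NumberField.discr L)) (w₀ : NumberField.InfinitePlace L)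
        (PL : (W.baseChange L).toAffine.Point),
        WeierstrassCurve.Affine.Point.map w₀.embedding.toRatAlgHom PL = heegnerPointComplex Dt Hd →
        ¬ (p : ℤ) ∣ Dt.c →
      ∀ (s : ℚ) (k : ℤ),
        (Real.sqrt ((NumberField.discr L).natAbs : ℝ) : ℂ) *
            (W.quadraticTwist (NumberField.discr L : ℚ)).entireLFunction 1 = (s : ℂ) * (minusPeriod Dt.f : ℂ) →
        (Dt.c : ℝ) * minusPeriod Dt.f = k * W.imaginaryPeriodRat →
      ∀ (W' : WeierstrassCurve ℚ) [W'.IsElliptic] (D : ModularParametrizationData W' (W.conductorNorm ℤ)),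
        D.f = Dt.f →
        (∀ (W'' : WeierstrassCurve ℚ) [W''.IsElliptic] (D'' : ModularParametrizationData W'' (W.conductorNorm ℤ)),
            D''.f = D.f → D.modularDegree ≤ D''.modularDegree) →
      ∀ (K : ZpExtension ℚ p) (hK : K.IsCyclotomic) (γ : absoluteGaloisGroup ℚ)
        (I : IwasawaH1Data W p K γ) (z₀ : I.H), K.IsTopGenerator γ → IsAdmissibleZetaClass W p K hK I z₀ →
      ∀ (ι' : PadicAlgCl p ≃+* ℂ)
        (κ : ZpExtension L p) (γ' : absoluteGaloisGroup L) (ΩK : ℂ) (Ωp : (unrIntegers p)ˣ) (Λf : UnrSeries p),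
        κ.IsAnticyclotomic → κ.IsTopGenerator γ' → ΩK ≠ 0 →
        IsBDPLFunction ι' (X11b.primeOfEmbeddingDatum p ι' w₀.embedding) κ γ' Dt.f ΩK
          ((Ωp : unrIntegers p) : ℂ_[p]) Λf →
      ∀ (X : ℂ_[p]), Λf.HasValueAt 0 X →
      ∀ t : ℚ_[p], HasLocPKummerLog W p (bottomClass W p K I z₀) t → t ≠ 0 →
        ‖X‖ = (p : ℝ) ^ (1 + padicValInt p Dt.c - padicValRat p s - padicValInt p k -
            ((padicValNat p (congruenceNumber Dt.f) : ℤ) - padicValNat p D.modularDegree) - t.valuation) := by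
  intro W _ _ p _ _ _ hX h5 hS hns hr L _ _ hLq hH hHp hd4 hodd hLt Dt Hd w₀ PL hPL hc s k hs hk W' _ D hDf hmin
    K hK γ I z₀ hγ hz ι' κ γ' ΩK Ωp Λf hκ hγ' hΩK hBDP X hXv t ht ht0
  haveI : Module.Free ℤ_[p] (W.tateModule p) := WeierstrassCurve.module_free_tateModule_holds W p
  haveI : Module.Finite ℤ_[p] (W.tateModule p) := WeierstrassCurve.module_finite_tateModule_holds W p
  obtain ⟨hp, N, hN, f, hf, ι, q, Λ, c, d₁, a, A, d', z, x, y, perRatio, c₁, c₂, hq, hzeta, hy, hA, hcg, hd, hdd',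
    hR, hper0, hper, -, -, -, htr⟩ :=
    ErratumRoadFiveKatoFframeAdmissibleLogTransfer.exists_family_kummerLog_transfer_of_isAdmissibleZetaClass W p K hK I z₀ hz
  obtain ⟨σ, hσ⟩ := ErratumRoadFiveKatoFframeValueAtoms.exists_hasLocPKummerLog_bottomClass W p hr K I y
  obtain ⟨-, hiff, hval⟩ := htr t σ ht hσ
  rw [hval ht0]
  exact stub_katoBdpCrossingNonsplitFamily W p hX h5 hS hns L hLq hH hHp hd4 hodd hLt Dt Hd w₀ PL hPL hc s k hs hk
    W' D hDf hmin K hK γ I hγ hp N f hf ι q Λ c d₁ a A d' z x y perRatio hq hzeta hy hA hcg hd hdd' hR hper0 hper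
    ι' κ γ' ΩK Ωp Λf hκ hγ' hΩK hBDP X hXv σ hσ (hiff.mp ht0)

/-- **A♭-fam-split (rev 3.8; RESEARCH, XL — the SPLIT twin of A♭-fam, the file's FOURTH stub):** A♭-fam's statement
VERBATIM with `¬ W.HasSplitMultiplicativeReductionAtPrime p` replaced by `W.HasSplitMultiplicativeReductionAtPrime p` — for every
value-pinned Kato family `(f, ι, q, Λ, c, d₁, a, A, d′, z, x)` of `W` at a SPLIT multiplicative `p ≥ 5` with `ρ̄` onto (Kato's printed
guards, Λ-adic lift `y ∈ I.H`, period ratio `λ ≠ 0`), every BDP frame with value `X` at `𝟙` and every Kummer logarithm `σ ≠ 0` of the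
bottom class of `y`: `‖X‖ = p^{1 + ord_p c − ord_p s − ord_p k − (ord_p r_f − ord_p m_f) − (v(σ) + v_p(λ/(q·R⁻_𝟙·∏_{ℓ∣A,ℓ≠p} P_ℓ(ℓ⁻¹))))}`.
WHY THE SAME EXPONENT (forced, not chosen): the anticyclotomic half A♯ (`bdpFrameValue`: `L_𝔭(f)(𝟙) = u·((1 − a_p p⁻¹)·log_ω e(P_L)/c)²`,
Castella's Thm. 3.2 ∕ JIMJ 2018 Thms. 2.10–2.11 — NATIVELY the `a_p = +1` case), the classical half B (`#Ш_an = n²·#tors²/(2·c·s·k·Tam)`,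
`2 log_ω ι(P_L) = n log_ω x̂` — ALL of `Tam`, `c_p` included, sits in B) and the glue never used the sign, and on X11b (`p ∥ N`, so the
Γ₀-term vanishes by Agashe–Ribet–Stein Thm. 2.1 (b)) B turns EQUALITY in the registered atom `stub_valuationIneqSplit` — whose right-hand
side `ord_p #Ш_an + ord_p Tam − 2 ord_p #tors − 1` the LEAD typed IDENTICAL to the non-split atom's («`−1 = ord_p(1 − a_p p⁻¹)`»; BSD ∧
Kato's main conjecture predict equality for both signs, g13 audit) — into EXACTLY A's identity `v + 1 + ord_p c + ord_p s + ord_p k =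
2 ord_p log_ω e(P_L)`, i.e. (through A♯) into this stub's identity: A♭-fam-split is the EQUALITY CASE of the registered split atom read
through the two sign-free halves, exactly as A♭-fam is for the non-split atom.  STATUS IN PRINT (honestly: NO mechanism in hand, unlike
A♭-fam): NOTHING of BSTW's §6.2.1 chain survives AS DISPLAYED at `a_p = +1` with `p` split in `L` — the comparison factor of
(comp-with-Kato) between `𝒵(g/L)_𝟙` and `z^{Kato}(g) ⊗ z^{Kato}(g ⊗ χ_L)` carries `(1 − a_p(g ⊗ χ_L)⁻¹)`-type Euler factors that VANISH
(`χ_L(p) = 1`), and Perrin-Riou's big-logarithm interpolation factor `(1 − α p⁻¹)(1 − α⁻¹)⁻¹` of (GRL) has a POLE at `α = a_p = +1` (at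
`a_p = −1` it is the harmless `(1 + p⁻¹)/2` of A♭-fam): both displayed relations degenerate (`0 = 0` ∕ `∞·0`) at `𝟙`.  Two candidate
engines, neither in print for this class in integral form: (E1) a DERIVED two-variable zeta element — when the Euler factor of a
Beilinson–Flach-type reciprocity law vanishes, the DERIVATIVE class along the family carries the information, the pole-free («improved»)
law reads it, and «the same 𝓛-invariant which arises in the theory of p-adic L-functions also governs the arithmetic of Euler systems»:
in print for NEIGHBOURING deformations only — Rivero–Rotger's derived Beilinson–Flach elements (adjoint setting; JEMS 2021,
arXiv:1806.10022), Rivero's generalized Kato classes for `E` SPLIT MULTIPLICATIVE at `p` (arXiv:2103.00987, abstract and p. 3: «an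
exceptional vanishing of the generalized cohomology classes … a putative refinement in terms of some derived generalized cohomology
classes»), cyclotomic derivatives of Beilinson–Flach classes (arXiv:2103.00990) — NOT for BSTW's anticyclotomic CM deformation `𝒵(g/L)` of
a `p`-Steinberg `g` with `p` split in `L`; the transplant (derive `𝒵(g/L)` at `𝟙` along the anticyclotomic line, read it by the improved
(GRL), compare with `z^{Kato}(g) ⊗ z^{Kato}(g ⊗ χ_L)` through the derivative of the vanishing factor, and CANCEL the two 𝓛-type constants —
Greenberg–Stevens style) is this stub's UNWRITTEN mechanism; (E2) the exceptional-zero road Bertolini–Darmon 2007 ∕ Venerucci 2016 ∕ Mok (card `kato-bottom-layer-exczero` of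
this crux): in print it yields Perrin-Riou's formula at a split Steinberg `p` in RATIONAL form only — Venerucci 2016 Thm. A ∕ Thm. 2.1
(`log_A res_p ζ^{BK} = ℓ₁·log_A(𝐏)²` with `ℓ₁ = −2ℓ·ord_p(q_A)·(1 − p⁻¹)`, `2ℓ⁻¹ = η_f·√D_K·L(A,ε_K,1)/Ω_A⁻ ∈ ℚˣ`; arXiv:1407.1913 p. 6 and
p. 9, hypothesis (α): «`Np = pN⁺N⁻`, `pN⁻` square-free, a prime of `Np` divides `pN⁻` iff it is inert in `K`», `𝐏` from the Shimura curve
`X_{N⁺,pN⁻}` of the INDEFINITE algebra of discriminant `pN⁻` — so `N⁻` is a set of an ODD number of further Steinberg primes inert in `K`,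
an auxiliary INERT SET, unavailable on this crux's class by its very name; Rem. 2.2: «see [Mok] for the general case») and
Bertolini–Darmon–Venerucci 2022 (Kim 2022 Thm. 2.1: «up to a non-zero rational number»).  CAVEAT recorded for the critic: Venerucci's `ℓ₁`
DISPLAYS the factor `ord_p(q_A) = c_p(A)`; in this door `c_p` lives only in B's `Tam`, and whether Venerucci's `c_p` is absorbed by the
Shimura-curve normalisation of `𝐏` (Ribet–Takahashi's degree ratio `∏_{q ∣ pN⁻} c_q`) is NOT audited here — the cheapest falsifier of THIS
stub (not of the atom, which is an inequality) is that audit, or one rank-one example with `p ∣ c_p`.  DOCKING POINTS for the split sign: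
(i) this stub (BDP-crossing shape, ∀ frames) ⟹ everything of §3b; (ii) ANY proof of the A-shaped crossing `hcross` (`∃ e, r_f ≠ 0 ∧ v + 1 +
ord_p c + ord_p s + ord_p k + Γ₀ = 2 ord_p log_ω e(P_L)`) feeds the sign-free core `valuationIneq_core_of_crossing` DIRECTLY — the natural
dock for an (E2)-engine, which compares Kato's class with a (Stark–)Heegner POINT rather than with the BDP VALUE.  This stub may well be
HARDER than A♭-fam; it is filed so that the split atom `stub_valuationIneqSplit` has the SAME typed door, not because a mechanism is in
hand.  No registered stub, no crux and no summit statement follows from typing it.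
[cite: BurungaleSkinnerTianWan2024, §6.2.1 (arXiv:2409.01350 pp. 59–60), Thm. 1.13 (p. 5)]
[cite: Venerucci2016, Thm. A (arXiv:1407.1913 p. 3), §2 eq. for ℓ₁ (p. 6), Thm. 2.1 and Rem. 2.2 with (α), (β) (p. 9)]
[cite: BertoliniDarmon2007] [cite: GreenbergStevens1993] [cite: BertoliniDarmonVenerucci2022, Thm. A] [cite: Kim2022, Thm. 2.1]
[cite: AgasheRibetStein2012, Thm. 2.1 (b)] [cite: GrossZagier1986, Thm. I.(7.3)]
[cite: Kato2004Asterisque, Thm. 12.5 (1) (pp. 221–222), Ex. 13.3 (p. 225), Lemma 13.10 (1) (p. 230)]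
[cite: Castella2018Exceptional, Thms. 2.10–2.11 (arXiv:1507.04260 pp. 13–14)] -/
theorem stub_katoBdpCrossingSplitFamily :
    ∀ (W : WeierstrassCurve ℚ) [W.IsElliptic] [W.IsGloballyMinimal] (p : ℕ) [Fact p.Prime]
      [ContinuousSMul ℤ_[p] (W.tateModule p)] [Module.Free ℤ_[p] (W.tateModule p)]
      [Module.Finite ℤ_[p] (W.tateModule p)] [NeZero (W.conductorNorm ℤ)],
      ClassX11b W p → 5 ≤ p → Surj W p → W.HasSplitMultiplicativeReductionAtPrime p →
      ∀ (L : Type) [Field L] [NumberField L], IsImaginaryQuadratic L →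
        SatisfiesHeegnerHypothesis (W.conductorNorm ℤ) L → SatisfiesHeegnerHypothesis p L →
        NumberField.discr L < -4 → Odd (NumberField.discr L) →
        (W.quadraticTwist (NumberField.discr L : ℚ)).entireLFunction 1 ≠ 0 →
      ∀ (Dt : ModularParametrizationData W (W.conductorNorm ℤ))
        (Hd : HeegnerDatum (W.conductorNorm ℤ) (NumberField.discr L)) (w₀ : NumberField.InfinitePlace L)
        (PL : (W.baseChange L).toAffine.Point),
        WeierstrassCurve.Affine.Point.map w₀.embedding.toRatAlgHom PL = heegnerPointComplex Dt Hd →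
        ¬ (p : ℤ) ∣ Dt.c →
      ∀ (s : ℚ) (k : ℤ),
        (Real.sqrt ((NumberField.discr L).natAbs : ℝ) : ℂ) *
            (W.quadraticTwist (NumberField.discr L : ℚ)).entireLFunction 1 = (s : ℂ) * (minusPeriod Dt.f : ℂ) →
        (Dt.c : ℝ) * minusPeriod Dt.f = k * W.imaginaryPeriodRat →
      ∀ (W' : WeierstrassCurve ℚ) [W'.IsElliptic] (D : ModularParametrizationData W' (W.conductorNorm ℤ)),
        D.f = Dt.f →
        (∀ (W'' : WeierstrassCurve ℚ) [W''.IsElliptic] (D'' : ModularParametrizationData W'' (W.conductorNorm ℤ)),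
            D''.f = D.f → D.modularDegree ≤ D''.modularDegree) →
      ∀ (K : ZpExtension ℚ p) (hK : K.IsCyclotomic) (γ : absoluteGaloisGroup ℚ)
        (I : IwasawaH1Data W p K γ), K.IsTopGenerator γ →
      ∀ (hp : p ≠ 2) (N : ℕ) [NeZero N] (f : CuspForm (Gamma0 N) 2), IsNewformOf W f →
      ∀ (ι : (n : ℕ) → (CyclotomicField n ℚ →+* ℂ)) (q : ℚ)
        (Λ : ∀ (m : ℕ) (r : Finset (HeightOneSpectrum (𝓞 ℚ))),
          H1 (tateRep W p) (cycSubgroup p m r) →ₗ[ℤ_[p]] ℚ_[p] ⊗[ℚ] CyclotomicField (cycLevel p m r) ℚ)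
        (c d₁ a : ℤ) (A : ℕ) (d' : ℤ)
        (z : ∀ (m : ℕ) (r : (cyclotomicLevelsRat p (badPlaces c d₁ A N)).Ideals),
          H1 (tateRep W p) ((cyclotomicLevelsRat p (badPlaces c d₁ A N)).level m r.1))
        (x : ∀ (m : ℕ) (r : (cyclotomicLevelsRat p (badPlaces c d₁ A N)).Ideals),
          CyclotomicField (cycLevel p m r.1) ℚ)
        (y : I.H) (perRatio : ℚ),
        q ≠ 0 → ZetaBody W p f ι ((q : ℚ) : ℝ) Λ c d₁ a A z x →
        (∀ n : ℕ, I.proj n y =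
          levelToLayer W p hK hp (badPlaces c d₁ A N) n
            (z (n + 1) (cyclotomicLevelsRat p (badPlaces c d₁ A N)).idealOne)) →
        0 < A → Int.gcd c (6 * p * A) = 1 → Int.gcd d₁ (6 * p * N) = 1 → (d₁ : ℤ) * d' ≡ 1 [ZMOD (A : ℤ)] →
        ratCuspFactor f true c d₁ a A d' ≠ 0 → perRatio ≠ 0 →
        plusPeriod f = ((perRatio : ℚ) : ℝ) * W.realPeriodRat →
      ∀ (ι' : PadicAlgCl p ≃+* ℂ)
        (κ : ZpExtension L p) (γ' : absoluteGaloisGroup L) (ΩK : ℂ) (Ωp : (unrIntegers p)ˣ) (Λf : UnrSeries p),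
        κ.IsAnticyclotomic → κ.IsTopGenerator γ' → ΩK ≠ 0 →
        IsBDPLFunction ι' (X11b.primeOfEmbeddingDatum p ι' w₀.embedding) κ γ' Dt.f ΩK
          ((Ωp : unrIntegers p) : ℂ_[p]) Λf →
      ∀ (X : ℂ_[p]), Λf.HasValueAt 0 X →
      ∀ σ : ℚ_[p], HasLocPKummerLog W p (bottomClass W p K I y) σ → σ ≠ 0 →
        ‖X‖ = (p : ℝ) ^ (1 + padicValInt p Dt.c - padicValRat p s - padicValInt p k -
            ((padicValNat p (congruenceNumber Dt.f) : ℤ) - padicValNat p D.modularDegree) -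
            (σ.valuation + padicValRat p (perRatio /
              (q * ratCuspFactor f true c d₁ a A d' * ∏ ℓ ∈ A.primeFactors.erase p, eulerFactorAtOne W N ℓ)))) := by
  sorry

/-- **A♭-split in the ADMISSIBLE-CLASS currency, a THEOREM of A♭-fam-split** (rev 3.8; sorry-free glue = the proof of
`katoBdpCrossingNonsplit_of_family` verbatim — the LEAD's transfer `exists_family_kummerLog_transfer_of_isAdmissibleZetaClass` (p768925)
and `exists_hasLocPKummerLog_bottomClass` (p766845) are sign-free): at a SPLIT multiplicative `p`, for `W` of positive rank, every BDP
frame with value `X` at `𝟙` and every Kummer logarithm `t ≠ 0` of the bottom layer of an ADMISSIBLE zeta class,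
`‖X‖ = p^{1 + ord_p c − ord_p s − ord_p k − (ord_p r_f − ord_p m_f) − ord_p t}`.
[cite: Kato2004Asterisque, Thm. 12.5 (1) (pp. 221–222), Lemma 13.10 (1) (p. 230), §14.14 (14.14.1) (p. 243)] -/
theorem katoBdpCrossingSplit_of_family :
    ∀ (W : WeierstrassCurve ℚ) [W.IsElliptic] [W.IsGloballyMinimal] (p : ℕ) [Fact p.Prime]
      [ContinuousSMul ℤ_[p] (W.tateModule p)] [NeZero (W.conductorNorm ℤ)],
      ClassX11b W p → 5 ≤ p → Surj W p → W.HasSplitMultiplicativeReductionAtPrime p → W.mordellWeilRank ≠ 0 →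
      ∀ (L : Type) [Field L] [NumberField L], IsImaginaryQuadratic L →
        SatisfiesHeegnerHypothesis (W.conductorNorm ℤ) L → SatisfiesHeegnerHypothesis p L →
        NumberField.discr L < -4 → Odd (NumberField.discr L) →
        (W.quadraticTwist (NumberField.discr L : ℚ)).entireLFunction 1 ≠ 0 →
      ∀ (Dt : ModularParametrizationData W (W.conductorNorm ℤ))
        (Hd : HeegnerDatum (W.conductorNorm ℤ) (NumberField.discr L)) (w₀ : NumberField.InfinitePlace L)
        (PL : (W.baseChange L).toAffine.Point),
        WeierstrassCurve.Affine.Point.map w₀.embedding.toRatAlgHom PL = heegnerPointComplex Dt Hd →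
        ¬ (p : ℤ) ∣ Dt.c →
      ∀ (s : ℚ) (k : ℤ),
        (Real.sqrt ((NumberField.discr L).natAbs : ℝ) : ℂ) *
            (W.quadraticTwist (NumberField.discr L : ℚ)).entireLFunction 1 = (s : ℂ) * (minusPeriod Dt.f : ℂ) →
        (Dt.c : ℝ) * minusPeriod Dt.f = k * W.imaginaryPeriodRat →
      ∀ (W' : WeierstrassCurve ℚ) [W'.IsElliptic] (D : ModularParametrizationData W' (W.conductorNorm ℤ)),
        D.f = Dt.f →
        (∀ (W'' : WeierstrassCurve ℚ) [W''.IsElliptic] (D'' : ModularParametrizationData W'' (W.conductorNorm ℤ)),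
            D''.f = D.f → D.modularDegree ≤ D''.modularDegree) →
      ∀ (K : ZpExtension ℚ p) (hK : K.IsCyclotomic) (γ : absoluteGaloisGroup ℚ)
        (I : IwasawaH1Data W p K γ) (z₀ : I.H), K.IsTopGenerator γ → IsAdmissibleZetaClass W p K hK I z₀ →
      ∀ (ι' : PadicAlgCl p ≃+* ℂ)
        (κ : ZpExtension L p) (γ' : absoluteGaloisGroup L) (ΩK : ℂ) (Ωp : (unrIntegers p)ˣ) (Λf : UnrSeries p),
        κ.IsAnticyclotomic → κ.IsTopGenerator γ' → ΩK ≠ 0 →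
        IsBDPLFunction ι' (X11b.primeOfEmbeddingDatum p ι' w₀.embedding) κ γ' Dt.f ΩK
          ((Ωp : unrIntegers p) : ℂ_[p]) Λf →
      ∀ (X : ℂ_[p]), Λf.HasValueAt 0 X →
      ∀ t : ℚ_[p], HasLocPKummerLog W p (bottomClass W p K I z₀) t → t ≠ 0 →
        ‖X‖ = (p : ℝ) ^ (1 + padicValInt p Dt.c - padicValRat p s - padicValInt p k -
            ((padicValNat p (congruenceNumber Dt.f) : ℤ) - padicValNat p D.modularDegree) - t.valuation) := by
  intro W _ _ p _ _ _ hX h5 hS hsp hr L _ _ hLq hH hHp hd4 hodd hLt Dt Hd w₀ PL hPL hc s k hs hk W' _ D hDf hmin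
    K hK γ I z₀ hγ hz ι' κ γ' ΩK Ωp Λf hκ hγ' hΩK hBDP X hXv t ht ht0
  haveI : Module.Free ℤ_[p] (W.tateModule p) := WeierstrassCurve.module_free_tateModule_holds W p
  haveI : Module.Finite ℤ_[p] (W.tateModule p) := WeierstrassCurve.module_finite_tateModule_holds W p
  obtain ⟨hp, N, hN, f, hf, ι, q, Λ, c, d₁, a, A, d', z, x, y, perRatio, c₁, c₂, hq, hzeta, hy, hA, hcg, hd, hdd',
    hR, hper0, hper, -, -, -, htr⟩ :=
    ErratumRoadFiveKatoFframeAdmissibleLogTransfer.exists_family_kummerLog_transfer_of_isAdmissibleZetaClass W p K hK I z₀ hz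
  obtain ⟨σ, hσ⟩ := ErratumRoadFiveKatoFframeValueAtoms.exists_hasLocPKummerLog_bottomClass W p hr K I y
  obtain ⟨-, hiff, hval⟩ := htr t σ ht hσ
  rw [hval ht0]
  exact stub_katoBdpCrossingSplitFamily W p hX h5 hS hsp L hLq hH hHp hd4 hodd hLt Dt Hd w₀ PL hPL hc s k hs hk
    W' D hDf hmin K hK γ I hγ hp N f hf ι q Λ c d₁ a A d' z x y perRatio hq hzeta hy hA hcg hd hdd' hR hper0 hper
    ι' κ γ' ΩK Ωp Λf hκ hγ' hΩK hBDP X hXv σ hσ (hiff.mp ht0)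

/-- **A♯ on the SEMISTABLE members of X11b is print** (sorry-free): A♯'s statement with `Semistable W` inserted,
from the named fact `Castella2018.thm32_exists_isBDPLFunction_valueAtOne` (Cas18 Thms. 3.1–3.2) ALONE — the embedding
datum `ℚ̄_p ≃ ℂ` is the tree theorem `PadicAlgCl.nonempty_ringEquiv_complex` (Steinitz) — via
`bdpFrameValue_of_thm32`.
[cite: Castella2018, Thm. 3.1 and Thm. 3.2 (arXiv:1704.06608 p. 9)] -/
theorem bdpFrameValue_of_semistable (h32 : thm32_exists_isBDPLFunction_valueAtOne) :
    ∀ (W : WeierstrassCurve ℚ) [W.IsElliptic] [W.IsGloballyMinimal] (p : ℕ) [Fact p.Prime]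
      [NeZero (W.conductorNorm ℤ)],
      ClassX11b W p → 5 ≤ p → Semistable W → Surj W p →
      ∀ (L : Type) [Field L] [NumberField L], IsImaginaryQuadratic L →
        SatisfiesHeegnerHypothesis (W.conductorNorm ℤ) L → SatisfiesHeegnerHypothesis p L →
        NumberField.discr L < -4 → Odd (NumberField.discr L) →
      ∀ (Dt : ModularParametrizationData W (W.conductorNorm ℤ))
        (Hd : HeegnerDatum (W.conductorNorm ℤ) (NumberField.discr L)) (w₀ : NumberField.InfinitePlace L)
        (PL : (W.baseChange L).toAffine.Point),
        WeierstrassCurve.Affine.Point.map w₀.embedding.toRatAlgHom PL = heegnerPointComplex Dt Hd →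
        ¬ (p : ℤ) ∣ Dt.c →
      ∃ (ι' : PadicAlgCl p ≃+* ℂ) (e : L →+* ℚ_[p])
        (κ : ZpExtension L p) (γ : absoluteGaloisGroup L) (ΩK : ℂ) (Ωp : (unrIntegers p)ˣ) (Λf : UnrSeries p),
        (∀ x : 𝓞 L, x ∈ (X11b.primeOfEmbeddingDatum p ι' w₀.embedding).asIdeal ↔ ‖e (x : L)‖ < 1) ∧
        κ.IsAnticyclotomic ∧ κ.IsTopGenerator γ ∧ ΩK ≠ 0 ∧
        IsBDPLFunction ι' (X11b.primeOfEmbeddingDatum p ι' w₀.embedding) κ γ Dt.f ΩK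
          ((Ωp : unrIntegers p) : ℂ_[p]) Λf ∧
        ∃ u : (unrIntegers p)ˣ, Λf.HasValueAt 0
          (((u : unrIntegers p) : ℂ_[p]) *
            (algebraMap ℚ_[p] ℂ_[p]
              (((1 : ℚ_[p]) - (W.LFunction p : ℚ_[p]) * (p : ℚ_[p])⁻¹) * padicLogOmega W p e PL /
                (Dt.c : ℚ_[p]))) ^ 2) := by
  intro W _ _ p _ _ hX h5 hss _ L _ _ hLq hH hHp _ _ Dt Hd w₀ PL hPL hc
  obtain ⟨ι₀⟩ := PadicAlgCl.nonempty_ringEquiv_complex p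
  exact bdpFrameValue_of_thm32 h32 ι₀ W hX h5 hss L hLq hH hHp Dt Hd w₀ PL hc hPL

/-- **A♯ — the anticyclotomic half, ALL of X11b, modulo the named facts `thm32` and `hVC`** (sorry-free glue): by cases
on `Semistable W` — the semistable members from print (`bdpFrameValue_of_semistable`), the others from the
residual stub (A♯-print, via `bdpFrame_of_print`) + print (`bdpFrameValue_of_frame`).  This is rev 3–3.4's A♯ statement with ONE binder
added (rev 3.5): `P_L` of infinite order. -/
theorem bdpFrameValue (h32 : thm32_exists_isBDPLFunction_valueAtOne)
    (hVC : castella2018Exceptional_bdpValueContinuity_trivialChar) :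
    ∀ (W : WeierstrassCurve ℚ) [W.IsElliptic] [W.IsGloballyMinimal] (p : ℕ) [Fact p.Prime]
      [NeZero (W.conductorNorm ℤ)],
      ClassX11b W p → 5 ≤ p → Surj W p →
      ∀ (L : Type) [Field L] [NumberField L], IsImaginaryQuadratic L →
        SatisfiesHeegnerHypothesis (W.conductorNorm ℤ) L → SatisfiesHeegnerHypothesis p L →
        NumberField.discr L < -4 → Odd (NumberField.discr L) →
      ∀ (Dt : ModularParametrizationData W (W.conductorNorm ℤ))
        (Hd : HeegnerDatum (W.conductorNorm ℤ) (NumberField.discr L)) (w₀ : NumberField.InfinitePlace L)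
        (PL : (W.baseChange L).toAffine.Point),
        WeierstrassCurve.Affine.Point.map w₀.embedding.toRatAlgHom PL = heegnerPointComplex Dt Hd →
        ¬ (p : ℤ) ∣ Dt.c → ¬ IsOfFinAddOrder PL →
      ∃ (ι' : PadicAlgCl p ≃+* ℂ) (e : L →+* ℚ_[p])
        (κ : ZpExtension L p) (γ : absoluteGaloisGroup L) (ΩK : ℂ) (Ωp : (unrIntegers p)ˣ) (Λf : UnrSeries p),
        (∀ x : 𝓞 L, x ∈ (X11b.primeOfEmbeddingDatum p ι' w₀.embedding).asIdeal ↔ ‖e (x : L)‖ < 1) ∧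
        κ.IsAnticyclotomic ∧ κ.IsTopGenerator γ ∧ ΩK ≠ 0 ∧
        IsBDPLFunction ι' (X11b.primeOfEmbeddingDatum p ι' w₀.embedding) κ γ Dt.f ΩK
          ((Ωp : unrIntegers p) : ℂ_[p]) Λf ∧
        ∃ u : (unrIntegers p)ˣ, Λf.HasValueAt 0
          (((u : unrIntegers p) : ℂ_[p]) *
            (algebraMap ℚ_[p] ℂ_[p]
              (((1 : ℚ_[p]) - (W.LFunction p : ℚ_[p]) * (p : ℚ_[p])⁻¹) * padicLogOmega W p e PL /
                (Dt.c : ℚ_[p]))) ^ 2) := by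
  intro W _ _ p _ _ hX h5 hS L _ _ hLq hH hHp hd4 hodd Dt Hd w₀ PL hPL hc hinf
  by_cases hss : Semistable W
  · exact bdpFrameValue_of_semistable h32 W p hX h5 hss hS L hLq hH hHp hd4 hodd Dt Hd w₀ PL hPL hc
  · exact bdpFrameValue_of_frame hVC W p hX h5 hss hS L hLq hH hHp hd4 hodd Dt Hd w₀ PL hPL hc hinf

/-- **`r_f ≠ 0` for the newform of a modular parametrisation datum** (a tree theorem: Pasten–Shimura,
`r_f ∣ ∏_{P ≠ 𝕀_f} η_f(P) > 0`; the same two lines as `Theorems.ManinLocalTwoThree.congruenceNumber_ne_zero_of_datum`,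
restated to keep this workfile's imports light). [cite: PastenShimura2024, §5.4–5.6 (pp. 17–19)] -/
theorem congruenceNumber_ne_zero_of_datum {N : ℕ} [NeZero N] {W : WeierstrassCurve ℚ}
    (D : ModularParametrizationData W N) : congruenceNumber D.f ≠ 0 := fun h0 =>
  (Nat.pos_iff_ne_zero.mp D.prod_heckeCongruenceModulus_pos)
    (Nat.eq_zero_of_zero_dvd (h0 ▸ D.congruenceNumber_dvd_prod_heckeCongruenceModulus))

/-- **A — the crossing identity from A♯ and a NORM IDENTITY of A♭'s shape, at an ABSTRACT exponent `v`** (sorry-free glue, rev 3.7's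
common proof of the two instances below; the embedding `e : L → ℚ_p` is the one A♯'s frame reads its logarithm through — at
`w = −1` the two primes above `p` give the same `ord_p log_ω`, `P̄_L − P_L` being torsion, cf. B).  From A♯ (`bdpFrameValue`:
a frame with `L_𝔭(f)(𝟙) = u·((1 − a_p p⁻¹)·log_ω e(P_L)/c)²`) and `hflat` (`‖X‖ = p^{1 + ord_p c − ord_p s − ord_p k − (ord_p r_f −
ord_p m_f) − v}` for every frame and value): `∃ e`, `r_f ≠ 0` (Pasten–Shimura) with `v + 1 + ord_p c + ord_p s + ord_p k + (ord_p r_f −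
ord_p m_f) = 2·ord_p log_ω e(P_L)`; `c ≠ 0` in `ℚ_p` and `log_ω e(P_L) ≠ 0` come OUT (`‖X‖` is a power of `p`), `ord_p(1 − a_p/p) = −1`
(`a_p = ±1`, Kraus–Oesterlé).  For `P_L` of INFINITE ORDER (a binder the composition discharges from B).
[cite: BurungaleSkinnerTianWan2024, §6.2.1 (arXiv:2409.01350 pp. 59–60)] [cite: Castella2018, Thm. 3.2 (arXiv:1704.06608 p. 9)] -/
theorem bstwCrossing_of_normIdentity (h32 : thm32_exists_isBDPLFunction_valueAtOne)
    (hVC : castella2018Exceptional_bdpValueContinuity_trivialChar)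
    {W : WeierstrassCurve ℚ} [W.IsElliptic] [W.IsGloballyMinimal] {p : ℕ} [Fact p.Prime]
    [NeZero (W.conductorNorm ℤ)]
    (hX : ClassX11b W p) (h5 : 5 ≤ p) (hS : Surj W p)
    {L : Type} [Field L] [NumberField L] (hLq : IsImaginaryQuadratic L)
    (hH : SatisfiesHeegnerHypothesis (W.conductorNorm ℤ) L) (hHp : SatisfiesHeegnerHypothesis p L)
    (hd4 : NumberField.discr L < -4) (hodd : Odd (NumberField.discr L))
    (Dt : ModularParametrizationData W (W.conductorNorm ℤ))
    (Hd : HeegnerDatum (W.conductorNorm ℤ) (NumberField.discr L)) (w₀ : NumberField.InfinitePlace L)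
    (PL : (W.baseChange L).toAffine.Point)
    (hPL : WeierstrassCurve.Affine.Point.map w₀.embedding.toRatAlgHom PL = heegnerPointComplex Dt Hd)
    (hc : ¬ (p : ℤ) ∣ Dt.c) (hinf : ¬ IsOfFinAddOrder PL) (s : ℚ) (k : ℤ)
    {W' : WeierstrassCurve ℚ} [W'.IsElliptic] (D : ModularParametrizationData W' (W.conductorNorm ℤ)) (v : ℤ)
    (hflat : ∀ (ι' : PadicAlgCl p ≃+* ℂ)
        (κ : ZpExtension L p) (γ' : absoluteGaloisGroup L) (ΩK : ℂ) (Ωp : (unrIntegers p)ˣ) (Λf : UnrSeries p),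
        κ.IsAnticyclotomic → κ.IsTopGenerator γ' → ΩK ≠ 0 →
        IsBDPLFunction ι' (X11b.primeOfEmbeddingDatum p ι' w₀.embedding) κ γ' Dt.f ΩK
          ((Ωp : unrIntegers p) : ℂ_[p]) Λf →
      ∀ (X : ℂ_[p]), Λf.HasValueAt 0 X →
        ‖X‖ = (p : ℝ) ^ (1 + padicValInt p Dt.c - padicValRat p s - padicValInt p k -
            ((padicValNat p (congruenceNumber Dt.f) : ℤ) - padicValNat p D.modularDegree) - v)) :
    ∃ e : L →+* ℚ_[p], congruenceNumber Dt.f ≠ 0 ∧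
      v + 1 + padicValInt p Dt.c + padicValRat p s + padicValInt p k +
          ((padicValNat p (congruenceNumber Dt.f) : ℤ) - padicValNat p D.modularDegree) =
        2 * (padicLogOmega W p e PL).valuation := by
  -- A♯: a BDP frame of `(f, L, p)` with its Waldspurger value at `𝟙`
  obtain ⟨ι', e, κ, γ', ΩK, Ωp, Λf, he, hκ, hγ', hΩK, hBDP, u, hval⟩ :=
    bdpFrameValue h32 hVC W p hX h5 hS L hLq hH hHp hd4 hodd Dt Hd w₀ PL hPL hc hinf
  -- the norm identity at that frame and that value
  have hnorm := hflat ι' κ γ' ΩK Ωp Λf hκ hγ' hΩK hBDP _ hval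
  refine ⟨e, congruenceNumber_ne_zero_of_datum Dt, ?_⟩
  -- names
  set y : ℚ_[p] := ((1 : ℚ_[p]) - (W.LFunction p : ℚ_[p]) * (p : ℚ_[p])⁻¹) * padicLogOmega W p e PL /
    (Dt.c : ℚ_[p]) with hy
  set m : ℤ := 1 + padicValInt p Dt.c - padicValRat p s - padicValInt p k -
    ((padicValNat p (congruenceNumber Dt.f) : ℤ) - padicValNat p D.modularDegree) - v with hm
  have hp1 : (1 : ℝ) < p := by exact_mod_cast (Fact.out : p.Prime).one_lt
  have hp0 : (0 : ℝ) < p := by positivity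
  -- `‖X‖ = ‖y‖²`
  have hXy : ‖(((u : unrIntegers p) : ℂ_[p]) * (algebraMap ℚ_[p] ℂ_[p] y) ^ 2)‖ = ‖y‖ ^ 2 := by
    rw [norm_mul, X11b.Halves.norm_coe_units_unrIntegers, one_mul, norm_pow, norm_algebraMap']
  rw [hXy] at hnorm
  -- hence `y ≠ 0`, so `log_ω e(P_L) ≠ 0` and `c ≠ 0` in `ℚ_p`
  have hy0 : y ≠ 0 := by
    intro h0
    rw [h0, norm_zero, zero_pow two_ne_zero] at hnorm
    exact (zpow_pos hp0 m).ne' hnorm.symm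
  have hfac0 : ((1 : ℚ_[p]) - (W.LFunction p : ℚ_[p]) * (p : ℚ_[p])⁻¹) * padicLogOmega W p e PL ≠ 0 := by
    intro h0; exact hy0 (by rw [hy, h0, zero_div])
  have hc0 : (Dt.c : ℚ_[p]) ≠ 0 := by
    intro h0; exact hy0 (by rw [hy, h0, div_zero])
  have hlog0 : padicLogOmega W p e PL ≠ 0 := fun h0 ↦ hfac0 (by rw [h0, mul_zero])
  have heul0 : (1 : ℚ_[p]) - (W.LFunction p : ℚ_[p]) * (p : ℚ_[p])⁻¹ ≠ 0 := fun h0 ↦ hfac0 (by rw [h0, zero_mul])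
  -- `a_p = ±1` at the multiplicative prime `p`, so `ord_p (1 − a_p p⁻¹) = −1`
  have ha : W.LFunction p = 1 ∨ W.LFunction p = -1 :=
    KrausOesterle1992.lFunction_apply_prime_eq_one_or_eq_neg_one_of_mult W p hX.2.2.1
  have heul : ((1 : ℚ_[p]) - (W.LFunction p : ℚ_[p]) * (p : ℚ_[p])⁻¹).valuation = -1 := by
    have hn := X11b.Halves.norm_one_sub_div_eq p ha
    rw [Padic.norm_eq_zpow_neg_valuation heul0] at hn
    have : (p : ℝ) ^ (-((1 : ℚ_[p]) - (W.LFunction p : ℚ_[p]) * (p : ℚ_[p])⁻¹).valuation) = (p : ℝ) ^ (1 : ℤ) := by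
      rw [hn, zpow_one]
    have hinj := zpow_right_injective₀ hp0 hp1.ne' this
    omega
  -- `ord_p y = −1 + ord_p log − ord_p c`
  have hyval : y.valuation = -1 + (padicLogOmega W p e PL).valuation - padicValInt p Dt.c := by
    rw [hy, div_eq_mul_inv, Padic.valuation_mul (mul_ne_zero heul0 hlog0) (inv_ne_zero hc0),
      Padic.valuation_mul heul0 hlog0, heul, Padic.valuation_inv, Padic.valuation_intCast]
    ring
  -- compare the two expressions for `‖X‖`
  rw [Padic.norm_eq_zpow_neg_valuation hy0, ← zpow_natCast, ← zpow_mul] at hnorm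
  have hexp := zpow_right_injective₀ hp0 hp1.ne' hnorm
  push_cast at hexp
  rw [hyval] at hexp
  omega

/-- **A at the FAMILY exponent** (rev 3.7; sorry-free from A♯ + A♭-fam + Pasten–Shimura): for every value-pinned Kato family `(f, ι, q,
Λ, c, d₁, a, A, d′, z, x)` of `W` at `p` with Λ-adic lift `y` and period ratio `λ`, every Kummer logarithm `σ ≠ 0` of `proj₀ y`, and
`P_L` of infinite order: `∃ e`, `r_f ≠ 0` with `v(σ) + v_p(λ/(q·R⁻_𝟙·∏P_ℓ)) + 1 + ord_p c + ord_p s + ord_p k + (ord_p r_f − ord_p m_f) =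
2·ord_p log_ω e(P_L)`. [cite: BurungaleSkinnerTianWan2024, §6.2.1 (arXiv:2409.01350 pp. 59–60)] [cite: Kato2004Asterisque, Thm. 12.5 (1) (pp. 221–222)] -/
theorem bstwCrossingNonsplitFamily (h32 : thm32_exists_isBDPLFunction_valueAtOne)
    (hVC : castella2018Exceptional_bdpValueContinuity_trivialChar) :
    ∀ (W : WeierstrassCurve ℚ) [W.IsElliptic] [W.IsGloballyMinimal] (p : ℕ) [Fact p.Prime]
      [ContinuousSMul ℤ_[p] (W.tateModule p)] [Module.Free ℤ_[p] (W.tateModule p)]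
      [Module.Finite ℤ_[p] (W.tateModule p)] [NeZero (W.conductorNorm ℤ)],
      ClassX11b W p → 5 ≤ p → Surj W p → ¬ W.HasSplitMultiplicativeReductionAtPrime p →
      ∀ (L : Type) [Field L] [NumberField L], IsImaginaryQuadratic L →
        SatisfiesHeegnerHypothesis (W.conductorNorm ℤ) L → SatisfiesHeegnerHypothesis p L →
        NumberField.discr L < -4 → Odd (NumberField.discr L) →
        (W.quadraticTwist (NumberField.discr L : ℚ)).entireLFunction 1 ≠ 0 →
      ∀ (Dt : ModularParametrizationData W (W.conductorNorm ℤ))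
        (Hd : HeegnerDatum (W.conductorNorm ℤ) (NumberField.discr L)) (w₀ : NumberField.InfinitePlace L)
        (PL : (W.baseChange L).toAffine.Point),
        WeierstrassCurve.Affine.Point.map w₀.embedding.toRatAlgHom PL = heegnerPointComplex Dt Hd →
        ¬ (p : ℤ) ∣ Dt.c → ¬ IsOfFinAddOrder PL →
      ∀ (s : ℚ) (k : ℤ),
        (Real.sqrt ((NumberField.discr L).natAbs : ℝ) : ℂ) *
            (W.quadraticTwist (NumberField.discr L : ℚ)).entireLFunction 1 = (s : ℂ) * (minusPeriod Dt.f : ℂ) →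
        (Dt.c : ℝ) * minusPeriod Dt.f = k * W.imaginaryPeriodRat →
      ∀ (W' : WeierstrassCurve ℚ) [W'.IsElliptic] (D : ModularParametrizationData W' (W.conductorNorm ℤ)),
        D.f = Dt.f →
        (∀ (W'' : WeierstrassCurve ℚ) [W''.IsElliptic] (D'' : ModularParametrizationData W'' (W.conductorNorm ℤ)),
            D''.f = D.f → D.modularDegree ≤ D''.modularDegree) →
      ∀ (K : ZpExtension ℚ p) (hK : K.IsCyclotomic) (γ : absoluteGaloisGroup ℚ)
        (I : IwasawaH1Data W p K γ), K.IsTopGenerator γ →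
      ∀ (hp : p ≠ 2) (N : ℕ) [NeZero N] (f : CuspForm (Gamma0 N) 2), IsNewformOf W f →
      ∀ (ι : (n : ℕ) → (CyclotomicField n ℚ →+* ℂ)) (q : ℚ)
        (Λ : ∀ (m : ℕ) (r : Finset (HeightOneSpectrum (𝓞 ℚ))),
          H1 (tateRep W p) (cycSubgroup p m r) →ₗ[ℤ_[p]] ℚ_[p] ⊗[ℚ] CyclotomicField (cycLevel p m r) ℚ)
        (c d₁ a : ℤ) (A : ℕ) (d' : ℤ)
        (z : ∀ (m : ℕ) (r : (cyclotomicLevelsRat p (badPlaces c d₁ A N)).Ideals),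
          H1 (tateRep W p) ((cyclotomicLevelsRat p (badPlaces c d₁ A N)).level m r.1))
        (x : ∀ (m : ℕ) (r : (cyclotomicLevelsRat p (badPlaces c d₁ A N)).Ideals),
          CyclotomicField (cycLevel p m r.1) ℚ)
        (y : I.H) (perRatio : ℚ),
        q ≠ 0 → ZetaBody W p f ι ((q : ℚ) : ℝ) Λ c d₁ a A z x →
        (∀ n : ℕ, I.proj n y =
          levelToLayer W p hK hp (badPlaces c d₁ A N) n
            (z (n + 1) (cyclotomicLevelsRat p (badPlaces c d₁ A N)).idealOne)) →
        0 < A → Int.gcd c (6 * p * A) = 1 → Int.gcd d₁ (6 * p * N) = 1 → (d₁ : ℤ) * d' ≡ 1 [ZMOD (A : ℤ)] →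
        ratCuspFactor f true c d₁ a A d' ≠ 0 → perRatio ≠ 0 →
        plusPeriod f = ((perRatio : ℚ) : ℝ) * W.realPeriodRat →
      ∀ σ : ℚ_[p], HasLocPKummerLog W p (bottomClass W p K I y) σ → σ ≠ 0 →
      ∃ e : L →+* ℚ_[p], congruenceNumber Dt.f ≠ 0 ∧
        σ.valuation + padicValRat p (perRatio /
              (q * ratCuspFactor f true c d₁ a A d' * ∏ ℓ ∈ A.primeFactors.erase p, eulerFactorAtOne W N ℓ)) +
            1 + padicValInt p Dt.c + padicValRat p s + padicValInt p k +
            ((padicValNat p (congruenceNumber Dt.f) : ℤ) - padicValNat p D.modularDegree) =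
          2 * (padicLogOmega W p e PL).valuation := by
  intro W _ _ p _ _ _ _ _ hX h5 hS hns L _ _ hLq hH hHp hd4 hodd hLt Dt Hd w₀ PL hPL hc hinf s k hs hk W' _ D hDf hmin
    K hK γ I hγ hp N _ f hf ι q Λ c d₁ a A d' z x y perRatio hq hzeta hy hA hcg hd hdd' hR hper0 hper σ hσ hσ0
  exact bstwCrossing_of_normIdentity h32 hVC hX h5 hS hLq hH hHp hd4 hodd Dt Hd w₀ PL hPL hc hinf s k D
    (σ.valuation + padicValRat p (perRatio /
      (q * ratCuspFactor f true c d₁ a A d' * ∏ ℓ ∈ A.primeFactors.erase p, eulerFactorAtOne W N ℓ)))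
    (fun ι' κ γ' ΩK Ωp Λf hκ hγ' hΩK hBDP X hXv =>
      stub_katoBdpCrossingNonsplitFamily W p hX h5 hS hns L hLq hH hHp hd4 hodd hLt Dt Hd w₀ PL hPL hc s k hs hk
        W' D hDf hmin K hK γ I hγ hp N f hf ι q Λ c d₁ a A d' z x y perRatio hq hzeta hy hA hcg hd hdd' hR hper0 hper
        ι' κ γ' ΩK Ωp Λf hκ hγ' hΩK hBDP X hXv σ hσ hσ0)

/-- **A in the ADMISSIBLE-CLASS currency = revs 3.4–3.6's `bstwCrossingNonsplit`** with ONE binder added (rev 3.7): `W` of POSITIVE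
RANK (the composition has it from `h1`).  Sorry-free from A♯ + `katoBdpCrossingNonsplit_of_family` (hence modulo A♭-fam): for `P_L` of
infinite order and every Kummer logarithm `t ≠ 0` of the bottom layer of an admissible zeta class, `∃ e`, `r_f ≠ 0` with
`ord_p t + 1 + ord_p c + ord_p s + ord_p k + (ord_p r_f − ord_p m_f) = 2·ord_p log_ω e(P_L)` — rev 2's single research stub, a theorem
of its halves since rev 3. [cite: BurungaleSkinnerTianWan2024, §6.2.1 (arXiv:2409.01350 pp. 59–60)] [cite: Castella2018, Thm. 3.2 (arXiv:1704.06608 p. 9)] -/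
theorem bstwCrossingNonsplit (h32 : thm32_exists_isBDPLFunction_valueAtOne)
    (hVC : castella2018Exceptional_bdpValueContinuity_trivialChar) :
    ∀ (W : WeierstrassCurve ℚ) [W.IsElliptic] [W.IsGloballyMinimal] (p : ℕ) [Fact p.Prime]
      [ContinuousSMul ℤ_[p] (W.tateModule p)] [NeZero (W.conductorNorm ℤ)],
      ClassX11b W p → 5 ≤ p → Surj W p → ¬ W.HasSplitMultiplicativeReductionAtPrime p → W.mordellWeilRank ≠ 0 →
      ∀ (L : Type) [Field L] [NumberField L], IsImaginaryQuadratic L →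
        SatisfiesHeegnerHypothesis (W.conductorNorm ℤ) L → SatisfiesHeegnerHypothesis p L →
        NumberField.discr L < -4 → Odd (NumberField.discr L) →
        (W.quadraticTwist (NumberField.discr L : ℚ)).entireLFunction 1 ≠ 0 →
      ∀ (Dt : ModularParametrizationData W (W.conductorNorm ℤ))
        (Hd : HeegnerDatum (W.conductorNorm ℤ) (NumberField.discr L)) (w₀ : NumberField.InfinitePlace L)
        (PL : (W.baseChange L).toAffine.Point),
        WeierstrassCurve.Affine.Point.map w₀.embedding.toRatAlgHom PL = heegnerPointComplex Dt Hd →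
        ¬ (p : ℤ) ∣ Dt.c → ¬ IsOfFinAddOrder PL →
      ∀ (s : ℚ) (k : ℤ),
        (Real.sqrt ((NumberField.discr L).natAbs : ℝ) : ℂ) *
            (W.quadraticTwist (NumberField.discr L : ℚ)).entireLFunction 1 = (s : ℂ) * (minusPeriod Dt.f : ℂ) →
        (Dt.c : ℝ) * minusPeriod Dt.f = k * W.imaginaryPeriodRat →
      ∀ (W' : WeierstrassCurve ℚ) [W'.IsElliptic] (D : ModularParametrizationData W' (W.conductorNorm ℤ)),
        D.f = Dt.f →
        (∀ (W'' : WeierstrassCurve ℚ) [W''.IsElliptic] (D'' : ModularParametrizationData W'' (W.conductorNorm ℤ)),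
            D''.f = D.f → D.modularDegree ≤ D''.modularDegree) →
      ∀ (K : ZpExtension ℚ p) (hK : K.IsCyclotomic) (γ : absoluteGaloisGroup ℚ)
        (I : IwasawaH1Data W p K γ) (z₀ : I.H), K.IsTopGenerator γ → IsAdmissibleZetaClass W p K hK I z₀ →
      ∀ t : ℚ_[p], HasLocPKummerLog W p (bottomClass W p K I z₀) t → t ≠ 0 →
      ∃ e : L →+* ℚ_[p], congruenceNumber Dt.f ≠ 0 ∧
        t.valuation + 1 + padicValInt p Dt.c + padicValRat p s + padicValInt p k +
            ((padicValNat p (congruenceNumber Dt.f) : ℤ) - padicValNat p D.modularDegree) =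
          2 * (padicLogOmega W p e PL).valuation := by
  intro W _ _ p _ _ _ hX h5 hS hns hr L _ _ hLq hH hHp hd4 hodd hLt Dt Hd w₀ PL hPL hc hinf s k hs hk W' _ D hDf hmin
    K hK γ I z₀ hγ hz t hlog ht0
  exact bstwCrossing_of_normIdentity h32 hVC hX h5 hS hLq hH hHp hd4 hodd Dt Hd w₀ PL hPL hc hinf s k D
    t.valuation
    (fun ι' κ γ' ΩK Ωp Λf hκ hγ' hΩK hBDP X hXv =>
      katoBdpCrossingNonsplit_of_family W p hX h5 hS hns hr L hLq hH hHp hd4 hodd hLt Dt Hd w₀ PL hPL hc s k hs hk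
        W' D hDf hmin K hK γ I z₀ hγ hz ι' κ γ' ΩK Ωp Λf hκ hγ' hΩK hBDP X hXv t hlog ht0)

/-- **A-split at the FAMILY exponent** (rev 3.8; sorry-free from the sign-free A♯ `bdpFrameValue` + A♭-fam-split + Pasten–Shimura,
through the sign-free glue `bstwCrossing_of_normIdentity`): the statement of `bstwCrossingNonsplitFamily` at a SPLIT multiplicative `p`.
[cite: Castella2018, Thm. 3.2 (arXiv:1704.06608 p. 9)] [cite: Castella2018Exceptional, Thms. 2.10–2.11 (arXiv:1507.04260 pp. 13–14)] -/
theorem bstwCrossingSplitFamily (h32 : thm32_exists_isBDPLFunction_valueAtOne)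
    (hVC : castella2018Exceptional_bdpValueContinuity_trivialChar) :
    ∀ (W : WeierstrassCurve ℚ) [W.IsElliptic] [W.IsGloballyMinimal] (p : ℕ) [Fact p.Prime]
      [ContinuousSMul ℤ_[p] (W.tateModule p)] [Module.Free ℤ_[p] (W.tateModule p)]
      [Module.Finite ℤ_[p] (W.tateModule p)] [NeZero (W.conductorNorm ℤ)],
      ClassX11b W p → 5 ≤ p → Surj W p → W.HasSplitMultiplicativeReductionAtPrime p →
      ∀ (L : Type) [Field L] [NumberField L], IsImaginaryQuadratic L →
        SatisfiesHeegnerHypothesis (W.conductorNorm ℤ) L → SatisfiesHeegnerHypothesis p L →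
        NumberField.discr L < -4 → Odd (NumberField.discr L) →
        (W.quadraticTwist (NumberField.discr L : ℚ)).entireLFunction 1 ≠ 0 →
      ∀ (Dt : ModularParametrizationData W (W.conductorNorm ℤ))
        (Hd : HeegnerDatum (W.conductorNorm ℤ) (NumberField.discr L)) (w₀ : NumberField.InfinitePlace L)
        (PL : (W.baseChange L).toAffine.Point),
        WeierstrassCurve.Affine.Point.map w₀.embedding.toRatAlgHom PL = heegnerPointComplex Dt Hd →
        ¬ (p : ℤ) ∣ Dt.c → ¬ IsOfFinAddOrder PL →
      ∀ (s : ℚ) (k : ℤ),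
        (Real.sqrt ((NumberField.discr L).natAbs : ℝ) : ℂ) *
            (W.quadraticTwist (NumberField.discr L : ℚ)).entireLFunction 1 = (s : ℂ) * (minusPeriod Dt.f : ℂ) →
        (Dt.c : ℝ) * minusPeriod Dt.f = k * W.imaginaryPeriodRat →
      ∀ (W' : WeierstrassCurve ℚ) [W'.IsElliptic] (D : ModularParametrizationData W' (W.conductorNorm ℤ)),
        D.f = Dt.f →
        (∀ (W'' : WeierstrassCurve ℚ) [W''.IsElliptic] (D'' : ModularParametrizationData W'' (W.conductorNorm ℤ)),
            D''.f = D.f → D.modularDegree ≤ D''.modularDegree) →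
      ∀ (K : ZpExtension ℚ p) (hK : K.IsCyclotomic) (γ : absoluteGaloisGroup ℚ)
        (I : IwasawaH1Data W p K γ), K.IsTopGenerator γ →
      ∀ (hp : p ≠ 2) (N : ℕ) [NeZero N] (f : CuspForm (Gamma0 N) 2), IsNewformOf W f →
      ∀ (ι : (n : ℕ) → (CyclotomicField n ℚ →+* ℂ)) (q : ℚ)
        (Λ : ∀ (m : ℕ) (r : Finset (HeightOneSpectrum (𝓞 ℚ))),
          H1 (tateRep W p) (cycSubgroup p m r) →ₗ[ℤ_[p]] ℚ_[p] ⊗[ℚ] CyclotomicField (cycLevel p m r) ℚ)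
        (c d₁ a : ℤ) (A : ℕ) (d' : ℤ)
        (z : ∀ (m : ℕ) (r : (cyclotomicLevelsRat p (badPlaces c d₁ A N)).Ideals),
          H1 (tateRep W p) ((cyclotomicLevelsRat p (badPlaces c d₁ A N)).level m r.1))
        (x : ∀ (m : ℕ) (r : (cyclotomicLevelsRat p (badPlaces c d₁ A N)).Ideals),
          CyclotomicField (cycLevel p m r.1) ℚ)
        (y : I.H) (perRatio : ℚ),
        q ≠ 0 → ZetaBody W p f ι ((q : ℚ) : ℝ) Λ c d₁ a A z x →
        (∀ n : ℕ, I.proj n y =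
          levelToLayer W p hK hp (badPlaces c d₁ A N) n
            (z (n + 1) (cyclotomicLevelsRat p (badPlaces c d₁ A N)).idealOne)) →
        0 < A → Int.gcd c (6 * p * A) = 1 → Int.gcd d₁ (6 * p * N) = 1 → (d₁ : ℤ) * d' ≡ 1 [ZMOD (A : ℤ)] →
        ratCuspFactor f true c d₁ a A d' ≠ 0 → perRatio ≠ 0 →
        plusPeriod f = ((perRatio : ℚ) : ℝ) * W.realPeriodRat →
      ∀ σ : ℚ_[p], HasLocPKummerLog W p (bottomClass W p K I y) σ → σ ≠ 0 →
      ∃ e : L →+* ℚ_[p], congruenceNumber Dt.f ≠ 0 ∧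
        σ.valuation + padicValRat p (perRatio /
              (q * ratCuspFactor f true c d₁ a A d' * ∏ ℓ ∈ A.primeFactors.erase p, eulerFactorAtOne W N ℓ)) +
            1 + padicValInt p Dt.c + padicValRat p s + padicValInt p k +
            ((padicValNat p (congruenceNumber Dt.f) : ℤ) - padicValNat p D.modularDegree) =
          2 * (padicLogOmega W p e PL).valuation := by
  intro W _ _ p _ _ _ _ _ hX h5 hS hsp L _ _ hLq hH hHp hd4 hodd hLt Dt Hd w₀ PL hPL hc hinf s k hs hk W' _ D hDf hmin
    K hK γ I hγ hp N _ f hf ι q Λ c d₁ a A d' z x y perRatio hq hzeta hy hA hcg hd hdd' hR hper0 hper σ hσ hσ0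
  exact bstwCrossing_of_normIdentity h32 hVC hX h5 hS hLq hH hHp hd4 hodd Dt Hd w₀ PL hPL hc hinf s k D
    (σ.valuation + padicValRat p (perRatio /
      (q * ratCuspFactor f true c d₁ a A d' * ∏ ℓ ∈ A.primeFactors.erase p, eulerFactorAtOne W N ℓ)))
    (fun ι' κ γ' ΩK Ωp Λf hκ hγ' hΩK hBDP X hXv =>
      stub_katoBdpCrossingSplitFamily W p hX h5 hS hsp L hLq hH hHp hd4 hodd hLt Dt Hd w₀ PL hPL hc s k hs hk
        W' D hDf hmin K hK γ I hγ hp N f hf ι q Λ c d₁ a A d' z x y perRatio hq hzeta hy hA hcg hd hdd' hR hper0 hper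
        ι' κ γ' ΩK Ωp Λf hκ hγ' hΩK hBDP X hXv σ hσ hσ0)

/-- **A-split in the ADMISSIBLE-CLASS currency** (rev 3.8; sorry-free from `bdpFrameValue` + `katoBdpCrossingSplit_of_family`,
hence modulo A♭-fam-split): the statement of `bstwCrossingNonsplit` at a SPLIT multiplicative `p`. -/
theorem bstwCrossingSplit (h32 : thm32_exists_isBDPLFunction_valueAtOne)
    (hVC : castella2018Exceptional_bdpValueContinuity_trivialChar) :
    ∀ (W : WeierstrassCurve ℚ) [W.IsElliptic] [W.IsGloballyMinimal] (p : ℕ) [Fact p.Prime]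
      [ContinuousSMul ℤ_[p] (W.tateModule p)] [NeZero (W.conductorNorm ℤ)],
      ClassX11b W p → 5 ≤ p → Surj W p → W.HasSplitMultiplicativeReductionAtPrime p → W.mordellWeilRank ≠ 0 →
      ∀ (L : Type) [Field L] [NumberField L], IsImaginaryQuadratic L →
        SatisfiesHeegnerHypothesis (W.conductorNorm ℤ) L → SatisfiesHeegnerHypothesis p L →
        NumberField.discr L < -4 → Odd (NumberField.discr L) →
        (W.quadraticTwist (NumberField.discr L : ℚ)).entireLFunction 1 ≠ 0 →
      ∀ (Dt : ModularParametrizationData W (W.conductorNorm ℤ))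
        (Hd : HeegnerDatum (W.conductorNorm ℤ) (NumberField.discr L)) (w₀ : NumberField.InfinitePlace L)
        (PL : (W.baseChange L).toAffine.Point),
        WeierstrassCurve.Affine.Point.map w₀.embedding.toRatAlgHom PL = heegnerPointComplex Dt Hd →
        ¬ (p : ℤ) ∣ Dt.c → ¬ IsOfFinAddOrder PL →
      ∀ (s : ℚ) (k : ℤ),
        (Real.sqrt ((NumberField.discr L).natAbs : ℝ) : ℂ) *
            (W.quadraticTwist (NumberField.discr L : ℚ)).entireLFunction 1 = (s : ℂ) * (minusPeriod Dt.f : ℂ) →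
        (Dt.c : ℝ) * minusPeriod Dt.f = k * W.imaginaryPeriodRat →
      ∀ (W' : WeierstrassCurve ℚ) [W'.IsElliptic] (D : ModularParametrizationData W' (W.conductorNorm ℤ)),
        D.f = Dt.f →
        (∀ (W'' : WeierstrassCurve ℚ) [W''.IsElliptic] (D'' : ModularParametrizationData W'' (W.conductorNorm ℤ)),
            D''.f = D.f → D.modularDegree ≤ D''.modularDegree) →
      ∀ (K : ZpExtension ℚ p) (hK : K.IsCyclotomic) (γ : absoluteGaloisGroup ℚ)
        (I : IwasawaH1Data W p K γ) (z₀ : I.H), K.IsTopGenerator γ → IsAdmissibleZetaClass W p K hK I z₀ →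
      ∀ t : ℚ_[p], HasLocPKummerLog W p (bottomClass W p K I z₀) t → t ≠ 0 →
      ∃ e : L →+* ℚ_[p], congruenceNumber Dt.f ≠ 0 ∧
        t.valuation + 1 + padicValInt p Dt.c + padicValRat p s + padicValInt p k +
            ((padicValNat p (congruenceNumber Dt.f) : ℤ) - padicValNat p D.modularDegree) =
          2 * (padicLogOmega W p e PL).valuation := by
  intro W _ _ p _ _ _ hX h5 hS hsp hr L _ _ hLq hH hHp hd4 hodd hLt Dt Hd w₀ PL hPL hc hinf s k hs hk W' _ D hDf hmin
    K hK γ I z₀ hγ hz t hlog ht0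
  exact bstwCrossing_of_normIdentity h32 hVC hX h5 hS hLq hH hHp hd4 hodd Dt Hd w₀ PL hPL hc hinf s k D
    t.valuation
    (fun ι' κ γ' ΩK Ωp Λf hκ hγ' hΩK hBDP X hXv =>
      katoBdpCrossingSplit_of_family W p hX h5 hS hsp hr L hLq hH hHp hd4 hodd hLt Dt Hd w₀ PL hPL hc s k hs hk
        W' D hDf hmin K hK γ I z₀ hγ hz ι' κ γ' ΩK Ωp Λf hκ hγ' hΩK hBDP X hXv t hlog ht0)

/-! ## §2 Sorry-free helpers -/

/-- **Rev 3.4's A♭ is implied by rev 3.3's, pointwise** (kernel-checked certificate that the research stub got SMALLER, not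
different): from `∃ t₀, HasLocPKummerLog x t₀ ∧ t₀ ≠ 0 ∧ F t₀` (rev 3.3's conclusion shape) follows
`∀ t, HasLocPKummerLog x t → t ≠ 0 → F t` (rev 3.4's), by the UNIQUENESS of the Kummer logarithm
(`Additive.ContraCount.HasLocPKummerLog.unique`, Bloch–Kato Ex. 3.11).  The converse needs the two print atoms `∃ t`
(`ErratumRoadFiveKatoFframeValueAtoms.exists_hasLocPKummerLog_bottomClass`) and `t ≠ 0` (BDV 2022 Thm. A).
[cite: BlochKato1990, Def. 3.10 and Ex. 3.11] -/
theorem forall_kummerLog_of_exists {W : WeierstrassCurve ℚ} [W.IsElliptic] [W.IsGloballyMinimal] {p : ℕ} [Fact p.Prime]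
    [ContinuousSMul ℤ_[p] (W.tateModule p)] {x : H1 (tateRep W p) ⊤} {F : ℚ_[p] → Prop}
    (h : ∃ t₀ : ℚ_[p], HasLocPKummerLog W p x t₀ ∧ t₀ ≠ 0 ∧ F t₀) :
    ∀ t : ℚ_[p], HasLocPKummerLog W p x t → t ≠ 0 → F t := by
  intro t ht _
  obtain ⟨t₀, h₀, -, hF⟩ := h
  exact (Additive.ContraCount.HasLocPKummerLog.unique W p ht h₀) ▸ hF

/-- `m ∣ r`, `r ≠ 0` ⇒ `ord_p m ≤ ord_p r` (elementary). [folklore] -/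
theorem padicValNat_le_of_dvd {p m r : ℕ} [Fact p.Prime] (hmr : m ∣ r) (hr : r ≠ 0) :
    padicValNat p m ≤ padicValNat p r :=
  (padicValNat_dvd_iff_le hr).mp (dvd_trans pow_padicValNat_dvd hmr)

/-- A modular parametrisation datum of MINIMAL degree among those with a given newform exists (well-ordering of
`ℕ`, witnessed by `Dt` itself). [folklore] -/
theorem exists_minimal_datum {W : WeierstrassCurve ℚ} [W.IsElliptic] {N : ℕ} [NeZero N]
    (Dt : ModularParametrizationData W N) :
    ∃ (W' : WeierstrassCurve ℚ) (_ : W'.IsElliptic) (D : ModularParametrizationData W' N), D.f = Dt.f ∧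
      ∀ (W'' : WeierstrassCurve ℚ) [W''.IsElliptic] (D'' : ModularParametrizationData W'' N),
        D''.f = D.f → D.modularDegree ≤ D''.modularDegree := by
  classical
  let S : Set ℕ := {m | ∃ (W' : WeierstrassCurve ℚ) (_ : W'.IsElliptic) (D : ModularParametrizationData W' N),
    D.f = Dt.f ∧ D.modularDegree = m}
  have hS : ∃ m, m ∈ S := ⟨Dt.modularDegree, W, ‹_›, Dt, rfl, rfl⟩
  obtain ⟨W', hW', D, hDf, hDm⟩ := Nat.find_spec hS
  refine ⟨W', hW', D, hDf, fun W'' _ D'' hD'' => ?_⟩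
  rw [hDm]
  exact Nat.find_min' hS ⟨W'', ‹_›, D'', hD''.trans hDf, rfl⟩

/-! ## §3 The compositions (no sorry below): the CORE at an abstract exponent; the FAMILY core and the LEAD's `hFamNonsplit`
VERBATIM; the admissible core and r5.6's `stub_valuationIneqNonsplit` VERBATIM (twice); r5.5's S3ns VERBATIM modulo the print binder `hNZ` -/

/-- A member of a Mordell–Weil basis has infinite order (any field: its class in `E(K)/E(K)_{tors}` belongs to a
`ℤ`-linearly independent family, hence is non-zero).  Stated for the group law of `IsMordellWeilBasis` (classical
decidable equality on `K`). [folklore] -/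
theorem not_isOfFinAddOrder_of_isMordellWeilBasis {K : Type*} [Field K] {W : WeierstrassCurve K} {ι : Type*}
    {P : ι → W.toAffine.Point} (hP : W.IsMordellWeilBasis P) (i : ι) : ¬ IsOfFinAddOrder (P i) := by
  intro htor
  apply hP.1.ne_zero i
  simp only [Function.comp_apply]
  exact (QuotientAddGroup.eq_zero_iff _).mpr htor

/-- The same over `ℚ` for the group law elaborated with `instDecidableEqRat` (the two `DecidableEq ℚ` instances agree —
`Subsingleton.elim`, transported by `convert`; pattern of the tree's `IsMordellWeilBasis.not_isOfFinAddOrder_rat`). [folklore] -/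
theorem not_isOfFinAddOrder_of_isMordellWeilBasis_rat {W : WeierstrassCurve ℚ} {ι : Type*}
    {P : ι → W.toAffine.Point} (hP : W.IsMordellWeilBasis P) (i : ι) : ¬ IsOfFinAddOrder (P i) := by
  convert not_isOfFinAddOrder_of_isMordellWeilBasis hP i

/-- **Core at an ABSTRACT exponent `v`: B's rational `q = #Ш_an` and the valuation inequality `v − 2 ord_p log_ω x̂ ≤ ord_p q + ord_p Tam −
2 ord_p #tors − 1`, from S0′ ∧ B ∧ a CROSSING `hcross` of A's shape at `v`** (rev 3.7's common proof of the family core and the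
admissible core below; sorry-free modulo S0′; `ρ̄` onto and `p` non-split enter only through `hcross`).  The proof picks `L` by Hoffstein–Luo (split at `p`, at `2` and at every `ℓ ∣ N`, odd
`d_L`, `|d_L| > 4`), a datum with `p ∤ c` (Mazur + Néron scaling), the `L`-rational Heegner point through the place embedding (Darmon
Thm. 3.6), a minimal datum by well-ordering, gets `P_L` of INFINITE ORDER from B through the embedding `X11b.embAt` of a degree-one
prime above the split `p` and `log_ω x̂ ≠ 0`, takes the embedding `e` of the crossing for B, and closes the inequality by
`ord_p`-arithmetic + Ribet (a) (`ord_p m_f ≤ ord_p r_f`; with ARS Thm. 2.1 (b) = `padicValNat_congruenceNumber_eq_of_not_sq_dvd` the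
Γ₀-term would vanish — not needed for `≤`); the degenerate case `log_ω(x̂) = 0` is harmless.
[cite: GrossZagier1986, Thm. I.(7.3)] [cite: AgasheRibetStein2012, Thm. 2.1] [cite: BurungaleSkinnerTianWan2024, §6.2.1 (arXiv:2409.01350 pp. 59–60)] -/
theorem valuationIneq_core_of_crossing
    {W : WeierstrassCurve ℚ} [W.IsElliptic] [W.IsGloballyMinimal] {p : ℕ} [Fact p.Prime] [NeZero (W.conductorNorm ℤ)]
    (hX : ClassX11b W p) (h5 : 5 ≤ p)
    (h1 : W.mordellWeilRank = 1) (P : Fin W.mordellWeilRank → W.toAffine.Point) (hP : W.IsMordellWeilBasis P) (v : ℤ)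
    (hcross : ∀ (L : Type) [Field L] [NumberField L], IsImaginaryQuadratic L →
        SatisfiesHeegnerHypothesis (W.conductorNorm ℤ) L → SatisfiesHeegnerHypothesis p L →
        NumberField.discr L < -4 → Odd (NumberField.discr L) →
        (W.quadraticTwist (NumberField.discr L : ℚ)).entireLFunction 1 ≠ 0 →
      ∀ (Dt : ModularParametrizationData W (W.conductorNorm ℤ))
        (Hd : HeegnerDatum (W.conductorNorm ℤ) (NumberField.discr L)) (w₀ : NumberField.InfinitePlace L)
        (PL : (W.baseChange L).toAffine.Point),
        WeierstrassCurve.Affine.Point.map w₀.embedding.toRatAlgHom PL = heegnerPointComplex Dt Hd →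
        ¬ (p : ℤ) ∣ Dt.c → ¬ IsOfFinAddOrder PL →
      ∀ (s : ℚ) (k : ℤ),
        (Real.sqrt ((NumberField.discr L).natAbs : ℝ) : ℂ) *
            (W.quadraticTwist (NumberField.discr L : ℚ)).entireLFunction 1 = (s : ℂ) * (minusPeriod Dt.f : ℂ) →
        (Dt.c : ℝ) * minusPeriod Dt.f = k * W.imaginaryPeriodRat →
      ∀ (W' : WeierstrassCurve ℚ) [W'.IsElliptic] (D : ModularParametrizationData W' (W.conductorNorm ℤ)),
        D.f = Dt.f →
        (∀ (W'' : WeierstrassCurve ℚ) [W''.IsElliptic] (D'' : ModularParametrizationData W'' (W.conductorNorm ℤ)),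
            D''.f = D.f → D.modularDegree ≤ D''.modularDegree) →
      ∃ e : L →+* ℚ_[p], congruenceNumber Dt.f ≠ 0 ∧
        v + 1 + padicValInt p Dt.c + padicValRat p s + padicValInt p k +
            ((padicValNat p (congruenceNumber Dt.f) : ℤ) - padicValNat p D.modularDegree) =
          2 * (padicLogOmega W p e PL).valuation) :
    ∃ q : ℚ, shaAn W = (q : ℂ) ∧
      v - 2 * (logOmega W p (P (Fin.cast h1.symm 0))).valuation ≤
        padicValRat p q + padicValNat p W.tamagawaProduct - 2 * padicValNat p W.torsionOrder - 1 := by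
  obtain ⟨hmodP, hHL, hGZ, hRibet, hMaz, -, -, -, -⟩ := stub_printedFactsHeldNonsplit
  have hp : p.Prime := Fact.out
  have hp2 : p ≠ 2 := by omega
  have hmod : exists_isNewformOf := exists_isNewformOf_of_nonempty_modularParametrizationData hmodP
  have hE : WeierstrassCurve.hasEntireLFunction_rat :=
    WeierstrassCurve.hasEntireLFunction_rat_of_exists_isNewformOf hmod
  -- (1) analytic rank one (class X11b) and `w(E) = -1`
  have hr : W.analyticRank = 1 := hX.1
  have hw : W.rootNumber = -1 := by
    rcases W.rootNumber_eq_one_or with hw | hw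
    · exact absurd ((WeierstrassCurve.even_analyticRank_iff_of_exists_isNewformOf hmod W).mpr hw)
        (by rw [hr]; exact Nat.not_even_one)
    · exact hw
  -- (2) a Heegner field split at `p`, `|d_L| > 4`, odd `d_L`, `L(E^{(d_L)}, 1) ≠ 0` (Hoffstein–Luo)
  obtain ⟨L, _, _, hLq, hB4, hH, hHp, -, hodd, hLt⟩ :=
    exists_heegnerField_split_two_split_oddDiscr_twist_ne_zero_of_hoffsteinLuo hmod hHL W hw hp 4
  set d : ℤ := NumberField.discr L with hd
  have hdneg : d < 0 := IsImaginaryQuadratic.discr_neg hLq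
  have hd4 : d < -4 := by omega
  have hd4sq : d % 4 = 1 ∧ Squarefree d := by
    rcases Literature.NumberTheory.QuadraticFields.Quadratic.isFundamentalDiscriminant_discr hLq.1 with
      ⟨h4, hsq, -⟩ | ⟨h4, -, -⟩
    · exact ⟨h4, hsq⟩
    · exfalso
      exact (Int.not_even_iff_odd.mpr hodd) (even_iff_two_dvd.mpr (dvd_trans ⟨2, by norm_num⟩ h4))
  have hkr := (satisfiesHeegnerHypothesis_iff_kronecker (W.conductorNorm ℤ) L hLq.1).mp hH
  have hgcd : Int.gcd d (W.conductorNorm ℤ) = 1 :=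
    int_gcd_eq_one_of_forall_jacobiSym_eq_one (by omega) fun p hp hpN hp2 ↦ (hkr p hp hpN).2 hp2
  -- (3) a datum `Dt` of `W` with MANIN CONSTANT PRIME TO `p` (Mazur 1978 Cor. 4.1 for the optimal curve + the
  --     integral Néron scaling along the isogeny, `X11b.exists_modularParametrizationData_not_dvd`), a Heegner datum
  --     `Hd` of discriminant `d_L`, and the `L`-rational Heegner point READ THROUGH THE PLACE EMBEDDING `w₀.embedding`
  --     (Darmon Thm. 3.6, tree theorem `heegnerPointComplex_mem_range_map_holds`); Gross–Zagier over `L`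
  have hpN2 : ¬ p ^ 2 ∣ W.conductorNorm ℤ := X11b.not_sq_dvd_conductorNorm_of_mult W p hX.2.2.1
  obtain ⟨Dt, hc⟩ := X11b.exists_modularParametrizationData_not_dvd hmod hMaz
    integral_neronScaling_of_isGloballyMinimal_holds W rfl hp hp2 hpN2 hX.2.2.2
  obtain ⟨β, hβ⟩ := exists_dvd_sq_sub_discr_holds (W.conductorNorm ℤ) L hLq hH
  obtain ⟨Hd, -⟩ := nonempty_heegnerDatum_holds (W.conductorNorm ℤ) L hLq hβ
  obtain ⟨w₀⟩ := (inferInstance : Nonempty (NumberField.InfinitePlace L))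
  obtain ⟨PL, hPL⟩ := heegnerPointComplex_mem_range_map_holds (W.conductorNorm ℤ) W L hLq hH Dt Hd w₀.embedding
  have eGZ : GrossZagierFormula (W.conductorNorm ℤ) W L := hGZ _ W L hLq hH
  -- (4) Birch's `s` and the period integer `k`
  obtain ⟨s, hs⟩ := exists_rat_sqrt_mul_entireLFunction_quadraticTwist_one_eq hE W Dt.isNewformOf
    hdneg hd4sq.2 hd4sq.1 hgcd
  obtain ⟨k, hk0, hk⟩ := Dt.exists_int_maninConstant_mul_minusPeriod_eq
  -- (5) a datum of minimal degree with the same newform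
  obtain ⟨W', hW', D, hDf, hmin⟩ := exists_minimal_datum Dt
  -- (5b) `P_L` has INFINITE ORDER (rev 3.5): `x̂` has infinite order (a Mordell–Weil basis), so `log_ω x̂ ≠ 0`
  --      (`log_ω` kills only torsion on `E(ℚ_p)`, and `E(ℚ) → E(ℚ_p)` is injective); B through the embedding `embAt` of a
  --      degree-one prime above the split `p` reads `2 log P_L = n log x̂` with `n ≠ 0`, so `log P_L ≠ 0`
  have hxinf : ¬ IsOfFinAddOrder (P (Fin.cast h1.symm 0)) := not_isOfFinAddOrder_of_isMordellWeilBasis_rat hP _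
  have hlogx : logOmega W p (P (Fin.cast h1.symm 0)) ≠ 0 := fun h0 ↦ hxinf
    (((WeierstrassCurve.Affine.Point.map_injective (W' := W.toAffine) (f := Algebra.ofId ℚ ℚ_[p])).isOfFinAddOrder_iff).mp
      (Summit.BirchSwinnertonDyer.BirchSwinnertonDyer.Theorems.CongruentShaFreeCutKatoKummerLogTorsion.isOfFinAddOrder_of_padicLogLocal_eq_zero
        W p h0))
  obtain ⟨𝔮, h𝔮, he1, hf1⟩ := X11b.exists_degreeOnePrime_of_splitsIn L p hLq.1 (hHp p hp dvd_rfl)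
  have hinfPL : ¬ IsOfFinAddOrder PL := by
    intro htor
    obtain ⟨n₀, hn₀, -, hlg₀⟩ := grossZagierDescentExact W p hmod hr hw h1 P hP L hLq hH hd4 hodd hLt
      Dt Hd w₀.embedding PL hPL eGZ s k hs hk (X11b.embAt L p _ h𝔮 he1 hf1)
    have h0 : padicLogOmega W p (X11b.embAt L p _ h𝔮 he1 hf1) PL = 0 := by
      rw [← X11b.R1.logOmega_eq_padicLogOmega]
      exact (X11b.R1.logOmega_eq_zero_iff W p _ PL).mpr htor
    rw [h0, mul_zero] at hlg₀
    exact (mul_ne_zero (Int.cast_ne_zero.mpr hn₀) hlogx) hlg₀.symm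
  -- (6) the crossing `hcross` at the exponent `v`, through its embedding `ιp : L → ℚ_p`, and B there
  obtain ⟨ιp, hrf, hA⟩ := hcross L hLq hH hHp hd4 hodd hLt Dt Hd w₀ PL hPL hc hinfPL s k hs hk W' D hDf hmin
  obtain ⟨n, hn0, hq, hlg⟩ := grossZagierDescentExact W p hmod hr hw h1 P hP L hLq hH hd4 hodd hLt
    Dt Hd w₀.embedding PL hPL eGZ s k hs hk ιp
  refine ⟨_, hq, ?_⟩
  -- (7) Ribet: `ord_p m_f ≤ ord_p r_f`
  have hdvd : D.modularDegree ∣ congruenceNumber D.f := hRibet W' (W.conductorNorm ℤ) D hmin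
  rw [hDf] at hdvd
  have he : (padicValNat p D.modularDegree : ℤ) ≤ padicValNat p (congruenceNumber Dt.f) := by
    exact_mod_cast padicValNat_le_of_dvd hdvd hrf
  -- (8) `2 log ι P_L = n log x̂` ⇒ `ord_p log ι P_L ≤ ord_p n + ord_p log x̂`
  set x := P (Fin.cast h1.symm 0) with hx
  have hV : (padicLogOmega W p ιp PL).valuation ≤ padicValInt p n + (logOmega W p x).valuation := by
    by_cases h0 : logOmega W p x = 0
    · have hz' : padicLogOmega W p ιp PL = 0 := by
        rw [h0, mul_zero] at hlg
        exact (mul_eq_zero.mp hlg).resolve_left two_ne_zero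
      rw [hz', h0, Padic.valuation_zero, add_zero]
      positivity
    · have hn' : (n : ℚ_[p]) ≠ 0 := Int.cast_ne_zero.mpr hn0
      have hne : padicLogOmega W p ιp PL ≠ 0 := by
        intro h
        rw [h, mul_zero] at hlg
        exact (mul_ne_zero hn' h0) hlg.symm
      have h2 : ((2 : ℚ_[p])).valuation = 0 := by
        haveI : Fact (Nat.Prime 2) := ⟨Nat.prime_two⟩
        rw [Padic.valuation_ofNat, padicValNat_primes hp2, Nat.cast_zero]
      have hcong := congrArg Padic.valuation hlg
      rw [Padic.valuation_mul two_ne_zero hne, h2, zero_add, Padic.valuation_mul hn' h0,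
        Padic.valuation_intCast] at hcong
      exact hcong.le
  -- (9) `ord_p` of `q = n² #tors² / (2 c s k Tam)`
  have hcQ : (Dt.c : ℚ) ≠ 0 := Int.cast_ne_zero.mpr Dt.maninConstant_ne_zero_holds
  have hkQ : (k : ℚ) ≠ 0 := Int.cast_ne_zero.mpr hk0
  have hnQ : (n : ℚ) ≠ 0 := Int.cast_ne_zero.mpr hn0
  have htors : (W.torsionOrder : ℚ) ≠ 0 := by exact_mod_cast W.torsionOrder_pos_holds.ne'
  have hTam : (W.tamagawaProduct : ℚ) ≠ 0 := by exact_mod_cast W.tamagawaProduct_pos_holds.ne'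
  have hs0 : s ≠ 0 := by
    rintro rfl
    rw [Rat.cast_zero, zero_mul, mul_eq_zero] at hs
    rcases hs with h | h
    · have hsD : 0 < Real.sqrt (d.natAbs : ℝ) :=
        Real.sqrt_pos.mpr (by exact_mod_cast Int.natAbs_pos.mpr hdneg.ne)
      exact hsD.ne' (by exact_mod_cast h)
    · exact hLt h
  have h2Q : padicValRat p (2 : ℚ) = 0 := by
    haveI : Fact (Nat.Prime 2) := ⟨Nat.prime_two⟩
    rw [show (2 : ℚ) = ((2 : ℕ) : ℚ) by norm_num, padicValRat.of_nat, padicValNat_primes hp2, Nat.cast_zero]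
  have hvq : padicValRat p ((n : ℚ) ^ 2 * (W.torsionOrder : ℚ) ^ 2 /
      (2 * (Dt.c : ℚ) * s * (k : ℚ) * (W.tamagawaProduct : ℚ))) =
      2 * padicValInt p n + 2 * padicValNat p W.torsionOrder -
        (padicValInt p Dt.c + padicValRat p s + padicValInt p k + padicValNat p W.tamagawaProduct) := by
    rw [padicValRat.div (mul_ne_zero (pow_ne_zero 2 hnQ) (pow_ne_zero 2 htors))
        (mul_ne_zero (mul_ne_zero (mul_ne_zero (mul_ne_zero two_ne_zero hcQ) hs0) hkQ) hTam),
      padicValRat.mul (pow_ne_zero 2 hnQ) (pow_ne_zero 2 htors), padicValRat.pow, padicValRat.pow,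
      padicValRat.mul (mul_ne_zero (mul_ne_zero (mul_ne_zero two_ne_zero hcQ) hs0) hkQ) hTam,
      padicValRat.mul (mul_ne_zero (mul_ne_zero two_ne_zero hcQ) hs0) hkQ,
      padicValRat.mul (mul_ne_zero two_ne_zero hcQ) hs0, padicValRat.mul two_ne_zero hcQ, h2Q]
    simp only [padicValRat.of_int, padicValRat.of_nat]
    push_cast
    ring
  rw [hvq]
  linarith [hA, hV, he]

/-- **Family core (rev 3.7): for a value-pinned Kato family with Λ-adic lift `y` and a GIVEN Kummer logarithm `σ ≠ 0` of `proj₀ y` —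
B's rational `qSha = #Ш_an` and the FAMILY-LEVEL valuation inequality** `v(σ) + v_p(λ/(q·R⁻_𝟙·∏P_ℓ)) − 2 ord_p log_ω x̂ ≤ ord_p #Ш_an +
ord_p Tam − 2 ord_p #tors − 1`, from S0′ ∧ A♯-print ∧ A♭-fam ∧ B: `valuationIneq_core_of_crossing` fed with
`bstwCrossingNonsplitFamily`.  No registered stub, no crux and no summit statement is proved here: A♭-fam is a `sorry`.
[cite: Kato2004Asterisque, Thm. 12.5 (1) (pp. 221–222), Ex. 13.3 (p. 225)] [cite: GrossZagier1986, Thm. I.(7.3)] -/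
theorem valuationIneqNonsplitFamily_core :
    ∀ (W : WeierstrassCurve ℚ) [W.IsElliptic] [W.IsGloballyMinimal] (p : ℕ) [Fact p.Prime]
      [ContinuousSMul ℤ_[p] (W.tateModule p)] [Module.Free ℤ_[p] (W.tateModule p)] [Module.Finite ℤ_[p] (W.tateModule p)],
      ClassX11b W p → 5 ≤ p → Surj W p → ¬ W.HasSplitMultiplicativeReductionAtPrime p →
      ∀ (h1 : W.mordellWeilRank = 1) (P : Fin W.mordellWeilRank → W.toAffine.Point),
        W.IsMordellWeilBasis P →
      ∀ (K : ZpExtension ℚ p) (hK : K.IsCyclotomic) (γ : absoluteGaloisGroup ℚ)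
        (I : IwasawaH1Data W p K γ), K.IsTopGenerator γ →
      ∀ (hp : p ≠ 2) (N : ℕ) [NeZero N] (f : CuspForm (Gamma0 N) 2), IsNewformOf W f →
      ∀ (ι : (n : ℕ) → (CyclotomicField n ℚ →+* ℂ)) (q : ℚ)
        (Λ : ∀ (m : ℕ) (r : Finset (HeightOneSpectrum (𝓞 ℚ))),
          H1 (tateRep W p) (cycSubgroup p m r) →ₗ[ℤ_[p]] ℚ_[p] ⊗[ℚ] CyclotomicField (cycLevel p m r) ℚ)
        (c d₁ a : ℤ) (A : ℕ) (d' : ℤ)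
        (z : ∀ (m : ℕ) (r : (cyclotomicLevelsRat p (badPlaces c d₁ A N)).Ideals),
          H1 (tateRep W p) ((cyclotomicLevelsRat p (badPlaces c d₁ A N)).level m r.1))
        (x : ∀ (m : ℕ) (r : (cyclotomicLevelsRat p (badPlaces c d₁ A N)).Ideals),
          CyclotomicField (cycLevel p m r.1) ℚ)
        (y : I.H) (perRatio : ℚ),
        q ≠ 0 → ZetaBody W p f ι ((q : ℚ) : ℝ) Λ c d₁ a A z x →
        (∀ n : ℕ, I.proj n y =
          levelToLayer W p hK hp (badPlaces c d₁ A N) n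
            (z (n + 1) (cyclotomicLevelsRat p (badPlaces c d₁ A N)).idealOne)) →
        0 < A → Int.gcd c (6 * p * A) = 1 → Int.gcd d₁ (6 * p * N) = 1 → (d₁ : ℤ) * d' ≡ 1 [ZMOD (A : ℤ)] →
        ratCuspFactor f true c d₁ a A d' ≠ 0 → perRatio ≠ 0 →
        plusPeriod f = ((perRatio : ℚ) : ℝ) * W.realPeriodRat →
      ∀ σ : ℚ_[p], HasLocPKummerLog W p (bottomClass W p K I y) σ → σ ≠ 0 →
      ∃ qSha : ℚ, shaAn W = (qSha : ℂ) ∧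
        σ.valuation +
              padicValRat p (perRatio /
                (q * ratCuspFactor f true c d₁ a A d' * ∏ ℓ ∈ A.primeFactors.erase p, eulerFactorAtOne W N ℓ)) -
            2 * (logOmega W p (P (Fin.cast h1.symm 0))).valuation ≤
          padicValRat p qSha + padicValNat p W.tamagawaProduct - 2 * padicValNat p W.torsionOrder - 1 := by
  intro W _ _ p _ _ _ _ hX h5 hS hns h1 P hP K hK γ I hγ hp N _ f hf ι q Λ c d₁ a A d' z x y perRatio
    hq hzeta hy hA hcg hd hdd' hR hper0 hper σ hσ hσ0
  obtain ⟨-, -, -, -, -, h32, hVC, -, -⟩ := stub_printedFactsHeldNonsplit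
  haveI hN : NeZero (W.conductorNorm ℤ) := ⟨(W.conductorNorm_pos_holds).ne'⟩
  exact valuationIneq_core_of_crossing hX h5 h1 P hP
    (σ.valuation + padicValRat p (perRatio /
      (q * ratCuspFactor f true c d₁ a A d' * ∏ ℓ ∈ A.primeFactors.erase p, eulerFactorAtOne W N ℓ)))
    (fun L _ _ hLq hH hHp hd4 hodd hLt Dt Hd w₀ PL hPL hc hinf sB k hsB hk W' _ D hDf hmin =>
      bstwCrossingNonsplitFamily h32 hVC W p hX h5 hS hns L hLq hH hHp hd4 hodd hLt Dt Hd w₀ PL hPL hc hinf sB k hsB hk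
        W' D hDf hmin K hK γ I hγ hp N f hf ι q Λ c d₁ a A d' z x y perRatio hq hzeta hy hA hcg hd hdd' hR hper0 hper σ hσ hσ0)

/-- **The LEAD's FAMILY-LEVEL binder `hFamNonsplit` of `ErratumRoadFiveKatoFframeValueAtomsOfFamily.valuationIneqNonsplit_of_family`
(p769350) VERBATIM, from the three stubs** (rev 3.7's primary dock: the research atom of S3ns read on the bottom class of the Λ-adic
lift of a value-pinned Kato family, Kato's constants `q`, `R⁻_𝟙`, `∏_{ℓ∣A,ℓ≠p} P_ℓ(ℓ⁻¹)`, `λ` explicit; ANY rational `qSha` with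
`#Ш_an = qSha`, pinned to B's by `Rat.cast_injective`; `bottomClass` / `logOmega` appear unfolded in the LEAD's text — the same terms
by `rfl`).  Hypothesis-free modulo S0′ ∧ A♯-print ∧ A♭-fam.  No registered stub, no crux and no summit statement is proved here:
A♭-fam is a `sorry`. [cite: Kato2004Asterisque, Thm. 12.5 (1) (pp. 221–222), Ex. 13.3 (p. 225), Lemma 13.10 (1) (p. 230)] -/
theorem famValuationIneqNonsplit_of_stubs :
    ∀ (W : WeierstrassCurve ℚ) [W.IsElliptic] [W.IsGloballyMinimal] (p : ℕ) [Fact p.Prime]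
      [ContinuousSMul ℤ_[p] (W.tateModule p)] [Module.Free ℤ_[p] (W.tateModule p)] [Module.Finite ℤ_[p] (W.tateModule p)],
      ClassX11b W p → 5 ≤ p → Surj W p → ¬ W.HasSplitMultiplicativeReductionAtPrime p →
      ∀ (h1 : W.mordellWeilRank = 1) (P : Fin W.mordellWeilRank → W.toAffine.Point),
        W.IsMordellWeilBasis P →
      ∀ (K : ZpExtension ℚ p) (hK : K.IsCyclotomic) (γ : absoluteGaloisGroup ℚ)
        (I : IwasawaH1Data W p K γ), K.IsTopGenerator γ →
      ∀ (hp : p ≠ 2) (N : ℕ) [NeZero N] (f : CuspForm (Gamma0 N) 2), IsNewformOf W f →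
      ∀ (ι : (n : ℕ) → (CyclotomicField n ℚ →+* ℂ)) (q : ℚ)
        (Λ : ∀ (k : ℕ) (r : Finset (HeightOneSpectrum (𝓞 ℚ))),
          H1 (tateRep W p) (cycSubgroup p k r) →ₗ[ℤ_[p]] ℚ_[p] ⊗[ℚ] CyclotomicField (cycLevel p k r) ℚ)
        (c d₁ a : ℤ) (A : ℕ) (d' : ℤ)
        (z : ∀ (k : ℕ) (r : (cyclotomicLevelsRat p (badPlaces c d₁ A N)).Ideals),
          H1 (tateRep W p) ((cyclotomicLevelsRat p (badPlaces c d₁ A N)).level k r.1))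
        (x : ∀ (k : ℕ) (r : (cyclotomicLevelsRat p (badPlaces c d₁ A N)).Ideals),
          CyclotomicField (cycLevel p k r.1) ℚ)
        (y : I.H) (perRatio : ℚ),
        q ≠ 0 → ZetaBody W p f ι ((q : ℚ) : ℝ) Λ c d₁ a A z x →
        (∀ n : ℕ, I.proj n y =
          levelToLayer W p hK hp (badPlaces c d₁ A N) n
            (z (n + 1) (cyclotomicLevelsRat p (badPlaces c d₁ A N)).idealOne)) →
        0 < A → Int.gcd c (6 * p * A) = 1 → Int.gcd d₁ (6 * p * N) = 1 → (d₁ : ℤ) * d' ≡ 1 [ZMOD (A : ℤ)] →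
        ratCuspFactor f true c d₁ a A d' ≠ 0 → perRatio ≠ 0 →
        plusPeriod f = ((perRatio : ℚ) : ℝ) * W.realPeriodRat →
      ∀ s : ℚ_[p], HasLocPKummerLog W p (layerZeroToTop W p K (I.proj 0 y)) s → s ≠ 0 →
      ∀ qSha : ℚ, shaAn W = (qSha : ℂ) →
        s.valuation +
              padicValRat p (perRatio /
                (q * ratCuspFactor f true c d₁ a A d' * ∏ ℓ ∈ A.primeFactors.erase p, eulerFactorAtOne W N ℓ)) -
            2 * (padicLogLocal W p (WeierstrassCurve.Affine.Point.map (Algebra.ofId ℚ ℚ_[p]) (P (Fin.cast h1.symm 0)))).valuation ≤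
          padicValRat p qSha + padicValNat p W.tamagawaProduct - 2 * padicValNat p W.torsionOrder - 1 := by
  intro W _ _ p _ _ _ _ hX h5 hS hns h1 P hP K hK γ I hγ hp N _ f hf ι q Λ c d₁ a A d' z x y perRatio
    hq hzeta hy hA hcg hd hdd' hR hper0 hper s hs hs0 qSha hqSha
  obtain ⟨q₀, hq₀, hineq⟩ := valuationIneqNonsplitFamily_core W p hX h5 hS hns h1 P hP K hK γ I hγ hp N f hf ι q Λ
    c d₁ a A d' z x y perRatio hq hzeta hy hA hcg hd hdd' hR hper0 hper s hs hs0
  obtain rfl : qSha = q₀ := Rat.cast_injective (hqSha.symm.trans hq₀)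
  exact hineq

/-- **Admissible core (revs 3.4–3.6's `valuationIneqNonsplit_core`, statement unchanged): for a GIVEN Kummer logarithm `t ≠ 0` of the
bottom layer of an ADMISSIBLE zeta class — B's rational `q = #Ш_an` and the valuation inequality**, from S0′ ∧ A♯-print ∧ A♭-fam ∧ B:
`valuationIneq_core_of_crossing` fed with `bstwCrossingNonsplit` (positive rank from `h1`; the admissible ↦ family passage is
inside `katoBdpCrossingNonsplit_of_family`).  No registered stub, no crux and no summit statement is proved here: A♭-fam is a `sorry`.
[cite: GrossZagier1986, Thm. I.(7.3)] [cite: Kato2004Asterisque, Thm. 12.5 (1) (pp. 221–222)] -/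
theorem valuationIneqNonsplit_core :
    ∀ (W : WeierstrassCurve ℚ) [W.IsElliptic] [W.IsGloballyMinimal] (p : ℕ) [Fact p.Prime]
      [ContinuousSMul ℤ_[p] (W.tateModule p)],
      ClassX11b W p → 5 ≤ p → Surj W p → ¬ W.HasSplitMultiplicativeReductionAtPrime p →
      ∀ (h1 : W.mordellWeilRank = 1) (P : Fin W.mordellWeilRank → W.toAffine.Point),
        W.IsMordellWeilBasis P →
      ∀ (K : ZpExtension ℚ p) (hK : K.IsCyclotomic) (γ : absoluteGaloisGroup ℚ)
        (I : IwasawaH1Data W p K γ) (z₀ : I.H), K.IsTopGenerator γ → IsAdmissibleZetaClass W p K hK I z₀ →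
      ∀ t : ℚ_[p], HasLocPKummerLog W p (bottomClass W p K I z₀) t → t ≠ 0 →
      ∃ q : ℚ, shaAn W = (q : ℂ) ∧
        t.valuation - 2 * (logOmega W p (P (Fin.cast h1.symm 0))).valuation ≤
          padicValRat p q + padicValNat p W.tamagawaProduct - 2 * padicValNat p W.torsionOrder - 1 := by
  intro W _ _ p _ _ hX h5 hS hns h1 P hP K hK γ I z₀ hγ hz t hlog ht
  obtain ⟨-, -, -, -, -, h32, hVC, -, -⟩ := stub_printedFactsHeldNonsplit
  haveI hN : NeZero (W.conductorNorm ℤ) := ⟨(W.conductorNorm_pos_holds).ne'⟩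
  exact valuationIneq_core_of_crossing hX h5 h1 P hP t.valuation
    (fun L _ _ hLq hH hHp hd4 hodd hLt Dt Hd w₀ PL hPL hc hinf s k hs hk W' _ D hDf hmin =>
      bstwCrossingNonsplit h32 hVC W p hX h5 hS hns (by omega) L hLq hH hHp hd4 hodd hLt Dt Hd w₀ PL hPL hc hinf s k hs hk
        W' D hDf hmin K hK γ I z₀ hγ hz t hlog ht)

/-- **r5.6's `stub_valuationIneqNonsplit` VERBATIM from the three stubs** (= the binder `hVnonsplit` of
`ErratumRoadFiveKatoFframeValueAtoms.integralNonsplitValue_of_atoms`, p766845 — referee g86 token record 821 chars; since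
2026-08-30T10:34:10Z the REGISTERED research stub of the line of record `Lines/kato_Fframe_r5.lean` bd976d191c265a9a): the research
ATOM of S3ns, a pure valuation inequality for ANY Kummer logarithm `t ≠ 0` of the bottom layer of an ADMISSIBLE zeta class and ANY
rational `q` with `#Ш_an = q`.  Since rev 3.7 obtained from the FAMILY-LEVEL theorem `famValuationIneqNonsplit_of_stubs` by the LEAD's
`ErratumRoadFiveKatoFframeValueAtomsOfFamily.valuationIneqNonsplit_of_family` (p769350) BY NAME — the kernel thereby re-certifies that
(i) `famValuationIneqNonsplit_of_stubs` has EXACTLY the type of the LEAD's binder `hFamNonsplit` and (ii) this theorem EXACTLY the type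
of the registered stub.  Hypothesis-free modulo S0′ ∧ A♯-print ∧ A♭-fam.  No r5.5/r5.6 stub, no crux and no summit statement is proved
here: A♭-fam is a `sorry`. [cite: Kato2004Asterisque, Thm. 12.5 (1) (pp. 221–222), Ex. 13.3 (p. 225), Lemma 13.10 (1) (p. 230)] -/
theorem valuationIneqNonsplit_of_stubs :
    ∀ (W : WeierstrassCurve ℚ) [W.IsElliptic] [W.IsGloballyMinimal] (p : ℕ) [Fact p.Prime]
      [ContinuousSMul ℤ_[p] (W.tateModule p)],
      ClassX11b W p → 5 ≤ p → Surj W p → ¬ W.HasSplitMultiplicativeReductionAtPrime p →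
      ∀ (h1 : W.mordellWeilRank = 1) (P : Fin W.mordellWeilRank → W.toAffine.Point),
        W.IsMordellWeilBasis P →
      ∀ (K : ZpExtension ℚ p) (hK : K.IsCyclotomic) (γ : absoluteGaloisGroup ℚ)
        (I : IwasawaH1Data W p K γ) (z₀ : I.H), K.IsTopGenerator γ → IsAdmissibleZetaClass W p K hK I z₀ →
      ∀ t : ℚ_[p], HasLocPKummerLog W p (layerZeroToTop W p K (I.proj 0 z₀)) t → t ≠ 0 →
      ∀ q : ℚ, shaAn W = (q : ℂ) →
        t.valuation -
            2 * (padicLogLocal W p (WeierstrassCurve.Affine.Point.map (Algebra.ofId ℚ ℚ_[p]) (P (Fin.cast h1.symm 0)))).valuation ≤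
          padicValRat p q + padicValNat p W.tamagawaProduct - 2 * padicValNat p W.torsionOrder - 1 :=
  ErratumRoadFiveKatoFframeValueAtomsOfFamily.valuationIneqNonsplit_of_family famValuationIneqNonsplit_of_stubs

/-- (rev ≤ 3.6's direct proof of the same statement from the admissible core, kept as a second certificate.) [folklore] -/
theorem valuationIneqNonsplit_of_stubs' :
    ∀ (W : WeierstrassCurve ℚ) [W.IsElliptic] [W.IsGloballyMinimal] (p : ℕ) [Fact p.Prime]
      [ContinuousSMul ℤ_[p] (W.tateModule p)],
      ClassX11b W p → 5 ≤ p → Surj W p → ¬ W.HasSplitMultiplicativeReductionAtPrime p →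
      ∀ (h1 : W.mordellWeilRank = 1) (P : Fin W.mordellWeilRank → W.toAffine.Point),
        W.IsMordellWeilBasis P →
      ∀ (K : ZpExtension ℚ p) (hK : K.IsCyclotomic) (γ : absoluteGaloisGroup ℚ)
        (I : IwasawaH1Data W p K γ) (z₀ : I.H), K.IsTopGenerator γ → IsAdmissibleZetaClass W p K hK I z₀ →
      ∀ t : ℚ_[p], HasLocPKummerLog W p (layerZeroToTop W p K (I.proj 0 z₀)) t → t ≠ 0 →
      ∀ q : ℚ, shaAn W = (q : ℂ) →
        t.valuation -
            2 * (padicLogLocal W p (WeierstrassCurve.Affine.Point.map (Algebra.ofId ℚ ℚ_[p]) (P (Fin.cast h1.symm 0)))).valuation ≤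
          padicValRat p q + padicValNat p W.tamagawaProduct - 2 * padicValNat p W.torsionOrder - 1 := by
  intro W _ _ p _ _ hX h5 hS hns h1 P hP K hK γ I z₀ hγ hz t ht ht0 q hq
  obtain ⟨q₀, hq₀, hineq⟩ := valuationIneqNonsplit_core W p hX h5 hS hns h1 P hP K hK γ I z₀ hγ hz t ht ht0
  obtain rfl : q = q₀ := Rat.cast_injective (hq.symm.trans hq₀)
  exact hineq

/-- **r5.5's S3ns (`KatoFframe.stub_integralNonsplitValue`, the registered stub UNTIL 10:34:10Z, r5.5 l.677–687 = r5.4 l.672–684;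
in the keyed r5.6 a THEOREM of the atoms with the same statement, 746/746) VERBATIM, modulo the PRINT binder `hNZ`** = `hNZnonsplit` of `ErratumRoadFiveKatoFframeValueAtoms.integralNonsplitValue_of_atoms` verbatim
(Bertolini–Darmon–Venerucci 2022 Thm. A at a non-split multiplicative `p ≥ 5` with `ρ̄` onto: every Kummer logarithm of the
bottom layer of an admissible class is `≠ 0`; transcription Kim 2022 Thm. 2.1 / Cor. 2.3) — discharged TODAY by
`ErratumRoadFiveKatoFframeNonvanishingOfPrint.kummerLog_ne_zero_nonsplit_of_bdv` (p768140) from the named fact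
`BertoliniDarmonVenerucci2022_kummerLog_bottomLayer_ne_zero`, whose typing is under referee revision (GAP l.139: add a
`HasIrreducibleModPGaloisRep` binder; `ρ̄` onto ⇒ irreducible, so the BINDER shape is stable) — hence a binder here, not the
fact's name.  `t` itself is the tree THEOREM `ErratumRoadFiveKatoFframeValueAtoms.exists_hasLocPKummerLog_bottomClass`
(Kummer theory in positive rank; p766845).  Up to rev 3.3 this composition was hypothesis-free because A♭ carried `∃ t … ∧ t ≠ 0`;
rev 3.4 moves those two print atoms OUT of the research stub.  No r5.5 stub, no crux and no summit statement is proved here.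
[cite: BertoliniDarmonVenerucci2022, Thm. A] [cite: Kim2022, Thm. 2.1 and Cor. 2.3] [cite: GrossZagier1986, Thm. I.(7.3)] -/
theorem integralNonsplitValue_of_stubs
    (hNZ : ∀ (W : WeierstrassCurve ℚ) [W.IsElliptic] [W.IsGloballyMinimal] (p : ℕ) [Fact p.Prime]
      [ContinuousSMul ℤ_[p] (W.tateModule p)],
      5 ≤ p → Surj W p → W.analyticRank = 1 → W.HasMultiplicativeReductionAtPrime p →
      ¬ W.HasSplitMultiplicativeReductionAtPrime p →
      ∀ (K : ZpExtension ℚ p) (hK : K.IsCyclotomic) (γ : absoluteGaloisGroup ℚ)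
        (I : IwasawaH1Data W p K γ) (z₀ : I.H), K.IsTopGenerator γ → IsAdmissibleZetaClass W p K hK I z₀ →
      ∀ t : ℚ_[p], HasLocPKummerLog W p (layerZeroToTop W p K (I.proj 0 z₀)) t → t ≠ 0) :
    ∀ (W : WeierstrassCurve ℚ) [W.IsElliptic] [W.IsGloballyMinimal] (p : ℕ) [Fact p.Prime]
      [ContinuousSMul ℤ_[p] (W.tateModule p)],
      ClassX11b W p → 5 ≤ p → Surj W p → ¬ W.HasSplitMultiplicativeReductionAtPrime p →
      ∀ (h1 : W.mordellWeilRank = 1) (P : Fin W.mordellWeilRank → W.toAffine.Point),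
        W.IsMordellWeilBasis P →
      ∀ (K : ZpExtension ℚ p) (hK : K.IsCyclotomic) (γ : absoluteGaloisGroup ℚ)
        (I : IwasawaH1Data W p K γ) (z₀ : I.H), K.IsTopGenerator γ → IsAdmissibleZetaClass W p K hK I z₀ →
      ∃ (q : ℚ) (t : ℚ_[p]), shaAn W = (q : ℂ) ∧ HasLocPKummerLog W p (bottomClass W p K I z₀) t ∧ t ≠ 0 ∧
        t.valuation - 2 * (logOmega W p (P (Fin.cast h1.symm 0))).valuation ≤
          padicValRat p q + padicValNat p W.tamagawaProduct - 2 * padicValNat p W.torsionOrder - 1 := by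
  intro W _ _ p _ _ hX h5 hS hns h1 P hP K hK γ I z₀ hγ hz
  -- `∃ t`: Kummer theory in positive rank (tree theorem, p766845)
  obtain ⟨t, ht⟩ :=
    Summit.BirchSwinnertonDyer.BirchSwinnertonDyer.Theorems.ErratumRoadFiveKatoFframeValueAtoms.exists_hasLocPKummerLog_bottomClass
      W p (by omega) K I z₀
  -- `t ≠ 0`: print (BDV 2022 Thm. A), the binder `hNZ`
  have ht0 : t ≠ 0 := hNZ W p h5 hS hX.1 hX.2.2.1 hns K hK γ I z₀ hγ hz t ht
  obtain ⟨q, hq, hineq⟩ := valuationIneqNonsplit_core W p hX h5 hS hns h1 P hP K hK γ I z₀ hγ hz t ht ht0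
  exact ⟨q, t, hq, ht, ht0, hineq⟩

/-! ## §3b The SPLIT compositions (rev 3.8; no sorry below): the family core and the LEAD's `hFamSplit` VERBATIM; the admissible
core and r5.6's `stub_valuationIneqSplit` VERBATIM (twice); r5.5's S3 VERBATIM modulo the print binder `hNZsplit` — all from the
sign-free halves A♯ ∕ B ∕ glue and the FOURTH stub A♭-fam-split -/

/-- **Family core, SPLIT sign (rev 3.8):** the statement of `valuationIneqNonsplitFamily_core` at a SPLIT multiplicative `p` —
B's rational `qSha = #Ш_an` and the family-level valuation inequality — from S0′ ∧ A♯-print ∧ A♭-fam-split ∧ B: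
`valuationIneq_core_of_crossing` (sign-free) fed with `bstwCrossingSplitFamily`.  No registered stub, no crux and no summit
statement is proved here: A♭-fam-split is a `sorry`. [cite: GrossZagier1986, Thm. I.(7.3)] [cite: Kato2004Asterisque, Thm. 12.5 (1) (pp. 221–222)] -/
theorem valuationIneqSplitFamily_core :
    ∀ (W : WeierstrassCurve ℚ) [W.IsElliptic] [W.IsGloballyMinimal] (p : ℕ) [Fact p.Prime]
      [ContinuousSMul ℤ_[p] (W.tateModule p)] [Module.Free ℤ_[p] (W.tateModule p)] [Module.Finite ℤ_[p] (W.tateModule p)],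
      ClassX11b W p → 5 ≤ p → Surj W p → W.HasSplitMultiplicativeReductionAtPrime p →
      ∀ (h1 : W.mordellWeilRank = 1) (P : Fin W.mordellWeilRank → W.toAffine.Point),
        W.IsMordellWeilBasis P →
      ∀ (K : ZpExtension ℚ p) (hK : K.IsCyclotomic) (γ : absoluteGaloisGroup ℚ)
        (I : IwasawaH1Data W p K γ), K.IsTopGenerator γ →
      ∀ (hp : p ≠ 2) (N : ℕ) [NeZero N] (f : CuspForm (Gamma0 N) 2), IsNewformOf W f →
      ∀ (ι : (n : ℕ) → (CyclotomicField n ℚ →+* ℂ)) (q : ℚ)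
        (Λ : ∀ (m : ℕ) (r : Finset (HeightOneSpectrum (𝓞 ℚ))),
          H1 (tateRep W p) (cycSubgroup p m r) →ₗ[ℤ_[p]] ℚ_[p] ⊗[ℚ] CyclotomicField (cycLevel p m r) ℚ)
        (c d₁ a : ℤ) (A : ℕ) (d' : ℤ)
        (z : ∀ (m : ℕ) (r : (cyclotomicLevelsRat p (badPlaces c d₁ A N)).Ideals),
          H1 (tateRep W p) ((cyclotomicLevelsRat p (badPlaces c d₁ A N)).level m r.1))
        (x : ∀ (m : ℕ) (r : (cyclotomicLevelsRat p (badPlaces c d₁ A N)).Ideals),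
          CyclotomicField (cycLevel p m r.1) ℚ)
        (y : I.H) (perRatio : ℚ),
        q ≠ 0 → ZetaBody W p f ι ((q : ℚ) : ℝ) Λ c d₁ a A z x →
        (∀ n : ℕ, I.proj n y =
          levelToLayer W p hK hp (badPlaces c d₁ A N) n
            (z (n + 1) (cyclotomicLevelsRat p (badPlaces c d₁ A N)).idealOne)) →
        0 < A → Int.gcd c (6 * p * A) = 1 → Int.gcd d₁ (6 * p * N) = 1 → (d₁ : ℤ) * d' ≡ 1 [ZMOD (A : ℤ)] →
        ratCuspFactor f true c d₁ a A d' ≠ 0 → perRatio ≠ 0 →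
        plusPeriod f = ((perRatio : ℚ) : ℝ) * W.realPeriodRat →
      ∀ σ : ℚ_[p], HasLocPKummerLog W p (bottomClass W p K I y) σ → σ ≠ 0 →
      ∃ qSha : ℚ, shaAn W = (qSha : ℂ) ∧
        σ.valuation +
              padicValRat p (perRatio /
                (q * ratCuspFactor f true c d₁ a A d' * ∏ ℓ ∈ A.primeFactors.erase p, eulerFactorAtOne W N ℓ)) -
            2 * (logOmega W p (P (Fin.cast h1.symm 0))).valuation ≤
          padicValRat p qSha + padicValNat p W.tamagawaProduct - 2 * padicValNat p W.torsionOrder - 1 := by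
  intro W _ _ p _ _ _ _ hX h5 hS hsp h1 P hP K hK γ I hγ hp N _ f hf ι q Λ c d₁ a A d' z x y perRatio
    hq hzeta hy hA hcg hd hdd' hR hper0 hper σ hσ hσ0
  obtain ⟨-, -, -, -, -, h32, hVC, -, -⟩ := stub_printedFactsHeldNonsplit
  haveI hN : NeZero (W.conductorNorm ℤ) := ⟨(W.conductorNorm_pos_holds).ne'⟩
  exact valuationIneq_core_of_crossing hX h5 h1 P hP
    (σ.valuation + padicValRat p (perRatio /
      (q * ratCuspFactor f true c d₁ a A d' * ∏ ℓ ∈ A.primeFactors.erase p, eulerFactorAtOne W N ℓ)))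
    (fun L _ _ hLq hH hHp hd4 hodd hLt Dt Hd w₀ PL hPL hc hinf sB k hsB hk W' _ D hDf hmin =>
      bstwCrossingSplitFamily h32 hVC W p hX h5 hS hsp L hLq hH hHp hd4 hodd hLt Dt Hd w₀ PL hPL hc hinf sB k hsB hk
        W' D hDf hmin K hK γ I hγ hp N f hf ι q Λ c d₁ a A d' z x y perRatio hq hzeta hy hA hcg hd hdd' hR hper0 hper σ hσ hσ0)

/-- **The LEAD's FAMILY-LEVEL binder `hFamSplit` of `ErratumRoadFiveKatoFframeValueAtomsOfFamily.valuationIneqSplit_of_family`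
(p769350) VERBATIM, from S0′ ∧ A♯-print ∧ A♭-fam-split** (rev 3.8's split dock; the tree text of `hFamSplit` is `hFamNonsplit` with the
sign flag flipped — 1984/1984 chars whitespace-normalised against the tree bytes; `qSha` pinned to B's by `Rat.cast_injective`).  No
registered stub, no crux and no summit statement is proved here: A♭-fam-split is a `sorry`.
[cite: Kato2004Asterisque, Thm. 12.5 (1) (pp. 221–222), Ex. 13.3 (p. 225), Lemma 13.10 (1) (p. 230)] -/
theorem famValuationIneqSplit_of_stubs :
    ∀ (W : WeierstrassCurve ℚ) [W.IsElliptic] [W.IsGloballyMinimal] (p : ℕ) [Fact p.Prime]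
      [ContinuousSMul ℤ_[p] (W.tateModule p)] [Module.Free ℤ_[p] (W.tateModule p)] [Module.Finite ℤ_[p] (W.tateModule p)],
      ClassX11b W p → 5 ≤ p → Surj W p → W.HasSplitMultiplicativeReductionAtPrime p →
      ∀ (h1 : W.mordellWeilRank = 1) (P : Fin W.mordellWeilRank → W.toAffine.Point),
        W.IsMordellWeilBasis P →
      ∀ (K : ZpExtension ℚ p) (hK : K.IsCyclotomic) (γ : absoluteGaloisGroup ℚ)
        (I : IwasawaH1Data W p K γ), K.IsTopGenerator γ →
      ∀ (hp : p ≠ 2) (N : ℕ) [NeZero N] (f : CuspForm (Gamma0 N) 2), IsNewformOf W f →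
      ∀ (ι : (n : ℕ) → (CyclotomicField n ℚ →+* ℂ)) (q : ℚ)
        (Λ : ∀ (k : ℕ) (r : Finset (HeightOneSpectrum (𝓞 ℚ))),
          H1 (tateRep W p) (cycSubgroup p k r) →ₗ[ℤ_[p]] ℚ_[p] ⊗[ℚ] CyclotomicField (cycLevel p k r) ℚ)
        (c d₁ a : ℤ) (A : ℕ) (d' : ℤ)
        (z : ∀ (k : ℕ) (r : (cyclotomicLevelsRat p (badPlaces c d₁ A N)).Ideals),
          H1 (tateRep W p) ((cyclotomicLevelsRat p (badPlaces c d₁ A N)).level k r.1))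
        (x : ∀ (k : ℕ) (r : (cyclotomicLevelsRat p (badPlaces c d₁ A N)).Ideals),
          CyclotomicField (cycLevel p k r.1) ℚ)
        (y : I.H) (perRatio : ℚ),
        q ≠ 0 → ZetaBody W p f ι ((q : ℚ) : ℝ) Λ c d₁ a A z x →
        (∀ n : ℕ, I.proj n y =
          levelToLayer W p hK hp (badPlaces c d₁ A N) n
            (z (n + 1) (cyclotomicLevelsRat p (badPlaces c d₁ A N)).idealOne)) →
        0 < A → Int.gcd c (6 * p * A) = 1 → Int.gcd d₁ (6 * p * N) = 1 → (d₁ : ℤ) * d' ≡ 1 [ZMOD (A : ℤ)] →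
        ratCuspFactor f true c d₁ a A d' ≠ 0 → perRatio ≠ 0 →
        plusPeriod f = ((perRatio : ℚ) : ℝ) * W.realPeriodRat →
      ∀ s : ℚ_[p], HasLocPKummerLog W p (layerZeroToTop W p K (I.proj 0 y)) s → s ≠ 0 →
      ∀ qSha : ℚ, shaAn W = (qSha : ℂ) →
        s.valuation +
              padicValRat p (perRatio /
                (q * ratCuspFactor f true c d₁ a A d' * ∏ ℓ ∈ A.primeFactors.erase p, eulerFactorAtOne W N ℓ)) -
            2 * (padicLogLocal W p (WeierstrassCurve.Affine.Point.map (Algebra.ofId ℚ ℚ_[p]) (P (Fin.cast h1.symm 0)))).valuation ≤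
          padicValRat p qSha + padicValNat p W.tamagawaProduct - 2 * padicValNat p W.torsionOrder - 1 := by
  intro W _ _ p _ _ _ _ hX h5 hS hsp h1 P hP K hK γ I hγ hp N _ f hf ι q Λ c d₁ a A d' z x y perRatio
    hq hzeta hy hA hcg hd hdd' hR hper0 hper s hs hs0 qSha hqSha
  obtain ⟨q₀, hq₀, hineq⟩ := valuationIneqSplitFamily_core W p hX h5 hS hsp h1 P hP K hK γ I hγ hp N f hf ι q Λ
    c d₁ a A d' z x y perRatio hq hzeta hy hA hcg hd hdd' hR hper0 hper s hs hs0
  obtain rfl : qSha = q₀ := Rat.cast_injective (hqSha.symm.trans hq₀)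
  exact hineq

/-- **Admissible core, SPLIT sign (rev 3.8):** the statement of `valuationIneqNonsplit_core` at a SPLIT multiplicative `p`, from
S0′ ∧ A♯-print ∧ A♭-fam-split ∧ B (`valuationIneq_core_of_crossing` fed with `bstwCrossingSplit`; positive rank from `h1`).  No registered
stub, no crux and no summit statement is proved here: A♭-fam-split is a `sorry`. [cite: GrossZagier1986, Thm. I.(7.3)] -/
theorem valuationIneqSplit_core :
    ∀ (W : WeierstrassCurve ℚ) [W.IsElliptic] [W.IsGloballyMinimal] (p : ℕ) [Fact p.Prime]
      [ContinuousSMul ℤ_[p] (W.tateModule p)],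
      ClassX11b W p → 5 ≤ p → Surj W p → W.HasSplitMultiplicativeReductionAtPrime p →
      ∀ (h1 : W.mordellWeilRank = 1) (P : Fin W.mordellWeilRank → W.toAffine.Point),
        W.IsMordellWeilBasis P →
      ∀ (K : ZpExtension ℚ p) (hK : K.IsCyclotomic) (γ : absoluteGaloisGroup ℚ)
        (I : IwasawaH1Data W p K γ) (z₀ : I.H), K.IsTopGenerator γ → IsAdmissibleZetaClass W p K hK I z₀ →
      ∀ t : ℚ_[p], HasLocPKummerLog W p (bottomClass W p K I z₀) t → t ≠ 0 →
      ∃ q : ℚ, shaAn W = (q : ℂ) ∧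
        t.valuation - 2 * (logOmega W p (P (Fin.cast h1.symm 0))).valuation ≤
          padicValRat p q + padicValNat p W.tamagawaProduct - 2 * padicValNat p W.torsionOrder - 1 := by
  intro W _ _ p _ _ hX h5 hS hsp h1 P hP K hK γ I z₀ hγ hz t hlog ht
  obtain ⟨-, -, -, -, -, h32, hVC, -, -⟩ := stub_printedFactsHeldNonsplit
  haveI hN : NeZero (W.conductorNorm ℤ) := ⟨(W.conductorNorm_pos_holds).ne'⟩
  exact valuationIneq_core_of_crossing hX h5 h1 P hP t.valuation
    (fun L _ _ hLq hH hHp hd4 hodd hLt Dt Hd w₀ PL hPL hc hinf s k hs hk W' _ D hDf hmin =>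
      bstwCrossingSplit h32 hVC W p hX h5 hS hsp (by omega) L hLq hH hHp hd4 hodd hLt Dt Hd w₀ PL hPL hc hinf s k hs hk
        W' D hDf hmin K hK γ I z₀ hγ hz t hlog ht)

/-- **r5.6's REGISTERED split atom `stub_valuationIneqSplit` VERBATIM from S0′ ∧ A♯-print ∧ A♭-fam-split** (rev 3.8; = the binder
`hVsplit` of `ErratumRoadFiveKatoFframeValueAtoms.integralExcZeroValue_of_atoms`, p766845 — referee g86 token record 819 chars; the
registered research stub of the line of record `Lines/kato_Fframe_r5.lean` bd976d191c265a9a at a SPLIT `p`): obtained from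
`famValuationIneqSplit_of_stubs` by the LEAD's `ErratumRoadFiveKatoFframeValueAtomsOfFamily.valuationIneqSplit_of_family` (p769350) BY
NAME — the kernel thereby certifies that (i) `famValuationIneqSplit_of_stubs` has EXACTLY the type of the LEAD's binder `hFamSplit` and
(ii) this theorem EXACTLY the type of the registered split stub (819/819 chars whitespace-normalised against the tree bytes).  No r5.5/r5.6
stub, no crux and no summit statement is proved here: A♭-fam-split is a `sorry` — and, unlike A♭-fam, one WITHOUT a printed mechanism
(see its docstring). [cite: Venerucci2016, Thm. A (arXiv:1407.1913 p. 3)] [cite: Kato2004Asterisque, Thm. 12.5 (1) (pp. 221–222)] -/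
theorem valuationIneqSplit_of_stubs :
    ∀ (W : WeierstrassCurve ℚ) [W.IsElliptic] [W.IsGloballyMinimal] (p : ℕ) [Fact p.Prime]
      [ContinuousSMul ℤ_[p] (W.tateModule p)],
      ClassX11b W p → 5 ≤ p → Surj W p → W.HasSplitMultiplicativeReductionAtPrime p →
      ∀ (h1 : W.mordellWeilRank = 1) (P : Fin W.mordellWeilRank → W.toAffine.Point),
        W.IsMordellWeilBasis P →
      ∀ (K : ZpExtension ℚ p) (hK : K.IsCyclotomic) (γ : absoluteGaloisGroup ℚ)
        (I : IwasawaH1Data W p K γ) (z₀ : I.H), K.IsTopGenerator γ → IsAdmissibleZetaClass W p K hK I z₀ →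
      ∀ t : ℚ_[p], HasLocPKummerLog W p (layerZeroToTop W p K (I.proj 0 z₀)) t → t ≠ 0 →
      ∀ q : ℚ, shaAn W = (q : ℂ) →
        t.valuation -
            2 * (padicLogLocal W p (WeierstrassCurve.Affine.Point.map (Algebra.ofId ℚ ℚ_[p]) (P (Fin.cast h1.symm 0)))).valuation ≤
          padicValRat p q + padicValNat p W.tamagawaProduct - 2 * padicValNat p W.torsionOrder - 1 :=
  ErratumRoadFiveKatoFframeValueAtomsOfFamily.valuationIneqSplit_of_family famValuationIneqSplit_of_stubs

/-- (The same statement directly from the split admissible core, a second certificate.) [folklore] -/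
theorem valuationIneqSplit_of_stubs' :
    ∀ (W : WeierstrassCurve ℚ) [W.IsElliptic] [W.IsGloballyMinimal] (p : ℕ) [Fact p.Prime]
      [ContinuousSMul ℤ_[p] (W.tateModule p)],
      ClassX11b W p → 5 ≤ p → Surj W p → W.HasSplitMultiplicativeReductionAtPrime p →
      ∀ (h1 : W.mordellWeilRank = 1) (P : Fin W.mordellWeilRank → W.toAffine.Point),
        W.IsMordellWeilBasis P →
      ∀ (K : ZpExtension ℚ p) (hK : K.IsCyclotomic) (γ : absoluteGaloisGroup ℚ)
        (I : IwasawaH1Data W p K γ) (z₀ : I.H), K.IsTopGenerator γ → IsAdmissibleZetaClass W p K hK I z₀ →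
      ∀ t : ℚ_[p], HasLocPKummerLog W p (layerZeroToTop W p K (I.proj 0 z₀)) t → t ≠ 0 →
      ∀ q : ℚ, shaAn W = (q : ℂ) →
        t.valuation -
            2 * (padicLogLocal W p (WeierstrassCurve.Affine.Point.map (Algebra.ofId ℚ ℚ_[p]) (P (Fin.cast h1.symm 0)))).valuation ≤
          padicValRat p q + padicValNat p W.tamagawaProduct - 2 * padicValNat p W.torsionOrder - 1 := by
  intro W _ _ p _ _ hX h5 hS hsp h1 P hP K hK γ I z₀ hγ hz t ht ht0 q hq
  obtain ⟨q₀, hq₀, hineq⟩ := valuationIneqSplit_core W p hX h5 hS hsp h1 P hP K hK γ I z₀ hγ hz t ht ht0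
  obtain rfl : q = q₀ := Rat.cast_injective (hq.symm.trans hq₀)
  exact hineq

/-- **r5.5's S3 (`KatoFframe.stub_integralExcZeroValue`, the registered door stub until 10:34:10Z; in the keyed r5.6 a THEOREM of
the atoms with the same statement, 744/744 chars) VERBATIM, modulo the PRINT binder `hNZ`** = `hNZsplit` of
`ErratumRoadFiveKatoFframeValueAtoms.integralExcZeroValue_of_atoms` verbatim (466/466: at a SPLIT multiplicative `p ≥ 5` with `ρ̄` onto
and analytic rank one, every Kummer logarithm of the bottom layer of an admissible class is `≠ 0` — Venerucci 2016 Thm. A, discharged on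
the line of record from the named fact `Venerucci2016_kummerLog_bottomLayer_ne_zero_split`; a binder here, as for S3ns, so that this
file does not depend on the fact's final typing).  `t` itself is the tree THEOREM `exists_hasLocPKummerLog_bottomClass` (p766845).  No
r5.5 stub, no crux and no summit statement is proved here: A♭-fam-split is a `sorry`.
[cite: Venerucci2016, Thm. A (arXiv:1407.1913 p. 3)] [cite: GrossZagier1986, Thm. I.(7.3)] -/
theorem integralExcZeroValue_of_stubs
    (hNZ : ∀ (W : WeierstrassCurve ℚ) [W.IsElliptic] [W.IsGloballyMinimal] (p : ℕ) [Fact p.Prime]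
      [ContinuousSMul ℤ_[p] (W.tateModule p)],
      5 ≤ p → Surj W p → W.analyticRank = 1 → W.HasSplitMultiplicativeReductionAtPrime p →
      ∀ (K : ZpExtension ℚ p) (hK : K.IsCyclotomic) (γ : absoluteGaloisGroup ℚ)
        (I : IwasawaH1Data W p K γ) (z₀ : I.H), K.IsTopGenerator γ → IsAdmissibleZetaClass W p K hK I z₀ →
      ∀ t : ℚ_[p], HasLocPKummerLog W p (layerZeroToTop W p K (I.proj 0 z₀)) t → t ≠ 0) :
    ∀ (W : WeierstrassCurve ℚ) [W.IsElliptic] [W.IsGloballyMinimal] (p : ℕ) [Fact p.Prime]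
      [ContinuousSMul ℤ_[p] (W.tateModule p)],
      ClassX11b W p → 5 ≤ p → Surj W p → W.HasSplitMultiplicativeReductionAtPrime p →
      ∀ (h1 : W.mordellWeilRank = 1) (P : Fin W.mordellWeilRank → W.toAffine.Point),
        W.IsMordellWeilBasis P →
      ∀ (K : ZpExtension ℚ p) (hK : K.IsCyclotomic) (γ : absoluteGaloisGroup ℚ)
        (I : IwasawaH1Data W p K γ) (z₀ : I.H), K.IsTopGenerator γ → IsAdmissibleZetaClass W p K hK I z₀ →
      ∃ (q : ℚ) (t : ℚ_[p]), shaAn W = (q : ℂ) ∧ HasLocPKummerLog W p (bottomClass W p K I z₀) t ∧ t ≠ 0 ∧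
        t.valuation - 2 * (logOmega W p (P (Fin.cast h1.symm 0))).valuation ≤
          padicValRat p q + padicValNat p W.tamagawaProduct - 2 * padicValNat p W.torsionOrder - 1 := by
  intro W _ _ p _ _ hX h5 hS hsp h1 P hP K hK γ I z₀ hγ hz
  -- `∃ t`: Kummer theory in positive rank (tree theorem, p766845)
  obtain ⟨t, ht⟩ :=
    Summit.BirchSwinnertonDyer.BirchSwinnertonDyer.Theorems.ErratumRoadFiveKatoFframeValueAtoms.exists_hasLocPKummerLog_bottomClass
      W p (by omega) K I z₀
  -- `t ≠ 0`: print (Venerucci 2016 Thm. A), the binder `hNZ`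
  have ht0 : t ≠ 0 := hNZ W p h5 hS hX.1 hsp K hK γ I z₀ hγ hz t ht
  obtain ⟨q, hq, hineq⟩ := valuationIneqSplit_core W p hX h5 hS hsp h1 P hP K hK γ I z₀ hγ hz t ht ht0
  exact ⟨q, t, hq, ht, ht0, hineq⟩

/-! ## §6 (rev 3.9) Docking at the r5.7 registry BY NAME — the aside items `KatoValuationIneqNonsplitAtFive` (33169) and
`KatoValuationIneqSplitAtFive` (33168) of route ER5, to which r5.7's `stub_valuationIneqNonsplit` ∕ `stub_valuationIneqSplit` are bound -/

/-- **r5.7 docking, NON-split atom BY NAME** (modulo S0′ ∧ A♭-fam): the door's composition `valuationIneqNonsplit_of_stubs` IS route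
ER5's aside item `KatoValuationIneqNonsplitAtFive` (stmt 33169; r5.7 `stub_valuationIneqNonsplit : KatoValuationIneqNonsplitAtFive`) —
the item's body is r5.6's atom text verbatim, so the proof is the rev-3.7 theorem itself (definitional unfolding). Proves nothing
unconditionally: A♭-fam is research. -/
theorem katoValuationIneqNonsplitAtFive_of_stubs :
    Summit.BirchSwinnertonDyer.BirchSwinnertonDyer.Theses.ErratumRoadFive.KatoValuationIneqNonsplitAtFive :=
  valuationIneqNonsplit_of_stubs

/-- **r5.7 docking, SPLIT atom BY NAME** (modulo S0′ ∧ A♭-fam-split): `valuationIneqSplit_of_stubs` IS route ER5's aside item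
`KatoValuationIneqSplitAtFive` (stmt 33168; r5.7 `stub_valuationIneqSplit : KatoValuationIneqSplitAtFive`), by definitional unfolding.
Proves nothing unconditionally: A♭-fam-split is research without a printed mechanism. -/
theorem katoValuationIneqSplitAtFive_of_stubs :
    Summit.BirchSwinnertonDyer.BirchSwinnertonDyer.Theses.ErratumRoadFive.KatoValuationIneqSplitAtFive :=
  valuationIneqSplit_of_stubs

end Summit.BirchSwinnertonDyer.BirchSwinnertonDyer.Cruxes.EulerHalfNotRamNoInertSetAtFive.BstwZetaNonsplit
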